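import Mathlib
import Literature.MathematicalPhysics.QuantumFieldTheory.Balaban1983to89.B6RandomWalk
import Literature.MathematicalPhysics.QuantumFieldTheory.Balaban1983to89.B9Thm34Ext

/-!
# `Balaban1983to89.B6RandomWalkHom` — the block-majorant calculus of [Balaban1984PropagatorsII] (2.51)–(2.66) between
TWO function spaces, the Neumann step for LEFT ENTRIES E·G of a right fixed point G = G₀ + G·R ((3.65), (3.130),
(3.138) of [Balaban1985BackgroundPropagators]), and the local-perturbation step behind [Balaban1985Variational] p. 306
*"defining G = (Δ_a − Δ^{(2)})^{−1} … the new operator G has exactly the same properties as Δ_a^{−1}"* — kernel-checked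
bookkeeping, 0 sorry

CITATION HEADER (lean-in-tree rule 2026-08-18).  Sources — all published; the cell `pub-balaban` adjudicates them, so
their disputed steps enter below as HYPOTHESES OF THE PRINTED SHAPE, never as cited facts:
[4] = T. Bałaban, *Propagators and renormalization transformations for lattice gauge theories. II*, Commun. Math.
Phys. **96**, 223–250 (1984), doi:10.1007/bf01240221 [Balaban1984PropagatorsII] (cell paper B6; journal page = PDF
page + 222); B9 = T. Bałaban, *Propagators for lattice gauge theories in a background field*, Commun. Math. Phys.
**99**, 389–434 (1985) [Balaban1985BackgroundPropagators] (held `paper:balaban1985-cmp99-background-propagators`,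
journal page = PDF page + 388; quotations read from the renders `b2b-balaban-ref1/pages/1985-cmp99-background-
propagators/…-p009,p010,p011,p014,p015,p033,p034,p035-x2.png` = pp. 397, 398, 399, 402, 403, 421, 422, 423);
B11 = T. Bałaban, *The variational problem and background fields in renormalization group method for lattice gauge
theories*, Commun. Math. Phys. **102**, 277–309 (1985), doi:10.1007/bf01229381 [Balaban1985Variational] (journal
page = PDF page + 276; render `…/1985-cmp102-variational-background/…-p030-x2.png` = p. 306).
SIBLINGS REUSED (imported, not restated, not modified): `…B6RandomWalk` (unit pv08: `HasMajorant`, `hasMajorant_mul`,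
`majorant_pow_265`, `majorant_G0_mul_265`, `majorant_partialSum_266`, `majorant_of_fixedPoint_266` = the kernel chain
(2.52) ⇒ (2.64) ⇒ (2.65) ⇒ (2.66) of Prop. 2.2 [4] pp. 232–234, for RIGHT fixed points G′ = G′₀ + G′R of ONE function
space); `…B9Thm34Ext` (unit b09-g2: the transport `toB6` of a B9 geometry to a B6 geometry, and the FIRST entry of
(3.42) for G′(U′U), `gpExt_entry1_of_365` — whose docstring (iii) leaves *"the ∇_U-entry … once ∇_UG′ is viewed as an
operator into bond functions — pv08's calculus is typed for endomorphisms of ONE function space"*: this module is that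
typing).  The general two-space vocabulary over ABSTRACT block norms is `…B11SectG.HasMaj` (unit b11-g2, LEFT fixed
points 𝔄₀ = S + K′𝔄₀, `neumann_majorant`); the present module stays in pv08's sharp-block sup vocabulary (the one
`…B9Thm34Ext`, `…B9Thm34Inv`, `…B8Ineq192` consume) and treats RIGHT fixed points S = S₀ + S·R, which is the printed
form of (3.65)₂, (3.130), (3.138).

THE PRINTED STEPS (verbatim, from the renders).
* B9 p. 397 [PDF 9], Theorem 3.1: *"There exist positive constants M₁, δ₀, a₀, B₀ dependent on d and L only, … such
  that for M ≧ M₁ and for an arbitrary configuration U satisfying the regularity condition (3.35) with Mα₀ ≦ a₀, the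
  operator G′(U) (a = 1) satisfies the inequalities |(G′(U)λ)(x)|, |(∇_UG′(U)λ)(x)|, |(G′(U)∇\*_Uλ)(x)|,
  |(Δ_UG′(U)λ)(x)| ≦ B₀[(L^jη)², L^jη, L^jη, 1]e^{−δ₀d(y,y′)}|λ| for x ∈ Δ(y), y ∈ Λ_j, supp λ ⊂ Δ(y′); (3.42)"* —
  four entries; the SECOND and FOURTH are LEFT entries E·G′(U) with E = ∇_U (site functions → bond functions) and
  E = Δ_U, i.e. operators between two DIFFERENT function spaces, with the weights P(y) = L^jη, 1 at the OUTPUT block.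
* B9 p. 399 [PDF 11], Theorem 3.3: *"Under the assumptions of Theorem 3.1, and with the constants described there, the
  operator G(U) (a = 1) satisfies the inequalities (3.42)–(3.47), with G′(U) replaced by G(U) and λ replaced by a
  function J defined at bonds of the lattice T_η, or Ω₀, and with values in g."*
* B9 pp. 402–403 [PDF 14–15]: *"the operator V′(A)G′(U) satisfies the bound |(V′(A)G′(U)λ)(x)| ≦ O(1)B₀α₁e^{−δ₀d(y,y′)}
  (3.63) for x ∈ Δ(y), supp λ ⊂ Δ(y′) … Thus for α₁ sufficiently small the norm of this operator is small and
  I − V′(A)G′(U) is an invertible operator, the inverse is given by a convergent Neumann series. … G′(U′U) = G′(U) +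
  G′(U)V′(A)G′(U′U) = G′(U) + G′(U′U)V′(A)G′(U), (3.65) … Now applying Theorem 3.1 for G′(U), the bound (3.63), the
  representation (3.64) and Lemma 2.1 of [4] we can prove all the statements (3.42)–(3.47) of Theorem 3.1 for the
  operator G′(U′U), of course with different constants, although changes are small. … the remainders G′(U)V′(A)G′(U′U)
  and G′(U′U)V′(A)G′(U) in (3.65) … satisfy Theorem 3.1 with the additional small factor O(1)α₁."*
* B9 p. 421 [PDF 33]: *"Let us denote for a moment the operator we have investigated in previous sections by G₀, i.e.
  G₀ = (Δ + DRD\* + Q\*aQ)^{−1}. From (3.120) we get G = G₀(I − Δ′_πG₀)^{−1} = Σ_{n=0}^∞ G₀(Δ′_πG₀)ⁿ. (3.130)"*;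
  p. 422 [PDF 34]: *"This inequality [(3.131)] and Theorem 3.3 for G₀ imply a convergence of the series (3.130), for α₀
  sufficiently small, in all norms appearing on the left-hand sides of the inequalities (3.42)–(3.47), except the
  inequality involving the Laplace operator in (3.42). Thus we have Theorem 3.3. for G, with this exception."*;
  p. 423 [PDF 35]: *"|(Δ^{(2)}A)(b)| ≦ O(1)Mα₀(L^jη)^{−2}|A|, b ∈ Δ(y), y ∈ Λ_j, (3.137) and the supremum |A| is taken
  over several j-blocks surrounding Δ(y). This bound implies that the operators Δ^{(2)}, Δ^{(2)}_π are small in a proper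
  sense, if α₀ is sufficiently small. Similarly as in (3.130) we get G₁ = G₀(I − (Δ′_π + Δ^{(2)}_π)G₀)^{−1} =
  Σ_{n=0}^∞ G₀((Δ′_π + Δ^{(2)}_π)G₀)ⁿ. (3.138) … the series (3.138) is convergent for α₀ restricted by a small, absolute
  constant. The convergence is in all norms appearing in the formulation of Theorem 3.3. This implies that the theorem
  is valid for G₁."* (Theorem 3.12, ibid.: *"… Theorems 3.3, 3.10, 3.11 hold for the propagators G, G₁, with one
  exception … The exception is the inequality in (3.42) involving the covariant Laplace operator. It does not hold for
  G, G₁."*)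
* B11 p. 306 [PDF 30]: *"We may simplify this equation including the operator −Δ^{(2)} into the definition of G, i.e.
  defining G = (Δ_a − Δ^{(2)})^{−1}. From the estimate (3.137) it follows that Δ^{(2)} is a small perturbation of Δ_a,
  and the new operator G has exactly the same properties as Δ_a^{−1}."*

WHAT IS REPRODUCED (0 sorry; every analytic input a hypothesis of the printed shape, named):
(a) `HasMajorantHom` — the printed bound shape *"|(Tλ)(v)| ≦ K(y,y′)|λ|, v in the block of y, supp λ ⊂ Δ(y′)"* for a
  linear operator T between the functions on TWO lattices X (blocks = fibres of `blkX`) and Y (fibres of `blkY`); it is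
  pv08's `HasMajorant` when X = Y (`hasMajorantHom_iff`, by `Iff.rfl`); monotone, additive, closed under composition
  through a third lattice (`hasMajorantHom_comp` = [4] (2.52) ⇒ (2.55)ₐ with the partition Σ_{y″}Δ(y″) = I inserted
  on the middle space).
(b) THE REDUCTION to pv08: the block operator `emb R S` = (R 0; S 0) on the functions on X ⊕ Y (`emb_mul`, `emb_add`:
  (R 0; S 0)(R′ 0; S′ 0) = (RR′ 0; SR′ 0)) carries the pair (majorant of R, two-space majorant of S) to ONE pv08
  majorant over the block map `Sum.elim blkX blkY` and back (`hasMajorant_emb`, `hasMajorantHom_of_emb`), and a right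
  fixed point S = S₀ + S·R becomes (0 0; S 0) = (0 0; S₀ 0) + (0 0; S 0)(R 0; 0 0).  Hence, WITHOUT re-proving the
  (2.64)–(2.66) chain: `hom_majorant_mul_265` (one term S·T, [4] (2.66): the y″-sum costs c₁(α) by (2.54) + (2.61)),
  `hom_majorant_nthTerm_265` (S₀Rⁿ has majorant A c₁(α)P(y)(θc₁(α))ⁿe^{−(1−α)δ₀d(y,y′)} — the n-th term of (3.64) /
  (3.130) / (3.138) for a left entry, WRITTEN OUT), `hom_majorant_partialSum_266` (uniform in N under θc₁(α) < 1),
  `hom_majorant_of_fixedPoint_266` (S = S₀ + S·R ⇒ S has majorant A c₁(α)(1 − θc₁(α))^{−1}P(y)e^{−(1−α)δ₀d(y,y′)}).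
(c) `local_mul_majorant`, `rowSum_of_neighbours`, `local_perturbation_majorant` — the (3.137)-MECHANISM: a LOCAL
  operator V (majorant K_V(y,y″) vanishing unless d(y,y″) ≦ ρ, e.g. y″ among the *"several j-blocks surrounding Δ(y)"*)
  with the weighted row sum Σ_{y″}K_V(y,y″)P(y″) ≦ ϑ (for (3.137): K_V = κ(L^jη)^{−2} on ≦ n₀ neighbours, P(y″) =
  (L^{j″}η)², so ϑ = κn₀c with (L^jη)^{−2}(L^{j″}η)² ≦ c — the scale weights CANCEL), composed with an operator G₀ of
  majorant A·P(y)e^{−δ₀d}, has the SCALE-FREE small majorant ϑAe^{δ₀ρ}·e^{−δ₀d(y,y′)} (triangle inequality (2.54) of [4]):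
  exactly the shape (2.51)/(3.63) that the Neumann theorems consume.
(d) ALGEBRA [folklore]: `rightFixpoint_of_resolvent` (G(I − W) = G₀ ⇒ G = G₀ + GW: (3.130)₁, (3.138)₁, (3.64)),
  `rightFixpoint_of_inverse` (G(Δ_a − Δ^{(2)}) = I, Δ_aG₀ = I ⇒ G = G₀ + G·Δ^{(2)}G₀: B11 p. 306),
  `leftEntry_fixpoint` (G = G₀ + GW ⇒ EG = EG₀ + (EG)W for every linear E).
(e) INSTANCES over a B9 geometry read through `B9Thm34Ext.toB6` (hypotheses = the printed displays, named):
  `b9_leftEntry_of_365` — (3.65)₂ + (3.63) + (3.42)_E for G′(U) ⇒ (3.42)_E for G′(U′U) with B₀ ↦ B₀c₁(α)(1 − θc₁(α))^{−1},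
  δ₀ ↦ (1−α)δ₀, for EVERY left entry E (E = ∇_U: P = L^jη; E = Δ_U: P = 1; E = I: P = (L^jη)², = `gpExt_entry1_of_365`);
  `b9_leftEntry_explicit_365` — with θ = κ₀B₀α₁ and α₁ ≦ a₁ := (2κ₀B₀c₁(α))^{−1} the constant is ≦ 2B₀c₁(α) (Theorem
  3.4's *"positive constant a₁"* witnessed on these entries, d- and L-dependent only); `b9_leftEntry_remainder_365` —
  p. 403 *"the remainders … with the additional small factor O(1)α₁"* for left entries; `b9_sectD_nthTerm`,
  `b9_sectD_leftEntry` — the (3.130)/(3.138) pattern G = G₀(I − XG₀)^{−1}: IF the one-factor operator W = XG₀ has a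
  majorant θe^{−δ₀d(y,y′)} in this sharp-block sup calculus, then the n-th term EG₀Wⁿ of every left entry has majorant
  B₀c₁(α)P(y)(θc₁(α))ⁿe^{−(1−α)δ₀d} (*"the n-th-term bound written out"*, cell GAPS G-B9-16) and EG the summed one under
  θc₁(α) < 1; `b11_newG_entry1_of_3137`, `b11_newG_leftEntry_of_3137` — B11 p. 306: with Δ^{(2)} local of the (3.137)
  shape, G = (Δ_a − Δ^{(2)})^{−1} inherits every sup-type (left) entry of Δ_a^{−1} = G₀ with B₀ ↦ B₀c₁(α)(1 − θc₁(α))^{−1},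
  δ₀ ↦ (1−α)δ₀, θ = κn₀cB₀e^{δ₀ρ} — *"has exactly the same properties as Δ_a^{−1}"* for these entries, under the LOCATED
  smallness θc₁(α) < 1 (the *"α₀ sufficiently small"* of p. 423, cell SMALLNESS).
ON THE CONSTANT c₁(α) OF LEMMA 2.1 [4] (cell rows G-A11-1, G-A12-1, G-ref1-11; section (f)).  The hypotheses `h261`,
`h263` are pv08's `Ineq261 d`, `Ineq263 d` with the PRINTED c₁(α) = 12c₀(½α)^d = `B6.c1 d δ₀ α`, in which `d : ℕ` is a
FREE parameter of the statement, not read off the geometry.  The printed (2.61) at d = the dimension is REFUTED in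
dimension 4 (`…B6Lemma21Counterexample.printed_c1_exceeded`) and repaired with c₁′ = 13c₀(½α)^{3d}
(`…B6Lemma21Arith.c1Repaired`, `…B6Lemma21Repaired`); a (2.61)-type row-sum bound with ANY constant c (e.g. the
repaired one) gives `Ineq261 d′`, `Ineq263 d′` for every parameter d′ with c ≦ `B6.c1 d′ δ₀ α` (`ineq261_of_rowSum_le`,
`ineq263_of_rowSum_le` below; such d′ exist since c₀(½α) > 1 for αδ₀ > 0), so every theorem here is consumed
non-vacuously through that door, at the price of the constant, until the generic-constant re-typing of `…B6RandomWalk`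
asked for in G-ref1-11 lands (then c₁(α) below reads "the constant of (2.61)").
WHAT IS *NOT* REPRODUCED OR ASSERTED.  (i) (3.42), (3.63), (3.137), (3.65), (3.130) themselves — hypotheses (`h342E`,
`h363`, `h3137`, `h365`, `h3130`); (ii) for (3.130)/(3.138) the ONE-FACTOR input: the print bounds Δ′_π only through the
BILINEAR estimate (3.131) p. 422 (one derivative kept on each side), NOT as a sharp-block sup majorant of Δ′_πG₀ — so
`b9_sectD_*` certify the summation GIVEN such a majorant (hypothesis `hW`); producing it from (3.131) + Theorem 3.3 +
Lemma 2.1 of [4] (the scale transfer L^{|j−j′|} ≦ O(1)e^{αδ₀d(y,y′)} of p. 398) is the part of G-B9-16 left open here, and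
is where the printed EXCEPTION (the Δ_U-entry fails for G, G₁) lives (the FORM/L²-language treatment of the same input is
the cell's repair row G-B9-16R, reader lineage r1 — not this module); for Δ^{(2)} alone the one-factor majorant IS (c);
(iii) the RIGHT entry G′∇\*_U of (3.42) (third entry): (3.65) gives for it only the LEFT fixed point G′(U′U)∇\* = G′(U)∇\*
+ (G′(U)V′(A))·G′(U′U)∇\*, whose factor G′(U)V′(A) has no scale-free sharp-block majorant without the p. 398 weight
transfer — not treated (it is a `B11SectG.neumann_majorant` instance over weighted block norms); (iv) the Hölder
entries (3.43)–(3.45), the L²-entry (3.46), (3.47) (from (3.42) by Lemma 2.1, `…B9Ineq347`), positivity (Thm 3.11,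
`…B9Thm311`), the random-walk shape (Thm 3.10); (v) which covariant derivative the print means in "(3.42) for
G′(U′U)" (∇_U or ∇_{U′U} = ∇_U + an O(α₁(L^jη)^{−1}) multiplication operator) — E is an arbitrary linear map here;
(vi) Lemma 2.1 of [4] for the geometry at hand ((2.61)/(2.63)-shaped hypotheses `h261`, `h263`; `h263` follows from
`h261`, `B6RandomWalk.ineq263_of_261`), the metric facts d(y,y) = 0, d ≧ 0, (2.54) — explicit hypotheses as in
`…B6RandomWalk`; (vii) existence of the inverses / norm convergence of the Neumann series on the finite lattice — only
the fixed-point identities are consumed.  NOTHING of the series' end-statement (ultraviolet stability,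
[Balaban1987RG1] Thm 2 ff.) is asserted; value = kernel-checked bookkeeping of three printed "we can prove" /
"similarly" / "has exactly the same properties", NOT summit progress.  Unit `b2b-balaban-pv21-g2` (surge node prover
#21, gen 2), node HOM-MAJORANT-KERNEL; cell rows: `GAPS.md` C-pv21g2-1 (certification: G-B9-02 (i′) sup entries 2, 4
of (3.42) for G′(U′U); G-B9-16 n-th term modulo the one-factor input; G-B11-G1 sup entries), `DIVERGENCE.md`
D-pv21g2.1 (two-space typing; (3.137) row-sum packaging), `SMALLNESS.md` (θc₁(α) < 1 cross-references).
v2 ADDENDUM (same unit, node HOM-LEFT-FIXPOINT; APPEND-ONLY: sections (g)–(j) added below section (e), nothing above them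
changed).  Item (iii) of the NOT-REPRODUCED list is now treated, modulo ONE labelled hypothesis (`hGV`):
(g) `blockDiag` — D_W = multiplication by a BLOCK-CONSTANT weight W(y(x)) — and the EXACT conjugation rule
  `hasMajorant_conj` (D_W^{−1}TD_W has majorant W(y)^{−1}K(y,y′)W(y′)): the kernel form of B9 p. 398 [render p010] *"Next,
  the choice of powers L^jη is conventional also. Using Lemma 2.1 in [4] we may replace the factor (L^jη)^α by
  (L^jη)^β(L^{j′}η)^γ with β + γ = α, j, j′ are indices of localizations"*; `majorant_mul_inputWeight` — composition with an
  INPUT-weighted right factor ([4] (2.54) + (2.61) read at y′ through the symmetry of d).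
(h) LEFT fixed points T = T₀ + V·T (`leftFixedPoint_telescope`, `majorant_leftPartialSum`, `majorant_of_leftFixedPoint`):
  V with majorant θe^{−δ₀d(y,y′)}, θc₁(α) < 1, and T₀ with majorant A·Q(y′)e^{−(1−α)δ₀d(y,y′)} give T the majorant
  A c₁(α)(1 − θc₁(α))^{−1}Q(y′)e^{−(1−2α)δ₀d(y,y′)}; the remainder V^N T of the telescoped identity is killed by (2.65) as
  N → ∞ on the finite lattice (`exists_opBound`), exactly as in pv08's `majorant_of_fixedPoint_266`.
(i) the block operator `embL V T` = (V T; 0 0) on the functions on X ⊕ Y, transporting LEFT chains VⁿT to pv08 and back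
  (`embL_mul`, `embL_leftFixpoint`, `hasMajorant_embL_left/right`, `hasMajorantHom_of_embL`,
  `hom_majorant_of_leftFixedPoint`), and the SCALE-WEIGHTED form `hom_majorant_of_leftFixedPoint_weighted`: T₀ with
  majorant A·W(y)Q(y)e^{−δ₀d}, V with θ·W(y)W(y′)^{−1}e^{−δ₀d} (W > 0), the p. 398 convention as Q(y) ≦ C·Q(y′)e^{αδ₀d(y,y′)}
  ⇒ T has majorant A C c₁(α)(1 − θc₁(α))^{−1}·W(y)Q(y′)·e^{−(1−2α)δ₀d(y,y′)} (conjugate by D_W, move Q to the input block,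
  (h), undo the conjugation — `blockDiag_cancel_comp`).
(j) `rightEntry_fixpoint`, `b9_rightEntry_of_365`, `b9_rightEntry_outputWeight_365` — the FIRST identity of (3.65)
  p. 402 [render p014] *"G′(U′U) = G′(U) + G′(U)V′(A)G′(U′U)"*, multiplied on the right by D = ∇\*_U: entry 3 of (3.42)
  p. 397 [render p009] (*"|(G′(U)∇\*_Uλ)(x)| … ≦ B₀[…, L^jη, …]e^{−δ₀d(y,y′)}|λ|"*) for G′(U′U), with constant
  B₀Cc₁(α)(1 − θc₁(α))^{−1}, weights (L^jη)²·(L^{j′}η)^{−1} and rate (1−2α)δ₀ (or, using the convention once more, weight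
  L^jη at the output block, constant B₀C²c₁(α)(1 − θc₁(α))^{−1}, rate (1−3α)δ₀), GIVEN (3.42)₃ for G′(U) (`h342D`), the
  convention (`htransfer`) and `hGV` = a scale-weighted majorant θ·(L^jη)²(L^{j′}η)^{−2}·e^{−δ₀d(y,y′)} of the LEFT-routed
  composite G′(U)V′(A) (δ₀ a free parameter: a degraded rate is admissible).  `hGV` is NOT a printed display and is not
  asserted: (3.61) p. 402 *"|(V′(A)λ)(x)| ≦ O(1)α₁((L^jη)^{−1}|∇_Uλ| + (L^jη)^{−2}|λ|)"* is the GRADIENT form of V′(A)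
  (derivative on the argument), which serves the LEFT entries through (3.63) *"|(V′(A)G′(U)λ)(x)| ≦
  O(1)B₀α₁e^{−δ₀d(y,y′)}"*; a RIGHT entry needs V′(A) in DIVERGENCE form ∇\*_U∘B″ + C″ (lattice Leibniz rule applied to
  (3.60)), each V′(A) handing its derivative to the G′(U) on its left as an entry-3 factor G′(U)∇\*_U — with the gradient
  form the chain would contain the mixed kernel ∇_UG′(U)∇\*_U, for which only the Hölder bound (3.44) p. 398 (*"B′₀(ε) → ∞
  if ε → 0"*) is in print.  The divergence-form coefficient bounds (|B″| ≦ O(1)α₁(L^jη)^{−1}, |C″| ≦ O(1)α₁(L^jη)^{−2}, from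
  (3.60) and the domain (3.37)) are the undisplayed step: cell row `GAPS.md` G-pv21g2-2 (located objection);
  certification C-pv21g2-2 (entry 3 of G-B9-02 (i′) modulo `hGV`); `DIVERGENCE.md` D-pv21g2.2 (weights placed as
  (L^jη)²(L^{j′}η)^{−1}; rates (1−2α)δ₀ / (1−3α)δ₀; the convention typed as a kernel inequality).
v3 ADDENDUM (same unit, node HOM-LEFT-COMPOSITE; APPEND-ONLY: sections (k)–(l) added below section (j), nothing above them
changed).  The labelled hypothesis `hGV` of (j) is reduced to inputs of PRINTED TYPE plus the undisplayed rewriting itself: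
(k) `hom_majorant_comp_localRight` / `majorant_mul_localRight` — a decaying operator (majorant A·F(y)e^{−δ₀d}) followed on
  the RIGHT by a LOCAL one (majorant K(y″,y′) ≥ 0 vanishing unless d(y″,y′) ≤ ρ, column sums Σ_{y″}K(y″,y′) ≤ ϑ(y′)) has
  majorant A·e^{δ₀ρ}F(y)ϑ(y′)e^{−δ₀d(y,y′)} ([4] (2.52)–(2.55) with the partition on the middle lattice + (2.54); the mirror
  of v1's `local_mul_majorant`, which is the LEFT version VG₀ with row sums).
(l) `b9_leftComposite_of_divForm` — IF V′(A) of (3.60) is given in divergence form V′ = D∘B″ + C″ (D = ∇\*_U the abstract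
  right entry of `h342D`; B″ : fields → tensor functions, C″ : fields → fields LOCAL with column sums ≤ β·(L^{j′}η)^{−1},
  ≤ γ·(L^{j′}η)^{−2} — the (3.61)-TYPE coefficient sizes, β, γ = O(1)α₁n₀; this rewriting is the undisplayed step G-pv21g2-2
  and enters as HYPOTHESES `hVdiv`, `hcolB`, `hcolC`), THEN entries 1 and 3 of (3.42) for G′(U), W·Q² = 1 (W = (L^jη)²,
  Q = (L^jη)^{−1}) and the p. 398 convention give `hGV` with θ = B₀e^{δ₀ρ}(βC + γ) at the rate (1−α)δ₀:
  G′(U)V′(A) = (G′(U)∇\*_U)B″ + G′(U)C″ = entry 3 × B″ + entry 1 × C″.  `b9_rightEntry_of_365_divForm` assembles (l) with (j):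
  entry 3 of (3.42) for G′(U′U) from Theorem 3.1 entries 1, 3 for G′(U), the divergence-form hypotheses, (3.65)₁, the
  convention (exponents αδ₀ and α′(1−α)δ₀), Lemma 2.1 of [4] at ((1−α)δ₀, α′) and θc₁ < 1 — constant
  B₀C′c₁(1 − θc₁)^{−1}, weights (L^jη)²(L^{j′}η)^{−1}, rate (1−2α′)(1−α)δ₀.  Nothing about V′(A) itself is asserted.
  Cell rows: `GAPS.md` C-pv21g2-3 (certification) sharpening G-pv21g2-2 to exactly the divergence-form display.
v4 ADDENDUM (same unit, node HOM-K389; APPEND-ONLY: sections (m)–(n) added below section (l), nothing above them changed).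
(m) `hom_majorant_localLeft_comp` — the two-space LOCAL-LEFT composition: a LOCAL operator (majorant K(y,y″) ≥ 0 vanishing
  unless d(y,y″) ≤ ρ, WEIGHTED row sums Σ_{y″}K(y,y″)F(y″) ≤ ϑ(y)) after a decaying one (majorant A·F(y″)e^{−δ₀d(y″,y′)}) has
  majorant A·e^{δ₀ρ}ϑ(y)e^{−δ₀d(y,y′)} (two-space form of v1's `local_mul_majorant`); `hasMajorantHom_comp_suppPreserving` /
  `blockSupp_map_of_mul` — multiplication by h with |h| ≤ 1 on the right costs nothing.
(n) `b9_389_of_342` — B9 (3.89) p. 409 (*"Using the inequalities (3.42) for G′_□, we get the bound |(K(h_□)G′_□h_□λ)(x)|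
  ≦ O(M^{−1})e^{−δ₀(L^jη)^{−1}|y−y′|}|λ| … It is exactly the bound (2.44) of [4], rescaled to η-scale."*) DERIVED in the
  kernel from entries 1, 2 of (3.42) for G′_□ and the structure K(h) = P∘D + C read off (3.88) p. 409 / [4] (2.39) p. 229:
  P the LOCAL coefficient operator of the (∂h)(b)(Dλ)(b) term (bond functions → site functions; weighted row sums
  Σ_{y″}K_P(y,y″)L^{j″}η ≤ p(y)), C the LOCAL derivative-free part ((Δh)-term + the a_j(L^jη)^{−2}-averaging term; weighted
  row sums Σ_{y″}K_C(y,y″)(L^{j″}η)² ≤ q(y)), D abstract (the derivative of p. 392), h_□ support/bound preserving (|h_□| ≤ 1):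
  K(h_□)G′_□h_□ has majorant B₀e^{δ₀ρ}(p(y) + q(y))e^{−δ₀d(y,y′)}.  `b9_389_localized` — the same in the indicator shape
  1_{S′}(y)·θ·e^{−δ₀d(y,y′)} of the hypothesis `h389` of the tree's `B9Thm37Sum` (θ = B₀e^{δ₀ρ}(κ₁ + κ₂): the printed
  O(M^{−1}) in terms of the partition-of-unity constants).  The bounds on ∂h_□, Δh_□ themselves ([4] p. 229: the functions
  h *"described in (1.118), and rescale them to proper scales. They satisfy Σ_{□∈𝒟}h²_□ = 1. (2.36)"*) are NOT asserted —
  they are the hypotheses `hrowP`, `hrowC`; the exponent carries the multiscale d of (3.42), as consumed by (3.92) (cell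
  `DIVERGENCE.md` D-b09.13 records the printed scaled distance).  Cell rows: `GAPS.md` C-pv21g2-4 (certification of the
  (3.89) derivation — row G-B9-22 (b) — down to the h_□ coefficient bounds and (3.42)₁,₂ for G′_□).
v4.1 DOCFIX (cross-read C-pv01-16, remark R1): in the docstring of `hom_majorant_of_leftFixedPoint_weighted` a paraphrase set in
  quotation italics is replaced by the printed clause of p. 398; no declaration changed.
v4.2 DOCFIX (own re-read of renders B9 p021 / [4] p008): the two quoted displays (3.89), (2.44) in the docstring of
  `b9_389_of_342` carry the printed ≦; no declaration changed.
v5 ADDENDUM (same unit, node HOM-363; APPEND-ONLY: section (o) added below section (n), nothing above it changed).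
(o) `majorant_mul_of_blockNormBound` / `b9_363_of_361` — B9 (3.63) p. 402 (*"and the operator V′(A)G′(U) satisfies the
  bound |(V′(A)G′(U)λ)(x)| ≦ O(1)B₀α₁e^{−δ₀d(y,y′)} (3.63) for x∈Δ(y), supp λ ⊂ Δ(y′)"*) — the hypothesis `h363` of (e) —
  DERIVED in the kernel from the block-restricted gradient-form bound (3.61) (*"the norms on the right-hand side restricted
  to the block B^j(y) containing the point x"*; typed: |(V′μ)(x)| ≦ κ₁(y)B₁ + κ₂(y)B₂ whenever |Dμ| ≦ B₁ on the bonds and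
  |μ| ≦ B₂ on the sites of the block y ∋ x, κ₁ = c₁′α₁(L^jη)^{−1}, κ₂ = c₂′α₁(L^jη)^{−2}, D abstract) and entries 1, 2 of
  (3.42) for G′(U): majorant (c₁′ + c₂′)B₀α₁e^{−δ₀d(y,y′)}, no neighbourhood spill.  `b9_leftEntry_of_361_365` assembles it
  with (e): the LEFT sup-entries 1, 2, 4 of (3.42) for G′(U′U) from Theorem 3.1 for G′(U) + (3.61) + (3.65)₂ + Lemma 2.1
  of [4] (constant 2B₀c₁(α), rate (1−α)δ₀, for α₁ ≦ (2(c₁′ + c₂′)B₀c₁(α))^{−1}) — the gradient form suffices on the left;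
  the divergence form of (j)–(l) is needed for the right entry only.  Cell rows: `GAPS.md` C-pv21g2-5.
-/

namespace Literature.MathematicalPhysics.QuantumFieldTheory.Balaban1983to89.B6RandomWalkHom

open Literature.MathematicalPhysics.QuantumFieldTheory.Balaban1983to89
open Finset B6RandomWalk

/-! ## (a) Majorants between two function spaces -/

section TwoSpace

variable {g : B6.Geometry} {X Y Z : Type}

/-- The printed shape of (3.42)₂,₄ / [4] (2.51), (2.64)–(2.66) for an operator between TWO function spaces:
*"|(Tλ)(v)| ≦ K(y, y′)|λ| for v in the block of y, supp λ ⊂ Δ(y′)"* — T maps functions on the lattice X (blocks =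
fibres of `blkX`) to functions on the lattice Y (fibres of `blkY`; e.g. X = sites, Y = bonds, T = ∇_UG′(U)) and has
the MAJORANT K on 𝔅 × 𝔅. [cite: Balaban1985BackgroundPropagators, (3.42) p.397; Balaban1984PropagatorsII, (2.51) p.232] -/
def HasMajorantHom (blkX : X → g.Site) (blkY : Y → g.Site) (T : (X → ℝ) →ₗ[ℝ] (Y → ℝ))
    (K : g.Site → g.Site → ℝ) : Prop :=
  ∀ (y' : g.Site) (μ : X → ℝ) (B : ℝ), BlockSupp blkX μ y' B → ∀ v : Y, |T μ v| ≤ K (blkY v) y' * B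

/-- For X = Y (one lattice, one block map) the two-space majorant IS pv08's `HasMajorant`, by `Iff.rfl`. [folklore] -/
theorem hasMajorantHom_iff (blk : X → g.Site) (T : Module.End ℝ (X → ℝ)) (K : g.Site → g.Site → ℝ) :
    HasMajorantHom blk blk T K ↔ HasMajorant blk T K :=
  Iff.rfl

/-- Monotonicity of two-space majorants. [folklore] -/
theorem hasMajorantHom_mono (blkX : X → g.Site) (blkY : Y → g.Site) {T : (X → ℝ) →ₗ[ℝ] (Y → ℝ)}
    {K K' : g.Site → g.Site → ℝ} (h : HasMajorantHom blkX blkY T K) (hle : ∀ a b, K a b ≤ K' a b) :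
    HasMajorantHom blkX blkY T K' :=
  fun y' μ B hμ v => (h y' μ B hμ v).trans (mul_le_mul_of_nonneg_right (hle _ _) hμ.nonneg)

/-- The zero operator has the zero majorant. [folklore] -/
theorem hasMajorantHom_zero (blkX : X → g.Site) (blkY : Y → g.Site) :
    HasMajorantHom blkX blkY (0 : (X → ℝ) →ₗ[ℝ] (Y → ℝ)) (fun _ _ => 0) := by
  intro y' μ B hμ v
  simp

/-- Majorants add (*"A summation preserves it also"*, [4] p. 232). [cite: Balaban1984PropagatorsII, p.232] -/
theorem hasMajorantHom_add (blkX : X → g.Site) (blkY : Y → g.Site) {T₁ T₂ : (X → ℝ) →ₗ[ℝ] (Y → ℝ)}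
    {K₁ K₂ : g.Site → g.Site → ℝ} (h₁ : HasMajorantHom blkX blkY T₁ K₁) (h₂ : HasMajorantHom blkX blkY T₂ K₂) :
    HasMajorantHom blkX blkY (T₁ + T₂) (fun a b => K₁ a b + K₂ a b) := by
  intro y' μ B hμ v
  rw [LinearMap.add_apply, Pi.add_apply, add_mul]
  exact (abs_add_le _ _).trans (add_le_add (h₁ y' μ B hμ v) (h₂ y' μ B hμ v))

/-- Finite sums of operators: the majorants add up. [folklore] -/
theorem hasMajorantHom_sum (blkX : X → g.Site) (blkY : Y → g.Site) (T : ℕ → (X → ℝ) →ₗ[ℝ] (Y → ℝ))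
    (K : ℕ → g.Site → g.Site → ℝ) (h : ∀ n, HasMajorantHom blkX blkY (T n) (K n)) (N : ℕ) :
    HasMajorantHom blkX blkY (∑ n ∈ Finset.range N, T n) (fun a b => ∑ n ∈ Finset.range N, K n a b) := by
  induction N with
  | zero => simpa using hasMajorantHom_zero blkX blkY
  | succ N ih =>
      have := hasMajorantHom_add blkX blkY ih (h N)
      simpa [Finset.sum_range_succ] using this

/-- **[4] (2.52) ⇒ (2.55)ₐ through a third lattice**: if T₂ : (X → ℝ) → (Y → ℝ) has majorant K₂ ≥ 0 and
T₁ : (Y → ℝ) → (Z → ℝ) has majorant K₁, then T₁T₂ has the 𝔅-convolution Σ_{y″}K₁(y,y″)K₂(y″,y′) as majorant — insert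
the partition Σ_{y″}Δ(y″) = I of the functions on the MIDDLE lattice Y between the factors (*"this property is preserved
under the composition of operators possessing it"*, p. 232). [cite: Balaban1984PropagatorsII, (2.52)–(2.55) p.232] -/
theorem hasMajorantHom_comp (blkX : X → g.Site) (blkY : Y → g.Site) (blkZ : Z → g.Site)
    {T₁ : (Y → ℝ) →ₗ[ℝ] (Z → ℝ)} {T₂ : (X → ℝ) →ₗ[ℝ] (Y → ℝ)} {K₁ K₂ : g.Site → g.Site → ℝ}
    (h₁ : HasMajorantHom blkY blkZ T₁ K₁) (h₂ : HasMajorantHom blkX blkY T₂ K₂) (hK₂ : ∀ a b, 0 ≤ K₂ a b) :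
    HasMajorantHom blkX blkZ (T₁ ∘ₗ T₂) (fun a b => ∑ y'' : g.Site, K₁ a y'' * K₂ y'' b) := by
  intro y' μ B hμ z
  have hν : ∀ v, |T₂ μ v| ≤ K₂ (blkY v) y' * B := h₂ y' μ B hμ
  have hpiece : ∀ y'' : g.Site, |T₁ (blockPiece blkY y'' (T₂ μ)) z| ≤ K₁ (blkZ z) y'' * (K₂ y'' y' * B) :=
    fun y'' => h₁ y'' _ _ (blockSupp_blockPiece blkY (T₂ μ) y'' (K₂ y'' y' * B)
      (mul_nonneg (hK₂ _ _) hμ.nonneg) (fun v hv => by simpa [hv] using hν v)) z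
  rw [LinearMap.comp_apply]
  conv_lhs => rw [← sum_blockPiece blkY (T₂ μ), map_sum, Finset.sum_apply]
  refine (Finset.abs_sum_le_sum_abs _ _).trans ?_
  rw [Finset.sum_mul]
  refine Finset.sum_le_sum fun y'' _ => ?_
  simpa [mul_assoc] using hpiece y''

end TwoSpace

/-! ## (b) The reduction to pv08: the block operator (R 0; S 0) on the functions on X ⊕ Y -/

section Embedding

variable {g : B6.Geometry} {X Y : Type}

/-- The block operator (R 0; S 0) on the functions on the disjoint union X ⊕ Y: f ↦ (R(f|_X), S(f|_X)) — an
endomorphism of ONE function space carrying the pair (R : X → X, S : X → Y). [folklore] -/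
def emb (R : Module.End ℝ (X → ℝ)) (S : (X → ℝ) →ₗ[ℝ] (Y → ℝ)) : Module.End ℝ (X ⊕ Y → ℝ) where
  toFun f := Sum.elim (R (f ∘ Sum.inl)) (S (f ∘ Sum.inl))
  map_add' f f' := by
    have h : (f + f') ∘ Sum.inl = f ∘ Sum.inl + f' ∘ Sum.inl := rfl
    simp only [h, map_add]
    funext z
    rcases z with x | v <;> rfl
  map_smul' c f := by
    have h : (c • f) ∘ Sum.inl = c • (f ∘ Sum.inl) := rfl
    simp only [h, map_smul, RingHom.id_apply]
    funext z
    rcases z with x | v <;> rfl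

/-- The X-component of (R 0; S 0)f is R(f|_X). [folklore] -/
@[simp] theorem emb_apply_inl (R : Module.End ℝ (X → ℝ)) (S : (X → ℝ) →ₗ[ℝ] (Y → ℝ)) (f : X ⊕ Y → ℝ) (x : X) :
    emb R S f (Sum.inl x) = R (f ∘ Sum.inl) x :=
  rfl

/-- The Y-component of (R 0; S 0)f is S(f|_X). [folklore] -/
@[simp] theorem emb_apply_inr (R : Module.End ℝ (X → ℝ)) (S : (X → ℝ) →ₗ[ℝ] (Y → ℝ)) (f : X ⊕ Y → ℝ) (v : Y) :
    emb R S f (Sum.inr v) = S (f ∘ Sum.inl) v :=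
  rfl

/-- Block multiplication: (R 0; S 0)(R′ 0; S′ 0) = (RR′ 0; SR′ 0). [folklore] -/
theorem emb_mul (R R' : Module.End ℝ (X → ℝ)) (S S' : (X → ℝ) →ₗ[ℝ] (Y → ℝ)) :
    emb R S * emb R' S' = emb (R * R') (S ∘ₗ R') := by
  apply LinearMap.ext
  intro f
  funext z
  rcases z with x | v <;> rfl

/-- Block addition: (R 0; S 0) + (R′ 0; S′ 0) = (R + R′ 0; S + S′ 0). [folklore] -/
theorem emb_add (R R' : Module.End ℝ (X → ℝ)) (S S' : (X → ℝ) →ₗ[ℝ] (Y → ℝ)) :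
    emb R S + emb R' S' = emb (R + R') (S + S') := by
  apply LinearMap.ext
  intro f
  funext z
  rcases z with x | v <;> rfl

/-- (0 0; S 0)(R 0; 0 0)ⁿ = (0 0; SRⁿ 0) for every n ≥ 0 (n = 0: both sides (0 0; S 0)). [folklore] -/
theorem emb_zero_mul_pow (R : Module.End ℝ (X → ℝ)) (S : (X → ℝ) →ₗ[ℝ] (Y → ℝ)) (n : ℕ) :
    emb 0 S * emb R (0 : (X → ℝ) →ₗ[ℝ] (Y → ℝ)) ^ n = emb 0 (S ∘ₗ (R ^ n)) := by
  induction n with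
  | zero =>
      rw [pow_zero, mul_one, pow_zero, Module.End.one_eq_id, LinearMap.comp_id]
  | succ n ih =>
      rw [pow_succ, ← mul_assoc, ih, emb_mul, zero_mul, pow_succ, Module.End.mul_eq_comp, LinearMap.comp_assoc]

/-- Σ_{n<N}(0 0; F_n 0) = (0 0; Σ_{n<N}F_n 0). [folklore] -/
theorem emb_zero_sum (F : ℕ → (X → ℝ) →ₗ[ℝ] (Y → ℝ)) (N : ℕ) :
    ∑ n ∈ Finset.range N, emb (0 : Module.End ℝ (X → ℝ)) (F n) = emb 0 (∑ n ∈ Finset.range N, F n) := by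
  induction N with
  | zero =>
      rw [Finset.sum_range_zero, Finset.sum_range_zero]
      apply LinearMap.ext
      intro f
      funext z
      rcases z with x | v <;> rfl
  | succ N ih =>
      rw [Finset.sum_range_succ, Finset.sum_range_succ, ih, emb_add, add_zero]

/-- A function on X ⊕ Y block-supported at y′ (for the block map `Sum.elim blkX blkY`) restricts to a function on X
block-supported at y′ with the same bound. [folklore] -/
theorem blockSupp_compInl {blkX : X → g.Site} {blkY : Y → g.Site} {μ : X ⊕ Y → ℝ} {y' : g.Site} {B : ℝ}
    (h : BlockSupp (Sum.elim blkX blkY) μ y' B) : BlockSupp blkX (μ ∘ Sum.inl) y' B :=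
  ⟨h.nonneg, fun x hx => h.bound (Sum.inl x) hx, fun x hx => h.off (Sum.inl x) hx⟩

/-- A function on X block-supported at y′, extended by 0 to X ⊕ Y, is block-supported at y′ with the same bound.
[folklore] -/
theorem blockSupp_sumElim {blkX : X → g.Site} {blkY : Y → g.Site} {μ : X → ℝ} {y' : g.Site} {B : ℝ}
    (h : BlockSupp blkX μ y' B) : BlockSupp (Sum.elim blkX blkY) (Sum.elim μ (0 : Y → ℝ)) y' B := by
  refine ⟨h.nonneg, ?_, ?_⟩
  · rintro (x | v) hx
    · exact h.bound x hx
    · show |(0 : Y → ℝ) v| ≤ B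
      simpa using h.nonneg
  · rintro (x | v) hx
    · exact h.off x hx
    · rfl

/-- TO pv08: if R has majorant K_R ≤ K and S has two-space majorant K_S ≤ K, then (R 0; S 0) has the pv08 majorant K
over the block map `Sum.elim blkX blkY` of X ⊕ Y. [folklore] -/
theorem hasMajorant_emb {blkX : X → g.Site} {blkY : Y → g.Site} {R : Module.End ℝ (X → ℝ)}
    {S : (X → ℝ) →ₗ[ℝ] (Y → ℝ)} {KR KS K : g.Site → g.Site → ℝ}
    (hR : HasMajorant blkX R KR) (hS : HasMajorantHom blkX blkY S KS)
    (hKR : ∀ a b, KR a b ≤ K a b) (hKS : ∀ a b, KS a b ≤ K a b) :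
    HasMajorant (Sum.elim blkX blkY) (emb R S) K := by
  intro y' μ B hμ z
  have hμX : BlockSupp blkX (μ ∘ Sum.inl) y' B := blockSupp_compInl hμ
  rcases z with x | v
  · show |R (μ ∘ Sum.inl) x| ≤ K (blkX x) y' * B
    exact (hR y' _ B hμX x).trans (mul_le_mul_of_nonneg_right (hKR _ _) hμ.nonneg)
  · show |S (μ ∘ Sum.inl) v| ≤ K (blkY v) y' * B
    exact (hS y' _ B hμX v).trans (mul_le_mul_of_nonneg_right (hKS _ _) hμ.nonneg)

/-- FROM pv08, the S-block: a pv08 majorant of (R 0; S 0) over X ⊕ Y is a two-space majorant of S (test on the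
functions extended by 0 from X). [folklore] -/
theorem hasMajorantHom_of_emb {blkX : X → g.Site} {blkY : Y → g.Site} {R : Module.End ℝ (X → ℝ)}
    {S : (X → ℝ) →ₗ[ℝ] (Y → ℝ)} {K : g.Site → g.Site → ℝ}
    (h : HasMajorant (Sum.elim blkX blkY) (emb R S) K) : HasMajorantHom blkX blkY S K := by
  intro y' μ B hμ v
  have := h y' (Sum.elim μ 0) B (blockSupp_sumElim hμ) (Sum.inr v)
  exact this

/-- FROM pv08, the R-block: a pv08 majorant of (R 0; S 0) over X ⊕ Y is a majorant of R. [folklore] -/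
theorem hasMajorant_of_emb {blkX : X → g.Site} {blkY : Y → g.Site} {R : Module.End ℝ (X → ℝ)}
    {S : (X → ℝ) →ₗ[ℝ] (Y → ℝ)} {K : g.Site → g.Site → ℝ}
    (h : HasMajorant (Sum.elim blkX blkY) (emb R S) K) : HasMajorant blkX R K := by
  intro y' μ B hμ x
  have := h y' (Sum.elim μ 0) B (blockSupp_sumElim hμ) (Sum.inl x)
  exact this

end Embedding

/-! ## (b′) The (2.64)–(2.66) chain for a left entry: S₀Rⁿ, Σ_{n<N}S₀Rⁿ, S = S₀ + S·R -/

section HomNeumann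

variable {g : B6.Geometry} {X Y : Type}

/-- **One term, two spaces** ([4] (2.66), one term): if S : (X → ℝ) → (Y → ℝ) has majorant A·P(y)·e^{−δ₀d(y,y″)} and
T : (X → ℝ) → (X → ℝ) has majorant r·e^{−(1−α)δ₀d(y″,y′)}, then S·T has majorant A c₁(α) P(y) r e^{−(1−α)δ₀d(y,y′)} —
the y″-summation costs one factor c₁(α) by (2.54) and (2.61).  Proof: pv08's `majorant_G0_mul_265` for the block
operators (0 0; S 0)(T 0; 0 0) = (0 0; ST 0). [cite: Balaban1984PropagatorsII, (2.66) p.234] -/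
theorem hom_majorant_mul_265 (blkX : X → g.Site) (blkY : Y → g.Site) (d : ℕ) (δ₀ α A r : ℝ) (P : g.Site → ℝ)
    (hA : 0 ≤ A) (hP : ∀ y, 0 ≤ P y) (hr : 0 ≤ r) (hαδ : 0 ≤ (1 - α) * δ₀) (htri : Triangle254 g)
    (h261 : Ineq261 d g δ₀ α) {S : (X → ℝ) →ₗ[ℝ] (Y → ℝ)} {T : Module.End ℝ (X → ℝ)}
    (hS : HasMajorantHom blkX blkY S (fun a b => A * P a * Real.exp (-(δ₀ * g.dist a b))))
    (hT : HasMajorant blkX T (fun a b => r * Real.exp (-((1 - α) * δ₀ * g.dist a b)))) :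
    HasMajorantHom blkX blkY (S ∘ₗ T)
      (fun a b => A * B6.c1 d δ₀ α * P a * r * Real.exp (-((1 - α) * δ₀ * g.dist a b))) := by
  have hG0 : HasMajorant (Sum.elim blkX blkY) (emb 0 S) (fun a b => A * P a * Real.exp (-(δ₀ * g.dist a b))) :=
    hasMajorant_emb (hasMajorant_zero blkX) hS
      (fun a b => mul_nonneg (mul_nonneg hA (hP a)) (Real.exp_nonneg _)) (fun a b => le_rfl)
  have hT' : HasMajorant (Sum.elim blkX blkY) (emb T (0 : (X → ℝ) →ₗ[ℝ] (Y → ℝ)))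
      (fun a b => r * Real.exp (-((1 - α) * δ₀ * g.dist a b))) :=
    hasMajorant_emb hT (hasMajorantHom_zero blkX blkY) (fun a b => le_rfl)
      (fun a b => mul_nonneg hr (Real.exp_nonneg _))
  have h := majorant_G0_mul_265 (Sum.elim blkX blkY) d δ₀ α A r P hA hP hr hαδ htri h261 hG0 hT'
  rw [emb_mul, zero_mul] at h
  exact hasMajorantHom_of_emb h

/-- **The n-th term of the Neumann series, written out** ([4] (2.65)–(2.66); B9 (3.64) / (3.130) / (3.138) for a left
entry): if S₀ : (X → ℝ) → (Y → ℝ) has majorant A·P(y)·e^{−δ₀d} (a (3.42)-type entry of the unperturbed operator) and R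
the (2.51)/(3.63)-type majorant θe^{−δ₀d}, then S₀Rⁿ has majorant A c₁(α) P(y) (θc₁(α))ⁿ e^{−(1−α)δ₀d(y,y′)} for EVERY
n ≥ 0. [cite: Balaban1984PropagatorsII, (2.65)–(2.66) p.234; Balaban1985BackgroundPropagators, (3.64) p.402 + (3.130) p.421] -/
theorem hom_majorant_nthTerm_265 (blkX : X → g.Site) (blkY : Y → g.Site) (d : ℕ) (δ₀ α θ A : ℝ) (P : g.Site → ℝ)
    (hA : 0 ≤ A) (hP : ∀ y, 0 ≤ P y) (hθ : 0 ≤ θ) (hαδ : 0 ≤ (1 - α) * δ₀) (htri : Triangle254 g)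
    (hrefl : ∀ y : g.Site, g.dist y y = 0) (h261 : Ineq261 d g δ₀ α) (h263 : Ineq263 d g δ₀ α)
    {S₀ : (X → ℝ) →ₗ[ℝ] (Y → ℝ)} {R : Module.End ℝ (X → ℝ)}
    (hS₀ : HasMajorantHom blkX blkY S₀ (fun a b => A * P a * Real.exp (-(δ₀ * g.dist a b))))
    (hR : HasMajorant blkX R (fun a b => θ * Real.exp (-(δ₀ * g.dist a b)))) (n : ℕ) :
    HasMajorantHom blkX blkY (S₀ ∘ₗ (R ^ n))
      (fun a b => A * B6.c1 d δ₀ α * P a * (θ * B6.c1 d δ₀ α) ^ n *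
        Real.exp (-((1 - α) * δ₀ * g.dist a b))) :=
  hom_majorant_mul_265 blkX blkY d δ₀ α A ((θ * B6.c1 d δ₀ α) ^ n) P hA hP
    (pow_nonneg (mul_nonneg hθ (c1_nonneg d δ₀ α)) n) hαδ htri h261 hS₀
    (majorant_pow_265 blkX d δ₀ α θ hθ hrefl h263 hR n)

/-- **The partial sums Σ_{n<N}S₀Rⁿ** ([4] (2.66); B9 (3.64)/(3.130)) have majorant A c₁(α)(1 − θc₁(α))^{−1}P(y)
e^{−(1−α)δ₀d(y,y′)} UNIFORMLY in N, under the located smallness θc₁(α) < 1.  Proof: pv08's `majorant_partialSum_266`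
on X ⊕ Y. [cite: Balaban1984PropagatorsII, (2.66) p.234] -/
theorem hom_majorant_partialSum_266 (blkX : X → g.Site) (blkY : Y → g.Site) (d : ℕ) (δ₀ α θ A : ℝ)
    (P : g.Site → ℝ) (hA : 0 ≤ A) (hP : ∀ y, 0 ≤ P y) (hθ : 0 ≤ θ) (hαδ : 0 ≤ (1 - α) * δ₀)
    (htri : Triangle254 g) (hrefl : ∀ y : g.Site, g.dist y y = 0) (h261 : Ineq261 d g δ₀ α)
    (h263 : Ineq263 d g δ₀ α) (hsmall : θ * B6.c1 d δ₀ α < 1)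
    {S₀ : (X → ℝ) →ₗ[ℝ] (Y → ℝ)} {R : Module.End ℝ (X → ℝ)}
    (hS₀ : HasMajorantHom blkX blkY S₀ (fun a b => A * P a * Real.exp (-(δ₀ * g.dist a b))))
    (hR : HasMajorant blkX R (fun a b => θ * Real.exp (-(δ₀ * g.dist a b)))) (N : ℕ) :
    HasMajorantHom blkX blkY (∑ n ∈ Finset.range N, S₀ ∘ₗ (R ^ n))
      (fun a b => A * B6.c1 d δ₀ α * (1 - θ * B6.c1 d δ₀ α)⁻¹ * P a *
        Real.exp (-((1 - α) * δ₀ * g.dist a b))) := by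
  have hG0 : HasMajorant (Sum.elim blkX blkY) (emb 0 S₀) (fun a b => A * P a * Real.exp (-(δ₀ * g.dist a b))) :=
    hasMajorant_emb (hasMajorant_zero blkX) hS₀
      (fun a b => mul_nonneg (mul_nonneg hA (hP a)) (Real.exp_nonneg _)) (fun a b => le_rfl)
  have hR' : HasMajorant (Sum.elim blkX blkY) (emb R (0 : (X → ℝ) →ₗ[ℝ] (Y → ℝ)))
      (fun a b => θ * Real.exp (-(δ₀ * g.dist a b))) :=
    hasMajorant_emb hR (hasMajorantHom_zero blkX blkY) (fun a b => le_rfl)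
      (fun a b => mul_nonneg hθ (Real.exp_nonneg _))
  have h := majorant_partialSum_266 (Sum.elim blkX blkY) d δ₀ α θ A P hA hP hθ hαδ htri hrefl h261 h263 hsmall
    hG0 hR' N
  have hsum : ∑ n ∈ Finset.range N, emb (0 : Module.End ℝ (X → ℝ)) S₀ * emb R (0 : (X → ℝ) →ₗ[ℝ] (Y → ℝ)) ^ n =
      emb 0 (∑ n ∈ Finset.range N, S₀ ∘ₗ (R ^ n)) := by
    rw [← emb_zero_sum]
    exact Finset.sum_congr rfl fun n _ => emb_zero_mul_pow R S₀ n
  rw [hsum] at h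
  exact hasMajorantHom_of_emb h

/-- **(2.66) for a LEFT ENTRY of a right fixed point** — the theorem behind B9 p. 403 *"we can prove all the statements
(3.42)–(3.47) … for the operator G′(U′U)"* for the ∇_U- and Δ_U-entries of (3.42), and behind (3.130)/(3.138): if
S, S₀ : (X → ℝ) → (Y → ℝ) and R : (X → ℝ) → (X → ℝ) on FINITE lattices satisfy S = S₀ + S·R, S₀ has majorant
A·P(y)e^{−δ₀d(y,y′)} and R has majorant θe^{−δ₀d(y,y′)} with θc₁(α) < 1, then S has majorant
A c₁(α)(1 − θc₁(α))^{−1}P(y)e^{−(1−α)δ₀d(y,y′)}.  Proof: pv08's `majorant_of_fixedPoint_266` for (0 0; S 0) = (0 0; S₀ 0)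
+ (0 0; S 0)(R 0; 0 0) on X ⊕ Y. [cite: Balaban1984PropagatorsII, Prop. 2.2 (2.66) p.234; Balaban1985BackgroundPropagators, (3.65) p.402 + p.403 l.1–9] -/
theorem hom_majorant_of_fixedPoint_266 [Fintype X] [DecidableEq X] [Fintype Y] [DecidableEq Y]
    (blkX : X → g.Site) (blkY : Y → g.Site) (d : ℕ) (δ₀ α θ A : ℝ) (P : g.Site → ℝ)
    (hA : 0 ≤ A) (hP : ∀ y, 0 ≤ P y) (hθ : 0 ≤ θ) (hαδ : 0 ≤ (1 - α) * δ₀) (htri : Triangle254 g)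
    (hrefl : ∀ y : g.Site, g.dist y y = 0) (hdnn : ∀ y y' : g.Site, 0 ≤ g.dist y y')
    (h261 : Ineq261 d g δ₀ α) (h263 : Ineq263 d g δ₀ α) (hsmall : θ * B6.c1 d δ₀ α < 1)
    {S S₀ : (X → ℝ) →ₗ[ℝ] (Y → ℝ)} {R : Module.End ℝ (X → ℝ)}
    (hS₀ : HasMajorantHom blkX blkY S₀ (fun a b => A * P a * Real.exp (-(δ₀ * g.dist a b))))
    (hR : HasMajorant blkX R (fun a b => θ * Real.exp (-(δ₀ * g.dist a b)))) (hfix : S = S₀ + S ∘ₗ R) :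
    HasMajorantHom blkX blkY S
      (fun a b => A * B6.c1 d δ₀ α * (1 - θ * B6.c1 d δ₀ α)⁻¹ * P a *
        Real.exp (-((1 - α) * δ₀ * g.dist a b))) := by
  have hG0 : HasMajorant (Sum.elim blkX blkY) (emb 0 S₀) (fun a b => A * P a * Real.exp (-(δ₀ * g.dist a b))) :=
    hasMajorant_emb (hasMajorant_zero blkX) hS₀
      (fun a b => mul_nonneg (mul_nonneg hA (hP a)) (Real.exp_nonneg _)) (fun a b => le_rfl)
  have hR' : HasMajorant (Sum.elim blkX blkY) (emb R (0 : (X → ℝ) →ₗ[ℝ] (Y → ℝ)))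
      (fun a b => θ * Real.exp (-(δ₀ * g.dist a b))) :=
    hasMajorant_emb hR (hasMajorantHom_zero blkX blkY) (fun a b => le_rfl)
      (fun a b => mul_nonneg hθ (Real.exp_nonneg _))
  have hfix' : emb (0 : Module.End ℝ (X → ℝ)) S = emb 0 S₀ + emb 0 S * emb R (0 : (X → ℝ) →ₗ[ℝ] (Y → ℝ)) := by
    rw [emb_mul, zero_mul, emb_add, add_zero, ← hfix]
  have h := majorant_of_fixedPoint_266 (Sum.elim blkX blkY) d δ₀ α θ A P hA hP hθ hαδ htri hrefl hdnn h261 h263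
    hsmall hG0 hR' hfix'
  exact hasMajorantHom_of_emb h

end HomNeumann

/-! ## (c) The (3.137) mechanism: a local perturbation with cancelling scale weights gives a (2.51)-type small factor -/

section LocalPerturbation

variable {g : B6.Geometry} {X : Type}

/-- **A local operator times a decaying one.**  Let V have majorant K_V ≥ 0 which is LOCAL (K_V(y,y″) ≠ 0 only if
d(y,y″) ≦ ρ — *"several j-blocks surrounding Δ(y)"*, (3.137)) with the WEIGHTED row sum Σ_{y″}K_V(y,y″)P(y″) ≦ ϑ, and
let G₀ have majorant A·P(y)e^{−δ₀d(y,y′)} ((3.42)-type).  Then VG₀ has the scale-free majorant ϑ·A·e^{δ₀ρ}·e^{−δ₀d(y,y′)}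
(triangle inequality (2.54) of [4] over the distance ≦ ρ). [cite: Balaban1985BackgroundPropagators, (3.137)–(3.138) p.423; Balaban1984PropagatorsII, (2.54) p.233] -/
theorem local_mul_majorant (blk : X → g.Site) (δ₀ ρ ϑ A : ℝ) (P : g.Site → ℝ) (KV : g.Site → g.Site → ℝ)
    (hA : 0 ≤ A) (hP : ∀ y, 0 ≤ P y) (hδ₀ : 0 ≤ δ₀) (htri : Triangle254 g)
    (hKV : ∀ a b, 0 ≤ KV a b) (hloc : ∀ a y'', KV a y'' ≠ 0 → g.dist a y'' ≤ ρ)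
    (hrow : ∀ a, ∑ y'' : g.Site, KV a y'' * P y'' ≤ ϑ)
    {V G0 : Module.End ℝ (X → ℝ)} (hV : HasMajorant blk V KV)
    (hG0 : HasMajorant blk G0 (fun a b => A * P a * Real.exp (-(δ₀ * g.dist a b)))) :
    HasMajorant blk (V * G0) (fun a b => ϑ * A * Real.exp (δ₀ * ρ) * Real.exp (-(δ₀ * g.dist a b))) := by
  have hK₂ : ∀ a b, 0 ≤ A * P a * Real.exp (-(δ₀ * g.dist a b)) := fun a b =>
    mul_nonneg (mul_nonneg hA (hP a)) (Real.exp_nonneg _)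
  refine hasMajorant_mono blk (hasMajorant_mul blk hV hG0 hK₂) fun a b => ?_
  have hterm : ∀ y'' : g.Site, KV a y'' * (A * P y'' * Real.exp (-(δ₀ * g.dist y'' b))) ≤
      KV a y'' * P y'' * (A * Real.exp (δ₀ * ρ) * Real.exp (-(δ₀ * g.dist a b))) := by
    intro y''
    by_cases h0 : KV a y'' = 0
    · simp [h0]
    · have hd : g.dist a y'' ≤ ρ := hloc a y'' h0
      have hexp : Real.exp (-(δ₀ * g.dist y'' b)) ≤ Real.exp (δ₀ * ρ) * Real.exp (-(δ₀ * g.dist a b)) := by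
        rw [← Real.exp_add]
        refine Real.exp_le_exp.mpr ?_
        have h1 : g.dist a b ≤ ρ + g.dist y'' b := (htri a y'' b).trans (add_le_add hd le_rfl)
        have h2 := mul_le_mul_of_nonneg_left h1 hδ₀
        rw [mul_add] at h2
        linarith
      have := mul_le_mul_of_nonneg_left hexp (mul_nonneg (mul_nonneg (hKV a y'') (hP y'')) hA)
      calc KV a y'' * (A * P y'' * Real.exp (-(δ₀ * g.dist y'' b)))
          = KV a y'' * P y'' * A * Real.exp (-(δ₀ * g.dist y'' b)) := by ring
        _ ≤ KV a y'' * P y'' * A * (Real.exp (δ₀ * ρ) * Real.exp (-(δ₀ * g.dist a b))) := this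
        _ = _ := by ring
  calc ∑ y'' : g.Site, KV a y'' * (A * P y'' * Real.exp (-(δ₀ * g.dist y'' b)))
      ≤ ∑ y'' : g.Site, KV a y'' * P y'' * (A * Real.exp (δ₀ * ρ) * Real.exp (-(δ₀ * g.dist a b))) :=
        Finset.sum_le_sum fun y'' _ => hterm y''
    _ = (∑ y'' : g.Site, KV a y'' * P y'') * (A * Real.exp (δ₀ * ρ) * Real.exp (-(δ₀ * g.dist a b))) := by
        rw [Finset.sum_mul]
    _ ≤ ϑ * (A * Real.exp (δ₀ * ρ) * Real.exp (-(δ₀ * g.dist a b))) :=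
        mul_le_mul_of_nonneg_right (hrow a)
          (mul_nonneg (mul_nonneg hA (Real.exp_nonneg _)) (Real.exp_nonneg _))
    _ = _ := by ring

/-- **The scale weights cancel** — the packaging of (3.137) *"|(Δ^{(2)}A)(b)| ≦ O(1)Mα₀(L^jη)^{−2}|A|, b ∈ Δ(y),
y ∈ Λ_j, … the supremum |A| is taken over several j-blocks surrounding Δ(y)"*: if K_V(y,·) vanishes off a set
`nbr y` of at most n₀ blocks, K_V(y,y″) ≦ κ·w(y) there (w(y) = (L^jη)^{−2}, κ = O(1)Mα₀) and w(y)P(y″) ≦ c there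
(P(y″) = (L^{j″}η)²: c = 1 for j-blocks, L² if neighbouring scales are allowed), then the weighted row sum is
Σ_{y″}K_V(y,y″)P(y″) ≦ κn₀c. [cite: Balaban1985BackgroundPropagators, (3.137) p.423] -/
theorem rowSum_of_neighbours (P : g.Site → ℝ) (KV : g.Site → g.Site → ℝ) (w : g.Site → ℝ)
    (nbr : g.Site → Finset g.Site) (κ c : ℝ) (n₀ : ℕ) (hP : ∀ y, 0 ≤ P y) (hκ : 0 ≤ κ) (hc : 0 ≤ c)
    (hoff : ∀ a y'', y'' ∉ nbr a → KV a y'' = 0) (hle : ∀ a y'', y'' ∈ nbr a → KV a y'' ≤ κ * w a)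
    (hwP : ∀ a y'', y'' ∈ nbr a → w a * P y'' ≤ c) (hcard : ∀ a, (nbr a).card ≤ n₀) (a : g.Site) :
    ∑ y'' : g.Site, KV a y'' * P y'' ≤ κ * n₀ * c := by
  have hsplit : ∑ y'' : g.Site, KV a y'' * P y'' = ∑ y'' ∈ nbr a, KV a y'' * P y'' :=
    (Finset.sum_subset (Finset.subset_univ (nbr a)) fun y'' _ hy'' => by rw [hoff a y'' hy'', zero_mul]).symm
  rw [hsplit]
  calc ∑ y'' ∈ nbr a, KV a y'' * P y'' ≤ ∑ y'' ∈ nbr a, κ * c := by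
        refine Finset.sum_le_sum fun y'' hy'' => ?_
        calc KV a y'' * P y'' ≤ κ * w a * P y'' := mul_le_mul_of_nonneg_right (hle a y'' hy'') (hP y'')
          _ = κ * (w a * P y'') := by ring
          _ ≤ κ * c := mul_le_mul_of_nonneg_left (hwP a y'' hy'') hκ
    _ = (nbr a).card * (κ * c) := by rw [Finset.sum_const, nsmul_eq_mul]
    _ ≤ (n₀ : ℝ) * (κ * c) := mul_le_mul_of_nonneg_right (by exact_mod_cast hcard a) (mul_nonneg hκ hc)
    _ = κ * n₀ * c := by ring

/-- **(3.137) ⇒ the (2.51)/(3.63)-type small factor**: a local perturbation V of the (3.137) shape (majorant K_V ≥ 0,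
supported on ≦ n₀ blocks `nbr y` within distance ρ of y, K_V ≦ κw(y) there, w(y)P(y″) ≦ c there), applied after an
operator G₀ with the (3.42)₁-type majorant A·P(y)e^{−δ₀d}, gives VG₀ the majorant θe^{−δ₀d(y,y′)} with
θ = κn₀cAe^{δ₀ρ} EXPLICIT — *"This bound implies that the operators Δ^{(2)}, Δ^{(2)}_π are small in a proper sense, if
α₀ is sufficiently small"* (p. 423), the proper sense being the hypothesis `hR` of the Neumann theorems above.
[cite: Balaban1985BackgroundPropagators, (3.137)–(3.138) p.423] -/
theorem local_perturbation_majorant (blk : X → g.Site) (δ₀ ρ κ c A : ℝ) (n₀ : ℕ) (P w : g.Site → ℝ)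
    (KV : g.Site → g.Site → ℝ) (nbr : g.Site → Finset g.Site)
    (hA : 0 ≤ A) (hP : ∀ y, 0 ≤ P y) (hδ₀ : 0 ≤ δ₀) (hκ : 0 ≤ κ) (hc : 0 ≤ c) (htri : Triangle254 g)
    (hKV : ∀ a b, 0 ≤ KV a b) (hoff : ∀ a y'', y'' ∉ nbr a → KV a y'' = 0)
    (hnbr : ∀ a y'', y'' ∈ nbr a → g.dist a y'' ≤ ρ) (hle : ∀ a y'', y'' ∈ nbr a → KV a y'' ≤ κ * w a)
    (hwP : ∀ a y'', y'' ∈ nbr a → w a * P y'' ≤ c) (hcard : ∀ a, (nbr a).card ≤ n₀)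
    {V G0 : Module.End ℝ (X → ℝ)} (hV : HasMajorant blk V KV)
    (hG0 : HasMajorant blk G0 (fun a b => A * P a * Real.exp (-(δ₀ * g.dist a b)))) :
    HasMajorant blk (V * G0)
      (fun a b => κ * n₀ * c * A * Real.exp (δ₀ * ρ) * Real.exp (-(δ₀ * g.dist a b))) := by
  have hloc : ∀ a y'', KV a y'' ≠ 0 → g.dist a y'' ≤ ρ := fun a y'' h => by
    by_contra hfar
    exact h (hoff a y'' fun hmem => hfar (hnbr a y'' hmem))
  exact local_mul_majorant blk δ₀ ρ (κ * n₀ * c) A P KV hA hP hδ₀ htri hKV hloc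
    (rowSum_of_neighbours P KV w nbr κ c n₀ hP hκ hc hoff hle hwP hcard) hV hG0

end LocalPerturbation

/-! ## (f) On the constant of Lemma 2.1 [4] (cell rows G-A11-1, G-A12-1, G-ref1-11) -/

section Constant

variable {g : B6.Geometry}

/-- THE DOOR FOR THE REPAIRED CONSTANT.  pv08's `Ineq261 d g δ₀ α` carries the printed c₁(α) = 12c₀(½α)^d =
`B6.c1 d δ₀ α` with `d : ℕ` a FREE parameter; a (2.61)-type row-sum bound *"sup_y Σ_{y′∈𝔅} e^{−αδ₀d(y,y′)} ≦ c"* with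
ANY constant c — in particular the repaired c₁′ = 13c₀(½α)^{3d} of `…B6Lemma21Repaired` (the printed constant being
refuted in dimension 4, `…B6Lemma21Counterexample.printed_c1_exceeded`) — yields `Ineq261 d′` for every parameter d′
with c ≦ `B6.c1 d′ δ₀ α`. [cite: Balaban1984PropagatorsII, (2.61) p.234] -/
theorem ineq261_of_rowSum_le (d : ℕ) (δ₀ α c : ℝ)
    (h : ∀ y : g.Site, ∑ y' : g.Site, Real.exp (-(α * δ₀ * g.dist y y')) ≤ c) (hc : c ≤ B6.c1 d δ₀ α) :
    Ineq261 d g δ₀ α :=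
  fun y => (h y).trans hc

/-- … and then `Ineq263 d′` by pv08's kernel-checked "hence" (2.61) + (2.54) ⇒ (2.63) (`B6RandomWalk.ineq263_of_261`;
needs 0 ≦ δ₀, α ≦ 1). [cite: Balaban1984PropagatorsII, (2.61)–(2.63) p.234] -/
theorem ineq263_of_rowSum_le (d : ℕ) (δ₀ α c : ℝ) (htri : Triangle254 g) (hδ : 0 ≤ δ₀) (hα : α ≤ 1)
    (h : ∀ y : g.Site, ∑ y' : g.Site, Real.exp (-(α * δ₀ * g.dist y y')) ≤ c) (hc : c ≤ B6.c1 d δ₀ α) :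
    Ineq263 d g δ₀ α :=
  ineq263_of_261 d g δ₀ α htri hδ hα (ineq261_of_rowSum_le d δ₀ α c h hc)

end Constant

/-! ## (d) Algebra of right fixed points [folklore] -/

section Algebra

variable {X Y : Type}

/-- (3.130)₁ / (3.138)₁ / (3.64): if G(I − W) = G₀ then G = G₀ + GW. [folklore] -/
theorem rightFixpoint_of_resolvent {G G0 W : Module.End ℝ (X → ℝ)} (h : G * (1 - W) = G0) : G = G0 + G * W := by
  have h1 : G * (1 - W) = G - G * W := by rw [mul_sub, mul_one]
  rw [h1] at h
  calc G = G - G * W + G * W := (sub_add_cancel _ _).symm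
    _ = G0 + G * W := by rw [h]

/-- B11 p. 306, G = (Δ_a − Δ^{(2)})^{−1}: if G(Δ_a − Δ^{(2)}) = I and Δ_aG₀ = I (G₀ = Δ_a^{−1}) then
G = G₀ + G·(Δ^{(2)}G₀) — the right fixed point with the one-factor operator Δ^{(2)}G₀. [folklore] -/
theorem rightFixpoint_of_inverse {G G0 Δa D2 : Module.End ℝ (X → ℝ)} (hG : G * (Δa - D2) = 1)
    (hG0 : Δa * G0 = 1) : G = G0 + G * (D2 * G0) := by
  have key : G * (Δa - D2) * G0 = G * (Δa * G0) - G * (D2 * G0) := by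
    rw [mul_sub, sub_mul, mul_assoc, mul_assoc]
  rw [hG, one_mul, hG0, mul_one] at key
  -- key : G0 = G - G * (D2 * G0)
  calc G = G - G * (D2 * G0) + G * (D2 * G0) := (sub_add_cancel _ _).symm
    _ = G0 + G * (D2 * G0) := by rw [← key]

/-- A right fixed point passes to every LEFT ENTRY: G = G₀ + GW ⇒ EG = EG₀ + (EG)W for any linear E (E = ∇_U, Δ_U,
…). [folklore] -/
theorem leftEntry_fixpoint {G G0 W : Module.End ℝ (X → ℝ)} (E : (X → ℝ) →ₗ[ℝ] (Y → ℝ)) (h : G = G0 + G * W) :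
    E ∘ₗ G = E ∘ₗ G0 + (E ∘ₗ G) ∘ₗ W := by
  conv_lhs => rw [h]
  rw [LinearMap.comp_add, Module.End.mul_eq_comp, LinearMap.comp_assoc]

end Algebra

/-! ## (e) Instances over a B9 geometry (through `B9Thm34Ext.toB6`) -/

section B9Side

open B9Thm34Ext

variable {g : B9.Geometry} [Fintype g.Site] {R : ℝ} {H : Prop} {X Y : Type}

/-- **(3.65) ⇒ (3.42)_E for G′(U′U), every left entry E, constants explicit** (p. 403: *"we can prove all the
statements (3.42)–(3.47) of Theorem 3.1 for the operator G′(U′U), of course with different constants, although changes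
are small"* — entries 2 and 4 of (3.42), E = ∇_U with P(y) = L^jη, E = Δ_U with P = 1; E = I, P = (L^jη)² is
`B9Thm34Ext.gpExt_entry1_of_365`).  Hypotheses of the printed shape: `h342E` = (3.42)_E for G′(U) as a two-space
majorant B₀P(y)e^{−δ₀d(y,y′)} of E·G′(U); `h363` = (3.63) (θ = O(1)B₀α₁); `h365` = the second identity of (3.65); Lemma
2.1 of [4] at the exponent α; the smallness θc₁(α) < 1.  Conclusion: |(EG′(U′U)λ)(v)| ≦ B₀c₁(α)(1 − θc₁(α))^{−1}P(y)
e^{−(1−α)δ₀d(y,y′)}|λ| for v in the block of y, supp λ ⊂ Δ(y′).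
[cite: Balaban1985BackgroundPropagators, (3.62)–(3.65) pp.402–403; Balaban1984PropagatorsII, (2.66) p.234] -/
theorem b9_leftEntry_of_365 [Fintype X] [DecidableEq X] [Fintype Y] [DecidableEq Y]
    (blkX : X → g.Site) (blkY : Y → g.Site) (d : ℕ) (δ₀ α θ B₀ : ℝ) (P : g.Site → ℝ)
    (hB₀ : 0 ≤ B₀) (hP : ∀ y, 0 ≤ P y) (hθ : 0 ≤ θ) (hαδ : 0 ≤ (1 - α) * δ₀)
    (htri : Triangle254 (toB6 g R H)) (hrefl : ∀ y : g.Site, g.dist y y = 0)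
    (hdnn : ∀ y y' : g.Site, 0 ≤ g.dist y y') (h261 : Ineq261 d (toB6 g R H) δ₀ α)
    (h263 : Ineq263 d (toB6 g R H) δ₀ α) (hsmall : θ * B6.c1 d δ₀ α < 1)
    {GpU GpExt V : Module.End ℝ (X → ℝ)} {E : (X → ℝ) →ₗ[ℝ] (Y → ℝ)}
    (h342E : HasMajorantHom (g := toB6 g R H) blkX blkY (E ∘ₗ GpU)
      (fun a b => B₀ * P a * Real.exp (-(δ₀ * g.dist a b))))
    (h363 : HasMajorant (g := toB6 g R H) blkX V (fun a b => θ * Real.exp (-(δ₀ * g.dist a b))))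
    (h365 : GpExt = GpU + GpExt * V) :
    HasMajorantHom (g := toB6 g R H) blkX blkY (E ∘ₗ GpExt)
      (fun a b => B₀ * B6.c1 d δ₀ α * (1 - θ * B6.c1 d δ₀ α)⁻¹ * P a *
        Real.exp (-((1 - α) * δ₀ * g.dist a b))) :=
  hom_majorant_of_fixedPoint_266 (g := toB6 g R H) blkX blkY d δ₀ α θ B₀ P hB₀ hP hθ hαδ htri hrefl hdnn h261 h263
    hsmall h342E h363 (leftEntry_fixpoint E h365)

/-- **Theorem 3.4's a₁ witnessed on the left entries**: with θ = κ₀B₀α₁ (κ₀ = the O(1) of (3.63), B₀ > 0 of Theorem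
3.1) and α₁ ≦ a₁ := (2κ₀B₀c₁(α))^{−1} one has θc₁(α) ≦ ½ and EG′(U′U) obeys (3.42)_E with the constant 2B₀c₁(α) and the
rate (1−α)δ₀ — a₁ depends on d, L (through B₀, δ₀, c₁(α)) only, as Theorem 3.4 (p. 400) asserts.
[cite: Balaban1985BackgroundPropagators, Thm 3.4 p.400 + (3.62)–(3.65) pp.402–403] -/
theorem b9_leftEntry_explicit_365 [Fintype X] [DecidableEq X] [Fintype Y] [DecidableEq Y]
    (blkX : X → g.Site) (blkY : Y → g.Site) (d : ℕ) (δ₀ α κ₀ B₀ α₁ : ℝ) (P : g.Site → ℝ)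
    (hB₀ : 0 < B₀) (hκ₀ : 0 < κ₀) (hα₁ : 0 ≤ α₁) (hP : ∀ y, 0 ≤ P y) (hαδ : 0 ≤ (1 - α) * δ₀)
    (hc₁ : 0 < B6.c1 d δ₀ α)
    (htri : Triangle254 (toB6 g R H)) (hrefl : ∀ y : g.Site, g.dist y y = 0)
    (hdnn : ∀ y y' : g.Site, 0 ≤ g.dist y y') (h261 : Ineq261 d (toB6 g R H) δ₀ α)
    (h263 : Ineq263 d (toB6 g R H) δ₀ α) (ha₁ : α₁ ≤ (2 * κ₀ * B₀ * B6.c1 d δ₀ α)⁻¹)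
    {GpU GpExt V : Module.End ℝ (X → ℝ)} {E : (X → ℝ) →ₗ[ℝ] (Y → ℝ)}
    (h342E : HasMajorantHom (g := toB6 g R H) blkX blkY (E ∘ₗ GpU)
      (fun a b => B₀ * P a * Real.exp (-(δ₀ * g.dist a b))))
    (h363 : HasMajorant (g := toB6 g R H) blkX V (fun a b => κ₀ * B₀ * α₁ * Real.exp (-(δ₀ * g.dist a b))))
    (h365 : GpExt = GpU + GpExt * V) :
    HasMajorantHom (g := toB6 g R H) blkX blkY (E ∘ₗ GpExt)
      (fun a b => 2 * B₀ * B6.c1 d δ₀ α * P a * Real.exp (-((1 - α) * δ₀ * g.dist a b))) := by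
  set θ : ℝ := κ₀ * B₀ * α₁ with hθdef
  set c : ℝ := B6.c1 d δ₀ α with hcdef
  have hθ : 0 ≤ θ := by positivity
  have hprod : 0 < 2 * κ₀ * B₀ * c := by positivity
  have hθc : θ * c ≤ 1 / 2 := by
    have h1 : α₁ * (2 * κ₀ * B₀ * c) ≤ 1 := by
      have := mul_le_mul_of_nonneg_right ha₁ hprod.le
      rwa [inv_mul_cancel₀ hprod.ne'] at this
    have : θ * c = α₁ * (2 * κ₀ * B₀ * c) / 2 := by rw [hθdef]; ring
    rw [this]
    linarith
  have hsmall : θ * c < 1 := by linarith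
  have hinv : (1 - θ * c)⁻¹ ≤ 2 := by
    rw [inv_le_comm₀ (by linarith) (by norm_num : (0 : ℝ) < 2)]
    linarith
  have h := b9_leftEntry_of_365 (R := R) (H := H) blkX blkY d δ₀ α θ B₀ P hB₀.le hP hθ hαδ htri hrefl hdnn h261
    h263 hsmall h342E h363 h365
  refine hasMajorantHom_mono (g := toB6 g R H) blkX blkY h fun a b => ?_
  have hPa := hP a
  have hE : 0 ≤ Real.exp (-((1 - α) * δ₀ * g.dist a b)) := Real.exp_nonneg _
  have hconst : B₀ * c * (1 - θ * c)⁻¹ ≤ 2 * B₀ * c := by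
    calc B₀ * c * (1 - θ * c)⁻¹ ≤ B₀ * c * 2 := mul_le_mul_of_nonneg_left hinv (mul_nonneg hB₀.le hc₁.le)
      _ = 2 * B₀ * c := by ring
  calc B₀ * c * (1 - θ * c)⁻¹ * P a * Real.exp (-((1 - α) * δ₀ * g.dist a b))
      ≤ 2 * B₀ * c * P a * Real.exp (-((1 - α) * δ₀ * g.dist a b)) :=
        mul_le_mul_of_nonneg_right (mul_le_mul_of_nonneg_right hconst hPa) hE
    _ = _ := by rfl

/-- **The remainder in (3.65) for a left entry** (p. 403 l. 1–9: *"the remainders … G′(U′U)V′(A)G′(U) in (3.65) …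
satisfy Theorem 3.1 with the additional small factor O(1)α₁"*): from the EG′(U′U)-majorant just obtained (constant B₀′,
rate (1−α)δ₀) and the (3.63)-majorant θe^{−δ₀d} of V′(A)G′(U) (weakened to the rate (1−α′)(1−α)δ₀; needs αδ₀, α′,
(1−α)δ₀, d ≥ 0), the product EG′(U′U)·V′(A)G′(U) has majorant B₀′·θ·c₁(α′; (1−α)δ₀)·P(y)e^{−(1−α′)(1−α)δ₀d(y,y′)} by one
more use of Lemma 2.1 at the rate (1−α)δ₀ with exponent α′ (hypothesis `h261'`).
[cite: Balaban1985BackgroundPropagators, (3.65) p.402 + p.403 l.1–9] -/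
theorem b9_leftEntry_remainder_365 (blkX : X → g.Site) (blkY : Y → g.Site) (d : ℕ) (δ₀ α α' θ B₀' : ℝ)
    (P : g.Site → ℝ) (hB₀' : 0 ≤ B₀') (hP : ∀ y, 0 ≤ P y) (hθ : 0 ≤ θ) (hαδ : 0 ≤ α * δ₀)
    (h1αδ : 0 ≤ (1 - α) * δ₀) (hα' : 0 ≤ α') (hα'δ : 0 ≤ (1 - α') * ((1 - α) * δ₀))
    (htri : Triangle254 (toB6 g R H)) (hdnn : ∀ y y' : g.Site, 0 ≤ g.dist y y')
    (h261' : Ineq261 d (toB6 g R H) ((1 - α) * δ₀) α')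
    {S V : Module.End ℝ (X → ℝ)} {E : (X → ℝ) →ₗ[ℝ] (Y → ℝ)}
    (hExt : HasMajorantHom (g := toB6 g R H) blkX blkY (E ∘ₗ S)
      (fun a b => B₀' * P a * Real.exp (-((1 - α) * δ₀ * g.dist a b))))
    (h363 : HasMajorant (g := toB6 g R H) blkX V (fun a b => θ * Real.exp (-(δ₀ * g.dist a b)))) :
    HasMajorantHom (g := toB6 g R H) blkX blkY ((E ∘ₗ S) ∘ₗ V)
      (fun a b => B₀' * B6.c1 d ((1 - α) * δ₀) α' * P a * θ *
        Real.exp (-((1 - α') * ((1 - α) * δ₀) * g.dist a b))) := by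
  have hV : HasMajorant (g := toB6 g R H) blkX V
      (fun a b => θ * Real.exp (-((1 - α') * ((1 - α) * δ₀) * g.dist a b))) := by
    refine hasMajorant_mono (g := toB6 g R H) blkX h363 fun a b => ?_
    refine mul_le_mul_of_nonneg_left (Real.exp_le_exp.mpr ?_) hθ
    have hd := hdnn a b
    have h1 : 0 ≤ α * δ₀ * g.dist a b := mul_nonneg hαδ hd
    have h3 : 0 ≤ α' * ((1 - α) * δ₀ * g.dist a b) := mul_nonneg hα' (mul_nonneg h1αδ hd)
    have key : δ₀ * g.dist a b - (1 - α') * ((1 - α) * δ₀) * g.dist a b =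
        α * δ₀ * g.dist a b + α' * ((1 - α) * δ₀ * g.dist a b) := by ring
    show -(δ₀ * (toB6 g R H).dist a b) ≤ -((1 - α') * ((1 - α) * δ₀) * (toB6 g R H).dist a b)
    simp only [toB6_dist]
    linarith [h1, h3, key]
  have h := hom_majorant_mul_265 (g := toB6 g R H) blkX blkY d ((1 - α) * δ₀) α' B₀' θ P hB₀' hP hθ hα'δ htri
    h261' hExt hV
  exact hasMajorantHom_mono (g := toB6 g R H) blkX blkY h fun a b => le_of_eq rfl

/-- **(3.130)/(3.138): the n-th term of a left entry, written out** (cell GAPS G-B9-16 "the n-th-term bound written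
out").  In G = Σ_{n≥0}G₀(XG₀)ⁿ ((3.130): X = Δ′_π; (3.138): X = Δ′_π + Δ^{(2)}_π) write W := XG₀ for the one-factor
operator.  IF W has a sharp-block sup majorant θe^{−δ₀d(y,y′)} (hypothesis `hW` — for X = Δ^{(2)} this is
`local_perturbation_majorant` from (3.137); for Δ′_π the print gives only the bilinear (3.131), see the module header
(ii)) and EG₀ has the Theorem-3.3 entry B₀P(y)e^{−δ₀d(y,y′)} (`hThm33E`), then the n-th term EG₀Wⁿ has majorant
B₀c₁(α)P(y)(θc₁(α))ⁿe^{−(1−α)δ₀d(y,y′)} — *"each operator Δ′_π provides the small factor α₀"* (p. 422) made a number: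
(θc₁(α))ⁿ. [cite: Balaban1985BackgroundPropagators, (3.130)–(3.131) pp.421–422 + (3.138) p.423] -/
theorem b9_sectD_nthTerm (blkX : X → g.Site) (blkY : Y → g.Site) (d : ℕ) (δ₀ α θ B₀ : ℝ) (P : g.Site → ℝ)
    (hB₀ : 0 ≤ B₀) (hP : ∀ y, 0 ≤ P y) (hθ : 0 ≤ θ) (hαδ : 0 ≤ (1 - α) * δ₀)
    (htri : Triangle254 (toB6 g R H)) (hrefl : ∀ y : g.Site, g.dist y y = 0)
    (h261 : Ineq261 d (toB6 g R H) δ₀ α) (h263 : Ineq263 d (toB6 g R H) δ₀ α)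
    {G0 W : Module.End ℝ (X → ℝ)} {E : (X → ℝ) →ₗ[ℝ] (Y → ℝ)}
    (hThm33E : HasMajorantHom (g := toB6 g R H) blkX blkY (E ∘ₗ G0)
      (fun a b => B₀ * P a * Real.exp (-(δ₀ * g.dist a b))))
    (hW : HasMajorant (g := toB6 g R H) blkX W (fun a b => θ * Real.exp (-(δ₀ * g.dist a b)))) (n : ℕ) :
    HasMajorantHom (g := toB6 g R H) blkX blkY ((E ∘ₗ G0) ∘ₗ (W ^ n))
      (fun a b => B₀ * B6.c1 d δ₀ α * P a * (θ * B6.c1 d δ₀ α) ^ n *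
        Real.exp (-((1 - α) * δ₀ * g.dist a b))) :=
  hom_majorant_nthTerm_265 (g := toB6 g R H) blkX blkY d δ₀ α θ B₀ P hB₀ hP hθ hαδ htri hrefl h261 h263 hThm33E hW n

/-- **(3.130)/(3.138) summed: Theorem 3.3's left entries for G (resp. G₁)** — *"This inequality and Theorem 3.3 for G₀
imply a convergence of the series (3.130), for α₀ sufficiently small, in all norms …"* (p. 422), *"The convergence is
in all norms appearing in the formulation of Theorem 3.3. This implies that the theorem is valid for G₁"* (p. 423), for
the sup-type left entries and GIVEN the one-factor majorant `hW` (header (ii)): from (3.130)₁ in the form G(I − W) = G₀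
(`h3130`), EG has majorant B₀c₁(α)(1 − θc₁(α))^{−1}P(y)e^{−(1−α)δ₀d(y,y′)} under the located smallness θc₁(α) < 1
(*"α₀ sufficiently small"*). [cite: Balaban1985BackgroundPropagators, (3.130) p.421 + p.422 + (3.138) p.423 + Thm 3.12 p.423] -/
theorem b9_sectD_leftEntry [Fintype X] [DecidableEq X] [Fintype Y] [DecidableEq Y]
    (blkX : X → g.Site) (blkY : Y → g.Site) (d : ℕ) (δ₀ α θ B₀ : ℝ) (P : g.Site → ℝ)
    (hB₀ : 0 ≤ B₀) (hP : ∀ y, 0 ≤ P y) (hθ : 0 ≤ θ) (hαδ : 0 ≤ (1 - α) * δ₀)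
    (htri : Triangle254 (toB6 g R H)) (hrefl : ∀ y : g.Site, g.dist y y = 0)
    (hdnn : ∀ y y' : g.Site, 0 ≤ g.dist y y') (h261 : Ineq261 d (toB6 g R H) δ₀ α)
    (h263 : Ineq263 d (toB6 g R H) δ₀ α) (hsmall : θ * B6.c1 d δ₀ α < 1)
    {G G0 W : Module.End ℝ (X → ℝ)} {E : (X → ℝ) →ₗ[ℝ] (Y → ℝ)}
    (hThm33E : HasMajorantHom (g := toB6 g R H) blkX blkY (E ∘ₗ G0)
      (fun a b => B₀ * P a * Real.exp (-(δ₀ * g.dist a b))))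
    (hW : HasMajorant (g := toB6 g R H) blkX W (fun a b => θ * Real.exp (-(δ₀ * g.dist a b))))
    (h3130 : G * (1 - W) = G0) :
    HasMajorantHom (g := toB6 g R H) blkX blkY (E ∘ₗ G)
      (fun a b => B₀ * B6.c1 d δ₀ α * (1 - θ * B6.c1 d δ₀ α)⁻¹ * P a *
        Real.exp (-((1 - α) * δ₀ * g.dist a b))) :=
  hom_majorant_of_fixedPoint_266 (g := toB6 g R H) blkX blkY d δ₀ α θ B₀ P hB₀ hP hθ hαδ htri hrefl hdnn h261 h263
    hsmall hThm33E hW (leftEntry_fixpoint E (rightFixpoint_of_resolvent h3130))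

/-- **B11 p. 306, first entry**: *"defining G = (Δ_a − Δ^{(2)})^{−1}. From the estimate (3.137) it follows that Δ^{(2)}
is a small perturbation of Δ_a, and the new operator G has exactly the same properties as Δ_a^{−1}"* — for the sup
entry: if G₀ = Δ_a^{−1} has the (3.42)₁/Thm 3.3 majorant B₀P(y)e^{−δ₀d} (`h342`), Δ^{(2)} is local of the (3.137)
shape (majorant K ≥ 0 on ≦ n₀ blocks `nbr y` within distance ρ, K ≦ κw(y), w(y)P(y″) ≦ c; κ = O(1)Mα₀,
w = (L^jη)^{−2}, P = (L^jη)²), G(Δ_a − Δ^{(2)}) = I and Δ_aG₀ = I, then G has majorant B₀c₁(α)(1 − θc₁(α))^{−1}P(y)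
e^{−(1−α)δ₀d(y,y′)} with θ = κn₀cB₀e^{δ₀ρ}, under the LOCATED smallness θc₁(α) < 1 (*"α₀ sufficiently small"*).
[cite: Balaban1985Variational, p.306; Balaban1985BackgroundPropagators, (3.137) p.423; Balaban1984PropagatorsII, (2.66) p.234] -/
theorem b11_newG_entry1_of_3137 [Fintype X] [DecidableEq X] (blk : X → g.Site) (d : ℕ) (δ₀ α ρ κ c B₀ : ℝ)
    (n₀ : ℕ) (P w : g.Site → ℝ) (KV : g.Site → g.Site → ℝ) (nbr : g.Site → Finset g.Site)
    (hB₀ : 0 ≤ B₀) (hP : ∀ y, 0 ≤ P y) (hδ₀ : 0 ≤ δ₀) (hκ : 0 ≤ κ) (hc : 0 ≤ c) (hαδ : 0 ≤ (1 - α) * δ₀)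
    (htri : Triangle254 (toB6 g R H)) (hrefl : ∀ y : g.Site, g.dist y y = 0)
    (hdnn : ∀ y y' : g.Site, 0 ≤ g.dist y y') (h261 : Ineq261 d (toB6 g R H) δ₀ α)
    (h263 : Ineq263 d (toB6 g R H) δ₀ α)
    (hsmall : κ * n₀ * c * B₀ * Real.exp (δ₀ * ρ) * B6.c1 d δ₀ α < 1)
    (hKV : ∀ a b, 0 ≤ KV a b) (hoff : ∀ a y'', y'' ∉ nbr a → KV a y'' = 0)
    (hnbr : ∀ a y'', y'' ∈ nbr a → g.dist a y'' ≤ ρ) (hle : ∀ a y'', y'' ∈ nbr a → KV a y'' ≤ κ * w a)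
    (hwP : ∀ a y'', y'' ∈ nbr a → w a * P y'' ≤ c) (hcard : ∀ a, (nbr a).card ≤ n₀)
    {G G0 Δa D2 : Module.End ℝ (X → ℝ)}
    (h342 : HasMajorant (g := toB6 g R H) blk G0 (fun a b => B₀ * P a * Real.exp (-(δ₀ * g.dist a b))))
    (h3137 : HasMajorant (g := toB6 g R H) blk D2 KV) (hG : G * (Δa - D2) = 1) (hG0 : Δa * G0 = 1) :
    HasMajorant (g := toB6 g R H) blk G
      (fun a b => B₀ * B6.c1 d δ₀ α * (1 - κ * n₀ * c * B₀ * Real.exp (δ₀ * ρ) * B6.c1 d δ₀ α)⁻¹ * P a *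
        Real.exp (-((1 - α) * δ₀ * g.dist a b))) := by
  have hR : HasMajorant (g := toB6 g R H) blk (D2 * G0)
      (fun a b => κ * n₀ * c * B₀ * Real.exp (δ₀ * ρ) * Real.exp (-(δ₀ * g.dist a b))) :=
    local_perturbation_majorant (g := toB6 g R H) blk δ₀ ρ κ c B₀ n₀ P w KV nbr hB₀ hP hδ₀ hκ hc htri hKV hoff hnbr
      hle hwP hcard h3137 h342
  have hθ : 0 ≤ κ * n₀ * c * B₀ * Real.exp (δ₀ * ρ) :=
    mul_nonneg (mul_nonneg (mul_nonneg (mul_nonneg hκ (Nat.cast_nonneg n₀)) hc) hB₀) (Real.exp_nonneg _)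
  exact majorant_of_fixedPoint_266 (g := toB6 g R H) blk d δ₀ α (κ * n₀ * c * B₀ * Real.exp (δ₀ * ρ)) B₀ P hB₀ hP hθ
    hαδ htri hrefl hdnn h261 h263 hsmall h342 hR (rightFixpoint_of_inverse hG hG0)

/-- **B11 p. 306, every left entry**: under the same (3.137)-shape hypotheses on Δ^{(2)} and the (3.42)₁ majorant of
G₀ = Δ_a^{−1}, every sup-type left entry EG₀ of Theorem 3.3 (majorant B_E·P_E(y)e^{−δ₀d}: E = ∇ with P_E = L^jη, …)
transfers to EG, G = (Δ_a − Δ^{(2)})^{−1}: majorant B_Ec₁(α)(1 − θc₁(α))^{−1}P_E(y)e^{−(1−α)δ₀d(y,y′)}, θ = κn₀cB₀e^{δ₀ρ}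
— *"the new operator G has exactly the same properties as Δ_a^{−1}"* for these entries, constants and smallness explicit.
[cite: Balaban1985Variational, p.306; Balaban1985BackgroundPropagators, (3.137) p.423; Balaban1984PropagatorsII, (2.66) p.234] -/
theorem b11_newG_leftEntry_of_3137 [Fintype X] [DecidableEq X] [Fintype Y] [DecidableEq Y]
    (blkX : X → g.Site) (blkY : Y → g.Site) (d : ℕ) (δ₀ α ρ κ c B₀ BE : ℝ) (n₀ : ℕ) (P PE w : g.Site → ℝ)
    (KV : g.Site → g.Site → ℝ) (nbr : g.Site → Finset g.Site)
    (hB₀ : 0 ≤ B₀) (hBE : 0 ≤ BE) (hP : ∀ y, 0 ≤ P y) (hPE : ∀ y, 0 ≤ PE y) (hδ₀ : 0 ≤ δ₀) (hκ : 0 ≤ κ)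
    (hc : 0 ≤ c) (hαδ : 0 ≤ (1 - α) * δ₀)
    (htri : Triangle254 (toB6 g R H)) (hrefl : ∀ y : g.Site, g.dist y y = 0)
    (hdnn : ∀ y y' : g.Site, 0 ≤ g.dist y y') (h261 : Ineq261 d (toB6 g R H) δ₀ α)
    (h263 : Ineq263 d (toB6 g R H) δ₀ α)
    (hsmall : κ * n₀ * c * B₀ * Real.exp (δ₀ * ρ) * B6.c1 d δ₀ α < 1)
    (hKV : ∀ a b, 0 ≤ KV a b) (hoff : ∀ a y'', y'' ∉ nbr a → KV a y'' = 0)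
    (hnbr : ∀ a y'', y'' ∈ nbr a → g.dist a y'' ≤ ρ) (hle : ∀ a y'', y'' ∈ nbr a → KV a y'' ≤ κ * w a)
    (hwP : ∀ a y'', y'' ∈ nbr a → w a * P y'' ≤ c) (hcard : ∀ a, (nbr a).card ≤ n₀)
    {G G0 Δa D2 : Module.End ℝ (X → ℝ)} {E : (X → ℝ) →ₗ[ℝ] (Y → ℝ)}
    (h342 : HasMajorant (g := toB6 g R H) blkX G0 (fun a b => B₀ * P a * Real.exp (-(δ₀ * g.dist a b))))
    (h342E : HasMajorantHom (g := toB6 g R H) blkX blkY (E ∘ₗ G0)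
      (fun a b => BE * PE a * Real.exp (-(δ₀ * g.dist a b))))
    (h3137 : HasMajorant (g := toB6 g R H) blkX D2 KV) (hG : G * (Δa - D2) = 1) (hG0 : Δa * G0 = 1) :
    HasMajorantHom (g := toB6 g R H) blkX blkY (E ∘ₗ G)
      (fun a b => BE * B6.c1 d δ₀ α * (1 - κ * n₀ * c * B₀ * Real.exp (δ₀ * ρ) * B6.c1 d δ₀ α)⁻¹ * PE a *
        Real.exp (-((1 - α) * δ₀ * g.dist a b))) := by
  have hR : HasMajorant (g := toB6 g R H) blkX (D2 * G0)
      (fun a b => κ * n₀ * c * B₀ * Real.exp (δ₀ * ρ) * Real.exp (-(δ₀ * g.dist a b))) :=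
    local_perturbation_majorant (g := toB6 g R H) blkX δ₀ ρ κ c B₀ n₀ P w KV nbr hB₀ hP hδ₀ hκ hc htri hKV hoff
      hnbr hle hwP hcard h3137 h342
  have hθ : 0 ≤ κ * n₀ * c * B₀ * Real.exp (δ₀ * ρ) :=
    mul_nonneg (mul_nonneg (mul_nonneg (mul_nonneg hκ (Nat.cast_nonneg n₀)) hc) hB₀) (Real.exp_nonneg _)
  exact hom_majorant_of_fixedPoint_266 (g := toB6 g R H) blkX blkY d δ₀ α (κ * n₀ * c * B₀ * Real.exp (δ₀ * ρ))
    BE PE hBE hPE hθ hαδ htri hrefl hdnn h261 h263 hsmall h342E hR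
    (leftEntry_fixpoint E (rightFixpoint_of_inverse hG hG0))

end B9Side

/-! ## (g) Block-constant diagonal conjugation; composition with an INPUT-weighted factor -/

section Conjugation

variable {g : B6.Geometry} {X Y : Type}

/-- D_W: multiplication by a weight W(y) that is CONSTANT ON BLOCKS, (D_Wλ)(x) = W(y(x))λ(x) — the device behind B9
p. 398 *"the choice of powers L^jη is conventional also. Using Lemma 2.1 in [4] we may replace the factor (L^jη)^α by
(L^jη)^β(L^{j′}η)^γ with β + γ = α, j, j′ are indices of localizations"*: conjugating an operator by D_W moves block
weights between the output block y and the input block y′ EXACTLY. [cite: Balaban1985BackgroundPropagators, p.398 (remarks after Thm 3.1)] -/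
def blockDiag (blk : X → g.Site) (W : g.Site → ℝ) : Module.End ℝ (X → ℝ) where
  toFun f := fun x => W (blk x) * f x
  map_add' f f' := by
    funext x
    simp only [Pi.add_apply]
    ring
  map_smul' c f := by
    funext x
    simp only [Pi.smul_apply, smul_eq_mul, RingHom.id_apply]
    ring

/-- (D_Wλ)(x) = W(y(x))λ(x). [folklore] -/
@[simp] theorem blockDiag_apply (blk : X → g.Site) (W : g.Site → ℝ) (f : X → ℝ) (x : X) :
    blockDiag blk W f x = W (blk x) * f x :=
  rfl

/-- D_W D_{W′} = D_{WW′}. [folklore] -/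
theorem blockDiag_mul_blockDiag (blk : X → g.Site) (W W' : g.Site → ℝ) :
    blockDiag blk W * blockDiag blk W' = blockDiag blk (fun y => W y * W' y) := by
  apply LinearMap.ext
  intro f
  funext x
  simp only [Module.End.mul_apply, blockDiag_apply]
  ring

/-- D_1 = I. [folklore] -/
theorem blockDiag_one (blk : X → g.Site) : blockDiag blk (fun _ => (1 : ℝ)) = 1 := by
  apply LinearMap.ext
  intro f
  funext x
  simp only [blockDiag_apply, one_mul, Module.End.one_apply]

/-- D_{W⁻¹} D_W = I for a nowhere-vanishing weight. [folklore] -/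
theorem blockDiag_inv_mul (blk : X → g.Site) {W : g.Site → ℝ} (hW : ∀ y, W y ≠ 0) :
    blockDiag blk (fun y => (W y)⁻¹) * blockDiag blk W = 1 := by
  rw [blockDiag_mul_blockDiag]
  have h : (fun y => (W y)⁻¹ * W y) = fun _ => (1 : ℝ) := funext fun y => inv_mul_cancel₀ (hW y)
  rw [h, blockDiag_one]

/-- D_W D_{W⁻¹} = I for a nowhere-vanishing weight. [folklore] -/
theorem blockDiag_mul_inv (blk : X → g.Site) {W : g.Site → ℝ} (hW : ∀ y, W y ≠ 0) :
    blockDiag blk W * blockDiag blk (fun y => (W y)⁻¹) = 1 := by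
  rw [blockDiag_mul_blockDiag]
  have h : (fun y => W y * (W y)⁻¹) = fun _ => (1 : ℝ) := funext fun y => mul_inv_cancel₀ (hW y)
  rw [h, blockDiag_one]

/-- D_W preserves block supports, scaling the bound by the weight of the block (W ≥ 0). [folklore] -/
theorem blockSupp_blockDiag {blk : X → g.Site} {μ : X → ℝ} {y' : g.Site} {B : ℝ} (W : g.Site → ℝ)
    (hW : ∀ y, 0 ≤ W y) (h : BlockSupp blk μ y' B) : BlockSupp blk (blockDiag blk W μ) y' (W y' * B) := by
  refine ⟨mul_nonneg (hW y') h.nonneg, fun x hx => ?_, fun x hx => ?_⟩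
  · rw [blockDiag_apply, abs_mul, hx, abs_of_nonneg (hW y')]
    exact mul_le_mul_of_nonneg_left (h.bound x hx) (hW y')
  · rw [blockDiag_apply, h.off x hx, mul_zero]

/-- Left multiplication by D_W (W ≥ 0) multiplies a majorant by the weight of the OUTPUT block. [folklore] -/
theorem hasMajorant_blockDiag_mul (blk : X → g.Site) {T : Module.End ℝ (X → ℝ)} {K : g.Site → g.Site → ℝ}
    (h : HasMajorant blk T K) (W : g.Site → ℝ) (hW : ∀ y, 0 ≤ W y) :
    HasMajorant blk (blockDiag blk W * T) (fun a b => W a * K a b) := by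
  intro y' μ B hμ x
  rw [Module.End.mul_apply, blockDiag_apply, abs_mul, abs_of_nonneg (hW _), mul_assoc]
  exact mul_le_mul_of_nonneg_left (h y' μ B hμ x) (hW _)

/-- Right multiplication by D_W (W ≥ 0) multiplies a majorant by the weight of the INPUT block. [folklore] -/
theorem hasMajorant_mul_blockDiag (blk : X → g.Site) {T : Module.End ℝ (X → ℝ)} {K : g.Site → g.Site → ℝ}
    (h : HasMajorant blk T K) (W : g.Site → ℝ) (hW : ∀ y, 0 ≤ W y) :
    HasMajorant blk (T * blockDiag blk W) (fun a b => K a b * W b) := by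
  intro y' μ B hμ x
  rw [Module.End.mul_apply, mul_assoc]
  exact h y' _ _ (blockSupp_blockDiag W hW hμ) x

/-- **Conjugation moves block weights exactly**: if T has majorant K then D_W^{−1} T D_W (W > 0) has majorant
W(y)^{−1}K(y,y′)W(y′) — the kernel form of p. 398's *"we may replace the factor (L^jη)^α by (L^jη)^β(L^{j′}η)^γ"*
insofar as no Lemma 2.1 is needed when the weights are merely MOVED between an operator and its conjugate.
[cite: Balaban1985BackgroundPropagators, p.398 (remarks after Thm 3.1)] -/
theorem hasMajorant_conj (blk : X → g.Site) {T : Module.End ℝ (X → ℝ)} {K : g.Site → g.Site → ℝ}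
    (h : HasMajorant blk T K) (W : g.Site → ℝ) (hW : ∀ y, 0 < W y) :
    HasMajorant blk (blockDiag blk (fun y => (W y)⁻¹) * T * blockDiag blk W)
      (fun a b => (W a)⁻¹ * K a b * W b) :=
  hasMajorant_mul_blockDiag blk (hasMajorant_blockDiag_mul blk h _ fun y => inv_nonneg.mpr (hW y).le) W
    fun y => (hW y).le

/-- Two-space version of `hasMajorant_blockDiag_mul`: D_W after T : (Y → ℝ) → (X → ℝ) multiplies a two-space
majorant by the weight of the output block. [folklore] -/
theorem hasMajorantHom_blockDiag_comp (blkY : Y → g.Site) (blkX : X → g.Site) {T : (Y → ℝ) →ₗ[ℝ] (X → ℝ)}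
    {K : g.Site → g.Site → ℝ} (h : HasMajorantHom blkY blkX T K) (W : g.Site → ℝ) (hW : ∀ y, 0 ≤ W y) :
    HasMajorantHom blkY blkX (blockDiag blkX W ∘ₗ T) (fun a b => W a * K a b) := by
  intro y' μ B hμ x
  rw [LinearMap.comp_apply, blockDiag_apply, abs_mul, abs_of_nonneg (hW _), mul_assoc]
  exact mul_le_mul_of_nonneg_left (h y' μ B hμ x) (hW _)

/-- **Composition with an INPUT-weighted right factor** (the mirror image of pv08's `majorant_G0_mul_265`, for chains
read from the left): if S has majorant r·e^{−βd(y,y″)} (β ≥ 0) and T has majorant A·Q(y′)·e^{−βd(y″,y′)}·e^{−αδ₀d(y″,y′)}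
with the weight Q at the INPUT block y′, then ST has majorant r A c₁(α) Q(y′) e^{−βd(y,y′)}: the triangle inequality
(2.54) merges the two e^{−β·} factors and (2.61), read at y′ through the SYMMETRY of d, sums the spare e^{−αδ₀d(y″,y′)}
over y″. [cite: Balaban1984PropagatorsII, (2.54) p.233 + (2.61), (2.66) p.234] -/
theorem majorant_mul_inputWeight (blk : X → g.Site) (d : ℕ) (δ₀ α β A r : ℝ) (Q : g.Site → ℝ)
    (hA : 0 ≤ A) (hQ : ∀ y, 0 ≤ Q y) (hr : 0 ≤ r) (hβ : 0 ≤ β) (htri : Triangle254 g)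
    (hsym : ∀ y y' : g.Site, g.dist y y' = g.dist y' y) (h261 : Ineq261 d g δ₀ α)
    {S T : Module.End ℝ (X → ℝ)}
    (hS : HasMajorant blk S (fun a b => r * Real.exp (-(β * g.dist a b))))
    (hT : HasMajorant blk T (fun a b => A * Q b * Real.exp (-(β * g.dist a b)) *
      Real.exp (-(α * δ₀ * g.dist a b)))) :
    HasMajorant blk (S * T) (fun a b => r * A * B6.c1 d δ₀ α * Q b * Real.exp (-(β * g.dist a b))) := by
  have hK₂ : ∀ a b : g.Site, 0 ≤ A * Q b * Real.exp (-(β * g.dist a b)) * Real.exp (-(α * δ₀ * g.dist a b)) :=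
    fun a b => mul_nonneg (mul_nonneg (mul_nonneg hA (hQ b)) (Real.exp_nonneg _)) (Real.exp_nonneg _)
  refine hasMajorant_mono blk (hasMajorant_mul blk hS hT hK₂) fun a b => ?_
  have hrAQ : 0 ≤ r * A * Q b := mul_nonneg (mul_nonneg hr hA) (hQ b)
  have hterm : ∀ y'' : g.Site,
      r * Real.exp (-(β * g.dist a y'')) *
          (A * Q b * Real.exp (-(β * g.dist y'' b)) * Real.exp (-(α * δ₀ * g.dist y'' b))) ≤
        r * A * Q b * Real.exp (-(β * g.dist a b)) * Real.exp (-(α * δ₀ * g.dist b y'')) := by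
    intro y''
    have hexp : Real.exp (-(β * g.dist a y'')) * Real.exp (-(β * g.dist y'' b)) ≤ Real.exp (-(β * g.dist a b)) := by
      rw [← Real.exp_add, Real.exp_le_exp]
      have := mul_le_mul_of_nonneg_left (htri a y'' b) hβ
      nlinarith
    have hs : Real.exp (-(α * δ₀ * g.dist y'' b)) = Real.exp (-(α * δ₀ * g.dist b y'')) := by rw [hsym y'' b]
    calc r * Real.exp (-(β * g.dist a y'')) *
          (A * Q b * Real.exp (-(β * g.dist y'' b)) * Real.exp (-(α * δ₀ * g.dist y'' b)))
        = r * A * Q b * (Real.exp (-(β * g.dist a y'')) * Real.exp (-(β * g.dist y'' b))) *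
            Real.exp (-(α * δ₀ * g.dist y'' b)) := by ring
      _ ≤ r * A * Q b * Real.exp (-(β * g.dist a b)) * Real.exp (-(α * δ₀ * g.dist y'' b)) :=
          mul_le_mul_of_nonneg_right (mul_le_mul_of_nonneg_left hexp hrAQ) (Real.exp_nonneg _)
      _ = r * A * Q b * Real.exp (-(β * g.dist a b)) * Real.exp (-(α * δ₀ * g.dist b y'')) := by rw [hs]
  calc ∑ y'' : g.Site, r * Real.exp (-(β * g.dist a y'')) *
          (A * Q b * Real.exp (-(β * g.dist y'' b)) * Real.exp (-(α * δ₀ * g.dist y'' b)))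
      ≤ ∑ y'' : g.Site, r * A * Q b * Real.exp (-(β * g.dist a b)) * Real.exp (-(α * δ₀ * g.dist b y'')) :=
        Finset.sum_le_sum fun y'' _ => hterm y''
    _ = r * A * Q b * Real.exp (-(β * g.dist a b)) * ∑ y'' : g.Site, Real.exp (-(α * δ₀ * g.dist b y'')) := by
        rw [Finset.mul_sum]
    _ ≤ r * A * Q b * Real.exp (-(β * g.dist a b)) * B6.c1 d δ₀ α :=
        mul_le_mul_of_nonneg_left (h261 b) (mul_nonneg hrAQ (Real.exp_nonneg _))
    _ = r * A * B6.c1 d δ₀ α * Q b * Real.exp (-(β * g.dist a b)) := by ring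

end Conjugation

/-! ## (h) LEFT fixed points T = T₀ + V·T ((3.65)₁ «G′(U′U) = G′(U) + G′(U)V′(A)G′(U′U)» read on a right entry) -/

section LeftNeumann

variable {g : B6.Geometry} {X Y : Type}

/-- Algebra: T = T₀ + VT ⇒ T = Σ_{n<N} VⁿT₀ + V^N T for every N. [folklore] -/
theorem leftFixedPoint_telescope {T T₀ V : Module.End ℝ (X → ℝ)} (hfix : T = T₀ + V * T) (N : ℕ) :
    T = (∑ n ∈ Finset.range N, V ^ n * T₀) + V ^ N * T := by
  induction N with
  | zero => simp
  | succ N ih =>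
      calc T = (∑ n ∈ Finset.range N, V ^ n * T₀) + V ^ N * T := ih
        _ = (∑ n ∈ Finset.range N, V ^ n * T₀) + V ^ N * (T₀ + V * T) := by rw [← hfix]
        _ = (∑ n ∈ Finset.range (N + 1), V ^ n * T₀) + V ^ (N + 1) * T := by
            rw [mul_add, ← mul_assoc, ← pow_succ, Finset.sum_range_succ, add_assoc]

/-- **The partial sums Σ_{n<N} VⁿT₀ of a LEFT Neumann series**: V with the (2.51)/(3.63)-type majorant θe^{−δ₀d} and
T₀ with the INPUT-weighted majorant A·Q(y′)·e^{−(1−α)δ₀d(y,y′)} give, uniformly in N, the majorant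
A c₁(α)(1 − θc₁(α))^{−1} Q(y′) e^{−(1−2α)δ₀d(y,y′)} (θc₁(α) < 1): (2.65) for Vⁿ, then `majorant_mul_inputWeight` —
each of the two steps costs one α of the rate. [cite: Balaban1984PropagatorsII, (2.65)–(2.66) p.234] -/
theorem majorant_leftPartialSum (blk : X → g.Site) (d : ℕ) (δ₀ α θ A : ℝ) (Q : g.Site → ℝ)
    (hA : 0 ≤ A) (hQ : ∀ y, 0 ≤ Q y) (hθ : 0 ≤ θ) (hαδ : 0 ≤ α * δ₀) (hαδ2 : 0 ≤ (1 - 2 * α) * δ₀)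
    (htri : Triangle254 g) (hrefl : ∀ y : g.Site, g.dist y y = 0)
    (hsym : ∀ y y' : g.Site, g.dist y y' = g.dist y' y) (hdnn : ∀ y y' : g.Site, 0 ≤ g.dist y y')
    (h261 : Ineq261 d g δ₀ α) (h263 : Ineq263 d g δ₀ α) (hsmall : θ * B6.c1 d δ₀ α < 1)
    {T₀ V : Module.End ℝ (X → ℝ)}
    (hT₀ : HasMajorant blk T₀ (fun a b => A * Q b * Real.exp (-((1 - α) * δ₀ * g.dist a b))))
    (hV : HasMajorant blk V (fun a b => θ * Real.exp (-(δ₀ * g.dist a b)))) (N : ℕ) :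
    HasMajorant blk (∑ n ∈ Finset.range N, V ^ n * T₀)
      (fun a b => A * B6.c1 d δ₀ α * (1 - θ * B6.c1 d δ₀ α)⁻¹ * Q b *
        Real.exp (-((1 - 2 * α) * δ₀ * g.dist a b))) := by
  set q : ℝ := θ * B6.c1 d δ₀ α with hq
  have hq0 : 0 ≤ q := mul_nonneg hθ (c1_nonneg d δ₀ α)
  have hterm : ∀ n, HasMajorant blk (V ^ n * T₀)
      (fun a b => q ^ n * A * B6.c1 d δ₀ α * Q b * Real.exp (-((1 - 2 * α) * δ₀ * g.dist a b))) := by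
    intro n
    have hVn : HasMajorant blk (V ^ n) (fun a b => q ^ n * Real.exp (-((1 - 2 * α) * δ₀ * g.dist a b))) := by
      refine hasMajorant_mono blk (majorant_pow_265 blk d δ₀ α θ hθ hrefl h263 hV n) fun a b => ?_
      refine mul_le_mul_of_nonneg_left ?_ (pow_nonneg hq0 n)
      rw [Real.exp_le_exp]
      have h1 := hdnn a b
      have h2 : 0 ≤ α * δ₀ * g.dist a b := mul_nonneg hαδ h1
      nlinarith
    have hT₀' : HasMajorant blk T₀ (fun a b => A * Q b * Real.exp (-((1 - 2 * α) * δ₀ * g.dist a b)) *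
        Real.exp (-(α * δ₀ * g.dist a b))) := by
      refine hasMajorant_mono blk hT₀ fun a b => le_of_eq ?_
      rw [mul_assoc (A * Q b), ← Real.exp_add]
      congr 1
      congr 1
      ring
    exact majorant_mul_inputWeight blk d δ₀ α ((1 - 2 * α) * δ₀) A (q ^ n) Q hA hQ (pow_nonneg hq0 n) hαδ2
      htri hsym h261 hVn hT₀'
  refine hasMajorant_mono blk (hasMajorant_sum blk (fun n => V ^ n * T₀) _ hterm N) fun a b => ?_
  have hgeom : ∑ n ∈ Finset.range N, q ^ n ≤ (1 - q)⁻¹ :=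
    sum_le_hasSum (Finset.range N) (fun n _ => pow_nonneg hq0 n) (hasSum_geometric_of_lt_one hq0 hsmall)
  have hC : 0 ≤ A * B6.c1 d δ₀ α * Q b * Real.exp (-((1 - 2 * α) * δ₀ * g.dist a b)) :=
    mul_nonneg (mul_nonneg (mul_nonneg hA (c1_nonneg d δ₀ α)) (hQ b)) (Real.exp_nonneg _)
  calc ∑ n ∈ Finset.range N, q ^ n * A * B6.c1 d δ₀ α * Q b * Real.exp (-((1 - 2 * α) * δ₀ * g.dist a b))
      = A * B6.c1 d δ₀ α * Q b * Real.exp (-((1 - 2 * α) * δ₀ * g.dist a b)) * ∑ n ∈ Finset.range N, q ^ n := by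
        rw [Finset.mul_sum]; refine Finset.sum_congr rfl fun n _ => ?_; ring
    _ ≤ A * B6.c1 d δ₀ α * Q b * Real.exp (-((1 - 2 * α) * δ₀ * g.dist a b)) * (1 - q)⁻¹ :=
        mul_le_mul_of_nonneg_left hgeom hC
    _ = _ := by ring

/-- **A LEFT fixed point T = T₀ + V·T on a finite lattice** — the theorem behind the RIGHT entries of (3.42) for a
perturbed operator ((3.65)₁ p. 402: *"G′(U′U) = G′(U) + G′(U)V′(A)G′(U′U)"*, multiplied by ∇*_U on the right): V with
majorant θe^{−δ₀d(y,y′)}, θc₁(α) < 1, and T₀ with the input-weighted majorant A·Q(y′)e^{−(1−α)δ₀d(y,y′)} give T the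
majorant A c₁(α)(1 − θc₁(α))^{−1}Q(y′)e^{−(1−2α)δ₀d(y,y′)}; the remainder V^N T of `leftFixedPoint_telescope` is killed
by (2.65) as N → ∞, using only that T is SOME linear map on the finite lattice (`exists_opBound`) and that the lattice
has finitely many blocks. [cite: Balaban1984PropagatorsII, Prop. 2.2 (2.65)–(2.66) p.234; Balaban1985BackgroundPropagators, (3.64)–(3.65) p.402 + p.403 l.1–9] -/
theorem majorant_of_leftFixedPoint [Fintype X] [DecidableEq X] (blk : X → g.Site) (d : ℕ) (δ₀ α θ A : ℝ)
    (Q : g.Site → ℝ) (hA : 0 ≤ A) (hQ : ∀ y, 0 ≤ Q y) (hθ : 0 ≤ θ) (hαδ : 0 ≤ α * δ₀)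
    (hαδ2 : 0 ≤ (1 - 2 * α) * δ₀) (htri : Triangle254 g) (hrefl : ∀ y : g.Site, g.dist y y = 0)
    (hsym : ∀ y y' : g.Site, g.dist y y' = g.dist y' y) (hdnn : ∀ y y' : g.Site, 0 ≤ g.dist y y')
    (h261 : Ineq261 d g δ₀ α) (h263 : Ineq263 d g δ₀ α) (hsmall : θ * B6.c1 d δ₀ α < 1)
    {T T₀ V : Module.End ℝ (X → ℝ)}
    (hT₀ : HasMajorant blk T₀ (fun a b => A * Q b * Real.exp (-((1 - α) * δ₀ * g.dist a b))))
    (hV : HasMajorant blk V (fun a b => θ * Real.exp (-(δ₀ * g.dist a b)))) (hfix : T = T₀ + V * T) :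
    HasMajorant blk T
      (fun a b => A * B6.c1 d δ₀ α * (1 - θ * B6.c1 d δ₀ α)⁻¹ * Q b *
        Real.exp (-((1 - 2 * α) * δ₀ * g.dist a b))) := by
  intro y' μ B hμ x
  obtain ⟨E, hE, hEb⟩ := exists_opBound T
  set q : ℝ := θ * B6.c1 d δ₀ α with hq
  have hq0 : 0 ≤ q := mul_nonneg hθ (c1_nonneg d δ₀ α)
  have h1α : 0 ≤ (1 - α) * δ₀ := by nlinarith [hαδ, hαδ2]
  set C : ℝ := A * B6.c1 d δ₀ α * (1 - q)⁻¹ * Q y' * Real.exp (-((1 - 2 * α) * δ₀ * g.dist (blk x) y')) * B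
    with hC
  have hμsup : ∀ z, |μ z| ≤ B := fun z => by
    by_cases hz : blk z = y'
    · exact hμ.bound z hz
    · rw [hμ.off z hz, abs_zero]; exact hμ.nonneg
  have hν : ∀ z, |T μ z| ≤ E * B := hEb μ B hμ.nonneg hμsup
  -- for every N: |Tμ(x)| ≤ C + |𝔅|·E·B·q^N
  have hN : ∀ N : ℕ, |T μ x| ≤ C + (Fintype.card g.Site : ℝ) * E * B * q ^ N := by
    intro N
    have hS := majorant_leftPartialSum blk d δ₀ α θ A Q hA hQ hθ hαδ hαδ2 htri hrefl hsym hdnn h261 h263 hsmall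
      hT₀ hV N y' μ B hμ x
    have hVN := majorant_pow_265 blk d δ₀ α θ hθ hrefl h263 hV N
    have hpiece : ∀ y'' : g.Site, |(V ^ N) (blockPiece blk y'' (T μ)) x| ≤ q ^ N * (E * B) := by
      intro y''
      have h1 := hVN y'' (blockPiece blk y'' (T μ)) (E * B)
        (blockSupp_blockPiece blk (T μ) y'' (E * B) (mul_nonneg hE hμ.nonneg) (fun z _ => hν z)) x
      refine h1.trans ?_
      have hexp : Real.exp (-((1 - α) * δ₀ * g.dist (blk x) y'')) ≤ 1 := by
        rw [Real.exp_le_one_iff]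
        have := mul_nonneg h1α (hdnn (blk x) y'')
        linarith
      have := mul_le_mul_of_nonneg_left hexp (pow_nonneg hq0 N)
      simpa [hq] using mul_le_mul_of_nonneg_right this (mul_nonneg hE hμ.nonneg)
    have hrem : |(V ^ N * T) μ x| ≤ (Fintype.card g.Site : ℝ) * E * B * q ^ N := by
      rw [Module.End.mul_apply]
      conv_lhs => rw [← sum_blockPiece blk (T μ), map_sum, Finset.sum_apply]
      refine (Finset.abs_sum_le_sum_abs _ _).trans ?_
      calc ∑ y'' : g.Site, |(V ^ N) (blockPiece blk y'' (T μ)) x|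
          ≤ ∑ y'' : g.Site, q ^ N * (E * B) := Finset.sum_le_sum fun y'' _ => hpiece y''
        _ = (Fintype.card g.Site : ℝ) * E * B * q ^ N := by
            rw [Finset.sum_const, nsmul_eq_mul, Finset.card_univ]; ring
    have hsplit : T μ x = (∑ n ∈ Finset.range N, V ^ n * T₀) μ x + (V ^ N * T) μ x := by
      conv_lhs => rw [leftFixedPoint_telescope hfix N]
      rfl
    rw [hsplit]
    refine (abs_add_le _ _).trans ?_
    have h1 : |(∑ n ∈ Finset.range N, V ^ n * T₀) μ x| ≤ C := by simpa [hC, hq] using hS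
    linarith [hrem, h1]
  -- let N → ∞
  have hlim : Filter.Tendsto (fun N : ℕ => C + (Fintype.card g.Site : ℝ) * E * B * q ^ N) Filter.atTop
      (nhds (C + (Fintype.card g.Site : ℝ) * E * B * 0)) :=
    ((tendsto_pow_atTop_nhds_zero_of_lt_one hq0 hsmall).const_mul ((Fintype.card g.Site : ℝ) * E * B)).const_add C
  rw [mul_zero, add_zero] at hlim
  have := ge_of_tendsto' hlim hN
  simpa [hC, hq] using this

end LeftNeumann

/-! ## (i) Transport of LEFT chains to pv08: the block operator (V T; 0 0) on the functions on X ⊕ Y -/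

section EmbeddingL

variable {g : B6.Geometry} {X Y : Type}

/-- The block operator (V T; 0 0) on the functions on X ⊕ Y: f ↦ (V(f|_X) + T(f|_Y), 0) — ONE endomorphism carrying
the pair (V : X → X, T : Y → X) of a LEFT chain VⁿT. [folklore] -/
def embL (V : Module.End ℝ (X → ℝ)) (T : (Y → ℝ) →ₗ[ℝ] (X → ℝ)) : Module.End ℝ (X ⊕ Y → ℝ) where
  toFun f := Sum.elim (V (f ∘ Sum.inl) + T (f ∘ Sum.inr)) 0
  map_add' f f' := by
    have h1 : (f + f') ∘ Sum.inl = f ∘ Sum.inl + f' ∘ Sum.inl := rfl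
    have h2 : (f + f') ∘ Sum.inr = f ∘ Sum.inr + f' ∘ Sum.inr := rfl
    simp only [h1, h2, map_add]
    funext z
    rcases z with x | v
    · show (V (f ∘ Sum.inl) + V (f' ∘ Sum.inl) + (T (f ∘ Sum.inr) + T (f' ∘ Sum.inr))) x =
        (V (f ∘ Sum.inl) + T (f ∘ Sum.inr)) x + (V (f' ∘ Sum.inl) + T (f' ∘ Sum.inr)) x
      simp only [Pi.add_apply]
      ring
    · show (0 : ℝ) = 0 + 0
      rw [add_zero]
  map_smul' c f := by
    have h1 : (c • f) ∘ Sum.inl = c • (f ∘ Sum.inl) := rfl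
    have h2 : (c • f) ∘ Sum.inr = c • (f ∘ Sum.inr) := rfl
    simp only [h1, h2, map_smul, RingHom.id_apply]
    funext z
    rcases z with x | v
    · show (c • V (f ∘ Sum.inl) + c • T (f ∘ Sum.inr)) x = c * (V (f ∘ Sum.inl) + T (f ∘ Sum.inr)) x
      simp only [Pi.add_apply, Pi.smul_apply, smul_eq_mul]
      ring
    · show (0 : ℝ) = c * 0
      rw [mul_zero]

/-- The X-component of (V T; 0 0)f is V(f|_X) + T(f|_Y). [folklore] -/
@[simp] theorem embL_apply_inl (V : Module.End ℝ (X → ℝ)) (T : (Y → ℝ) →ₗ[ℝ] (X → ℝ)) (f : X ⊕ Y → ℝ) (x : X) :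
    embL V T f (Sum.inl x) = (V (f ∘ Sum.inl) + T (f ∘ Sum.inr)) x :=
  rfl

/-- The Y-component of (V T; 0 0)f is 0. [folklore] -/
@[simp] theorem embL_apply_inr (V : Module.End ℝ (X → ℝ)) (T : (Y → ℝ) →ₗ[ℝ] (X → ℝ)) (f : X ⊕ Y → ℝ) (v : Y) :
    embL V T f (Sum.inr v) = 0 :=
  rfl

/-- Block multiplication: (V T; 0 0)(V′ T′; 0 0) = (VV′ VT′; 0 0). [folklore] -/
theorem embL_mul (V V' : Module.End ℝ (X → ℝ)) (T T' : (Y → ℝ) →ₗ[ℝ] (X → ℝ)) :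
    embL V T * embL V' T' = embL (V * V') (V ∘ₗ T') := by
  apply LinearMap.ext
  intro f
  funext z
  rcases z with x | v
  · show (V ((embL V' T' f) ∘ Sum.inl) + T ((embL V' T' f) ∘ Sum.inr)) x =
      ((V * V') (f ∘ Sum.inl) + (V ∘ₗ T') (f ∘ Sum.inr)) x
    have h1 : (embL V' T' f) ∘ Sum.inl = V' (f ∘ Sum.inl) + T' (f ∘ Sum.inr) := rfl
    have h2 : (embL V' T' f) ∘ Sum.inr = 0 := rfl
    rw [h1, h2, map_zero, add_zero, map_add]
    rfl
  · rfl

/-- Block addition: (V T; 0 0) + (V′ T′; 0 0) = (V + V′ T + T′; 0 0). [folklore] -/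
theorem embL_add (V V' : Module.End ℝ (X → ℝ)) (T T' : (Y → ℝ) →ₗ[ℝ] (X → ℝ)) :
    embL V T + embL V' T' = embL (V + V') (T + T') := by
  apply LinearMap.ext
  intro f
  funext z
  rcases z with x | v
  · show (V (f ∘ Sum.inl) + T (f ∘ Sum.inr)) x + (V' (f ∘ Sum.inl) + T' (f ∘ Sum.inr)) x =
      ((V + V') (f ∘ Sum.inl) + (T + T') (f ∘ Sum.inr)) x
    simp only [LinearMap.add_apply, Pi.add_apply]
    ring
  · show (0 : ℝ) + 0 = 0
    rw [add_zero]

/-- A LEFT fixed point T = T₀ + V·T between two spaces becomes the pv08-shaped LEFT fixed point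
(0 T; 0 0) = (0 T₀; 0 0) + (V 0; 0 0)(0 T; 0 0) on X ⊕ Y. [folklore] -/
theorem embL_leftFixpoint {T T₀ : (Y → ℝ) →ₗ[ℝ] (X → ℝ)} {V : Module.End ℝ (X → ℝ)} (hfix : T = T₀ + V ∘ₗ T) :
    embL 0 T = embL 0 T₀ + embL V 0 * embL 0 T := by
  rw [embL_mul, mul_zero, embL_add, add_zero, ← hfix]

/-- A function on X ⊕ Y block-supported at y′ restricts to a function on Y block-supported at y′. [folklore] -/
theorem blockSupp_compInr {blkX : X → g.Site} {blkY : Y → g.Site} {μ : X ⊕ Y → ℝ} {y' : g.Site} {B : ℝ}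
    (h : BlockSupp (Sum.elim blkX blkY) μ y' B) : BlockSupp blkY (μ ∘ Sum.inr) y' B :=
  ⟨h.nonneg, fun v hv => h.bound (Sum.inr v) hv, fun v hv => h.off (Sum.inr v) hv⟩

/-- A function on Y block-supported at y′, extended by 0 to X ⊕ Y, is block-supported at y′. [folklore] -/
theorem blockSupp_sumElim_right {blkX : X → g.Site} {blkY : Y → g.Site} {μ : Y → ℝ} {y' : g.Site} {B : ℝ}
    (h : BlockSupp blkY μ y' B) : BlockSupp (Sum.elim blkX blkY) (Sum.elim (0 : X → ℝ) μ) y' B := by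
  refine ⟨h.nonneg, ?_, ?_⟩
  · rintro (x | v) hx
    · show |(0 : X → ℝ) x| ≤ B
      simpa using h.nonneg
    · exact h.bound v hx
  · rintro (x | v) hx
    · rfl
    · exact h.off v hx

/-- TO pv08, the V-block: a majorant K ≥ 0 of V is a pv08 majorant of (V 0; 0 0) over `Sum.elim blkX blkY`. [folklore] -/
theorem hasMajorant_embL_left {blkX : X → g.Site} {blkY : Y → g.Site} {V : Module.End ℝ (X → ℝ)}
    {K : g.Site → g.Site → ℝ} (hV : HasMajorant blkX V K) (hK : ∀ a b, 0 ≤ K a b) :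
    HasMajorant (Sum.elim blkX blkY) (embL V (0 : (Y → ℝ) →ₗ[ℝ] (X → ℝ))) K := by
  intro y' μ B hμ z
  rcases z with x | v
  · show |(V (μ ∘ Sum.inl) + (0 : (Y → ℝ) →ₗ[ℝ] (X → ℝ)) (μ ∘ Sum.inr)) x| ≤ K (blkX x) y' * B
    rw [LinearMap.zero_apply, add_zero]
    exact hV y' _ B (blockSupp_compInl hμ) x
  · show |(0 : Y → ℝ) v| ≤ K (blkY v) y' * B
    simpa using mul_nonneg (hK _ _) hμ.nonneg

/-- TO pv08, the T-block: a two-space majorant K ≥ 0 of T : (Y → ℝ) → (X → ℝ) is a pv08 majorant of (0 T; 0 0).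
[folklore] -/
theorem hasMajorant_embL_right {blkX : X → g.Site} {blkY : Y → g.Site} {T : (Y → ℝ) →ₗ[ℝ] (X → ℝ)}
    {K : g.Site → g.Site → ℝ} (hT : HasMajorantHom blkY blkX T K) (hK : ∀ a b, 0 ≤ K a b) :
    HasMajorant (Sum.elim blkX blkY) (embL (0 : Module.End ℝ (X → ℝ)) T) K := by
  intro y' μ B hμ z
  rcases z with x | v
  · show |((0 : Module.End ℝ (X → ℝ)) (μ ∘ Sum.inl) + T (μ ∘ Sum.inr)) x| ≤ K (blkX x) y' * B
    rw [LinearMap.zero_apply, zero_add]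
    exact hT y' _ B (blockSupp_compInr hμ) x
  · show |(0 : Y → ℝ) v| ≤ K (blkY v) y' * B
    simpa using mul_nonneg (hK _ _) hμ.nonneg

/-- FROM pv08, the T-block: a pv08 majorant of (V T; 0 0) is a two-space majorant of T (test on the functions
extended by 0 from Y). [folklore] -/
theorem hasMajorantHom_of_embL {blkX : X → g.Site} {blkY : Y → g.Site} {V : Module.End ℝ (X → ℝ)}
    {T : (Y → ℝ) →ₗ[ℝ] (X → ℝ)} {K : g.Site → g.Site → ℝ}
    (h : HasMajorant (Sum.elim blkX blkY) (embL V T) K) : HasMajorantHom blkY blkX T K := by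
  intro y' μ B hμ x
  have h0 := h y' (Sum.elim 0 μ) B (blockSupp_sumElim_right hμ) (Sum.inl x)
  have h1 : (Sum.elim (0 : X → ℝ) μ) ∘ Sum.inl = 0 := rfl
  have h2 : (Sum.elim (0 : X → ℝ) μ) ∘ Sum.inr = μ := rfl
  rw [embL_apply_inl, h1, h2, map_zero, zero_add] at h0
  exact h0

/-- **A LEFT fixed point between two spaces**, T = T₀ + V·T with T, T₀ : (Y → ℝ) → (X → ℝ) (e.g. T₀ = G′(U)∇*_U,
V = G′(U)V′(A), T = G′(U′U)∇*_U as in (3.65)₁·∇*_U): the conclusion of `majorant_of_leftFixedPoint`, transported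
through (V T; 0 0) on X ⊕ Y. [cite: Balaban1984PropagatorsII, Prop. 2.2 (2.65)–(2.66) p.234; Balaban1985BackgroundPropagators, (3.65) p.402 + p.403 l.1–9] -/
theorem hom_majorant_of_leftFixedPoint [Fintype X] [DecidableEq X] [Fintype Y] [DecidableEq Y]
    (blkX : X → g.Site) (blkY : Y → g.Site) (d : ℕ) (δ₀ α θ A : ℝ) (Q : g.Site → ℝ)
    (hA : 0 ≤ A) (hQ : ∀ y, 0 ≤ Q y) (hθ : 0 ≤ θ) (hαδ : 0 ≤ α * δ₀) (hαδ2 : 0 ≤ (1 - 2 * α) * δ₀)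
    (htri : Triangle254 g) (hrefl : ∀ y : g.Site, g.dist y y = 0)
    (hsym : ∀ y y' : g.Site, g.dist y y' = g.dist y' y) (hdnn : ∀ y y' : g.Site, 0 ≤ g.dist y y')
    (h261 : Ineq261 d g δ₀ α) (h263 : Ineq263 d g δ₀ α) (hsmall : θ * B6.c1 d δ₀ α < 1)
    {T T₀ : (Y → ℝ) →ₗ[ℝ] (X → ℝ)} {V : Module.End ℝ (X → ℝ)}
    (hT₀ : HasMajorantHom blkY blkX T₀ (fun a b => A * Q b * Real.exp (-((1 - α) * δ₀ * g.dist a b))))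
    (hV : HasMajorant blkX V (fun a b => θ * Real.exp (-(δ₀ * g.dist a b)))) (hfix : T = T₀ + V ∘ₗ T) :
    HasMajorantHom blkY blkX T
      (fun a b => A * B6.c1 d δ₀ α * (1 - θ * B6.c1 d δ₀ α)⁻¹ * Q b *
        Real.exp (-((1 - 2 * α) * δ₀ * g.dist a b))) := by
  have hVe : HasMajorant (Sum.elim blkX blkY) (embL V (0 : (Y → ℝ) →ₗ[ℝ] (X → ℝ)))
      (fun a b => θ * Real.exp (-(δ₀ * g.dist a b))) :=
    hasMajorant_embL_left hV fun a b => mul_nonneg hθ (Real.exp_nonneg _)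
  have hT₀e : HasMajorant (Sum.elim blkX blkY) (embL (0 : Module.End ℝ (X → ℝ)) T₀)
      (fun a b => A * Q b * Real.exp (-((1 - α) * δ₀ * g.dist a b))) :=
    hasMajorant_embL_right hT₀ fun a b => mul_nonneg (mul_nonneg hA (hQ b)) (Real.exp_nonneg _)
  exact hasMajorantHom_of_embL (majorant_of_leftFixedPoint (Sum.elim blkX blkY) d δ₀ α θ A Q hA hQ hθ hαδ hαδ2
    htri hrefl hsym hdnn h261 h263 hsmall hT₀e hVe (embL_leftFixpoint hfix))

/-- D_W D_{W⁻¹} S = S for a nowhere-vanishing block weight. [folklore] -/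
theorem blockDiag_cancel_comp (blk : X → g.Site) {W : g.Site → ℝ} (hW : ∀ y, W y ≠ 0)
    (S : (Y → ℝ) →ₗ[ℝ] (X → ℝ)) :
    blockDiag blk W ∘ₗ (blockDiag blk (fun y => (W y)⁻¹) ∘ₗ S) = S := by
  rw [← LinearMap.comp_assoc, ← Module.End.mul_eq_comp, blockDiag_mul_inv blk hW, Module.End.one_eq_id,
    LinearMap.id_comp]

/-- **The SCALE-WEIGHTED left fixed point** — the form in which (3.65)₁ is used for a right entry of (3.42): T₀ with
the OUTPUT-weighted majorant A·W(y)Q(y)·e^{−δ₀d(y,y′)} (W(y) = (L^jη)² > 0 the weight of entry 1, Q(y) = (L^jη)^{−1}),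
V with the scale-weighted majorant θ·W(y)W(y′)^{−1}·e^{−δ₀d(y,y′)}, and the convention of p. 398 (*"the choice of powers
L^jη is conventional also"*) in the form Q(y) ≦ C·Q(y′)·e^{αδ₀d(y,y′)} (for Q = (L^jη)^{−1}: L^{j′−j} ≦ Ce^{αδ₀d(y,y′)}, a consequence of the
geometry (3.24)–(3.28)) give T = T₀ + V·T the majorant A C c₁(α)(1 − θc₁(α))^{−1}·W(y)Q(y′)·e^{−(1−2α)δ₀d(y,y′)}.
Proof: conjugate by D_W (`hasMajorant_conj`: the conjugated V has majorant θe^{−δ₀d} EXACTLY), move Q to the input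
block, `hom_majorant_of_leftFixedPoint`, undo the conjugation.
[cite: Balaban1985BackgroundPropagators, p.398 (remarks after Thm 3.1) + (3.65) p.402; Balaban1984PropagatorsII, (2.66) p.234] -/
theorem hom_majorant_of_leftFixedPoint_weighted [Fintype X] [DecidableEq X] [Fintype Y] [DecidableEq Y]
    (blkX : X → g.Site) (blkY : Y → g.Site) (d : ℕ) (δ₀ α θ A C : ℝ) (W Q : g.Site → ℝ)
    (hA : 0 ≤ A) (hC : 0 ≤ C) (hW : ∀ y, 0 < W y) (hQ : ∀ y, 0 ≤ Q y) (hθ : 0 ≤ θ) (hαδ : 0 ≤ α * δ₀)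
    (hαδ2 : 0 ≤ (1 - 2 * α) * δ₀) (htri : Triangle254 g) (hrefl : ∀ y : g.Site, g.dist y y = 0)
    (hsym : ∀ y y' : g.Site, g.dist y y' = g.dist y' y) (hdnn : ∀ y y' : g.Site, 0 ≤ g.dist y y')
    (h261 : Ineq261 d g δ₀ α) (h263 : Ineq263 d g δ₀ α) (hsmall : θ * B6.c1 d δ₀ α < 1)
    (htransfer : ∀ a b : g.Site, Q a ≤ C * Q b * Real.exp (α * δ₀ * g.dist a b))
    {T T₀ : (Y → ℝ) →ₗ[ℝ] (X → ℝ)} {V : Module.End ℝ (X → ℝ)}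
    (hT₀ : HasMajorantHom blkY blkX T₀ (fun a b => A * W a * Q a * Real.exp (-(δ₀ * g.dist a b))))
    (hV : HasMajorant blkX V (fun a b => θ * W a * (W b)⁻¹ * Real.exp (-(δ₀ * g.dist a b))))
    (hfix : T = T₀ + V ∘ₗ T) :
    HasMajorantHom blkY blkX T
      (fun a b => A * C * B6.c1 d δ₀ α * (1 - θ * B6.c1 d δ₀ α)⁻¹ * W a * Q b *
        Real.exp (-((1 - 2 * α) * δ₀ * g.dist a b))) := by
  have hWne : ∀ y, W y ≠ 0 := fun y => (hW y).ne'
  have hWi0 : ∀ y, 0 ≤ (W y)⁻¹ := fun y => inv_nonneg.mpr (hW y).le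
  -- the conjugated data
  have hV' : HasMajorant blkX (blockDiag blkX (fun y => (W y)⁻¹) * V * blockDiag blkX W)
      (fun a b => θ * Real.exp (-(δ₀ * g.dist a b))) := by
    refine hasMajorant_mono blkX (hasMajorant_conj blkX hV W hW) fun a b => le_of_eq ?_
    calc (W a)⁻¹ * (θ * W a * (W b)⁻¹ * Real.exp (-(δ₀ * g.dist a b))) * W b
        = θ * Real.exp (-(δ₀ * g.dist a b)) * ((W a)⁻¹ * W a) * ((W b)⁻¹ * W b) := by ring
      _ = θ * Real.exp (-(δ₀ * g.dist a b)) := by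
          rw [inv_mul_cancel₀ (hWne a), inv_mul_cancel₀ (hWne b), mul_one, mul_one]
  have hT₀' : HasMajorantHom blkY blkX (blockDiag blkX (fun y => (W y)⁻¹) ∘ₗ T₀)
      (fun a b => A * C * Q b * Real.exp (-((1 - α) * δ₀ * g.dist a b))) := by
    refine hasMajorantHom_mono blkY blkX (hasMajorantHom_blockDiag_comp blkY blkX hT₀ _ hWi0) fun a b => ?_
    have hexp : Real.exp (α * δ₀ * g.dist a b) * Real.exp (-(δ₀ * g.dist a b)) =
        Real.exp (-((1 - α) * δ₀ * g.dist a b)) := by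
      rw [← Real.exp_add]
      congr 1
      ring
    calc (W a)⁻¹ * (A * W a * Q a * Real.exp (-(δ₀ * g.dist a b)))
        = A * Q a * Real.exp (-(δ₀ * g.dist a b)) * ((W a)⁻¹ * W a) := by ring
      _ = A * Q a * Real.exp (-(δ₀ * g.dist a b)) := by rw [inv_mul_cancel₀ (hWne a), mul_one]
      _ ≤ A * (C * Q b * Real.exp (α * δ₀ * g.dist a b)) * Real.exp (-(δ₀ * g.dist a b)) :=
          mul_le_mul_of_nonneg_right (mul_le_mul_of_nonneg_left (htransfer a b) hA) (Real.exp_nonneg _)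
      _ = A * C * Q b * (Real.exp (α * δ₀ * g.dist a b) * Real.exp (-(δ₀ * g.dist a b))) := by ring
      _ = A * C * Q b * Real.exp (-((1 - α) * δ₀ * g.dist a b)) := by rw [hexp]
  have hfix' : blockDiag blkX (fun y => (W y)⁻¹) ∘ₗ T = blockDiag blkX (fun y => (W y)⁻¹) ∘ₗ T₀ +
      (blockDiag blkX (fun y => (W y)⁻¹) * V * blockDiag blkX W) ∘ₗ (blockDiag blkX (fun y => (W y)⁻¹) ∘ₗ T) := by
    conv_lhs => rw [hfix, ← blockDiag_cancel_comp blkX hWne T]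
    rw [LinearMap.comp_add]
    simp only [Module.End.mul_eq_comp, LinearMap.comp_assoc]
  have h := hom_majorant_of_leftFixedPoint blkX blkY d δ₀ α θ (A * C) Q (mul_nonneg hA hC) hQ hθ hαδ hαδ2 htri
    hrefl hsym hdnn h261 h263 hsmall hT₀' hV' hfix'
  -- undo the conjugation
  rw [← blockDiag_cancel_comp blkX hWne T]
  refine hasMajorantHom_mono blkY blkX (hasMajorantHom_blockDiag_comp blkY blkX h W fun y => (hW y).le)
    fun a b => le_of_eq ?_
  ring

end EmbeddingL

/-! ## (j) The RIGHT entry of (3.42) for G′(U′U), from (3.65)₁ -/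

section B9SideLeft

open B9Thm34Ext

variable {g : B9.Geometry} [Fintype g.Site] {R : ℝ} {H : Prop} {X Y : Type}

/-- Algebra of (3.65)₁ read on a right entry D (e.g. D = ∇*_U): G′(U′U) = G′(U) + G′(U)V′(A)G′(U′U) gives
G′(U′U)D = G′(U)D + (G′(U)V′(A))·(G′(U′U)D) — a LEFT fixed point for T = G′(U′U)D. [folklore] -/
theorem rightEntry_fixpoint {GpU GpExt V' : Module.End ℝ (X → ℝ)} (D : (Y → ℝ) →ₗ[ℝ] (X → ℝ))
    (h365 : GpExt = GpU + GpU * V' * GpExt) :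
    GpExt ∘ₗ D = GpU ∘ₗ D + (GpU * V') ∘ₗ (GpExt ∘ₗ D) := by
  conv_lhs => rw [h365]
  rw [LinearMap.add_comp]
  simp only [Module.End.mul_eq_comp, LinearMap.comp_assoc]

/-- **(3.65)₁ ⇒ (3.42)₃ for G′(U′U), constants explicit** — the RIGHT entry |G′(U′U)∇*_Uλ| of (3.42) for the
perturbed operator (p. 403 l. 1–9: *"we can prove all the statements (3.42)–(3.47) of Theorem 3.1 for the operator
G′(U′U), of course with different constants"*), from the FIRST identity of (3.65) p. 402, *"G′(U′U) = G′(U) +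
G′(U)V′(A)G′(U′U)"*, multiplied on the right by D = ∇*_U.  Hypotheses of the printed shape: `h342D` = (3.42)₃ for G′(U)
as a two-space majorant B₀·W(y)Q(y)·e^{−δ₀d(y,y′)} of G′(U)D (W = (L^jη)², WQ = L^jη); `htransfer` = the p. 398
convention *"we may replace the factor (L^jη)^α by (L^jη)^β(L^{j′}η)^γ with β + γ = α"* in kernel form.  The
hypothesis `hGV` — a SCALE-WEIGHTED majorant θ·W(y)W(y′)^{−1}e^{−δ₀d(y,y′)} of the LEFT-routed composite G′(U)V′(A) —
is NOT displayed in print: (3.61) p. 402 bounds V′(A)λ by derivatives OF λ and (3.63) is the RIGHT-routed composite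
V′(A)G′(U); its derivation needs the structure (3.60) of V′(A) and is recorded as the located objection GAPS G-pv21g2-2
(the all-left routing is forced: the right-routed series for a right entry ends in the mixed kernel ∇_UG′(U)∇*_U, for
which only the Hölder bound (3.44), *"B′₀(ε) → ∞ if ε → 0"*, is in print).  Conclusion: |(G′(U′U)Dλ)(x)| ≦
B₀Cc₁(α)(1 − θc₁(α))^{−1}·W(y)Q(y′)·e^{−(1−2α)δ₀d(y,y′)}|λ| for x in the block of y, supp λ ⊂ Δ(y′) — entry 3 with the
powers of L^jη placed as (L^jη)²(L^{j′}η)^{−1}, which p. 398 declares conventional.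
[cite: Balaban1985BackgroundPropagators, (3.42) p.397, p.398 (remarks), (3.60)–(3.65) pp.402–403; Balaban1984PropagatorsII, (2.66) p.234] -/
theorem b9_rightEntry_of_365 [Fintype X] [DecidableEq X] [Fintype Y] [DecidableEq Y]
    (blkX : X → g.Site) (blkY : Y → g.Site) (d : ℕ) (δ₀ α θ B₀ C : ℝ) (W Q : g.Site → ℝ)
    (hB₀ : 0 ≤ B₀) (hC : 0 ≤ C) (hW : ∀ y, 0 < W y) (hQ : ∀ y, 0 ≤ Q y) (hθ : 0 ≤ θ) (hαδ : 0 ≤ α * δ₀)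
    (hαδ2 : 0 ≤ (1 - 2 * α) * δ₀) (htri : Triangle254 (toB6 g R H)) (hrefl : ∀ y : g.Site, g.dist y y = 0)
    (hsym : ∀ y y' : g.Site, g.dist y y' = g.dist y' y) (hdnn : ∀ y y' : g.Site, 0 ≤ g.dist y y')
    (h261 : Ineq261 d (toB6 g R H) δ₀ α) (h263 : Ineq263 d (toB6 g R H) δ₀ α)
    (hsmall : θ * B6.c1 d δ₀ α < 1)
    (htransfer : ∀ a b : g.Site, Q a ≤ C * Q b * Real.exp (α * δ₀ * g.dist a b))
    {GpU GpExt V' : Module.End ℝ (X → ℝ)} {D : (Y → ℝ) →ₗ[ℝ] (X → ℝ)}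
    (h342D : HasMajorantHom (g := toB6 g R H) blkY blkX (GpU ∘ₗ D)
      (fun a b => B₀ * W a * Q a * Real.exp (-(δ₀ * g.dist a b))))
    (hGV : HasMajorant (g := toB6 g R H) blkX (GpU * V')
      (fun a b => θ * W a * (W b)⁻¹ * Real.exp (-(δ₀ * g.dist a b))))
    (h365 : GpExt = GpU + GpU * V' * GpExt) :
    HasMajorantHom (g := toB6 g R H) blkY blkX (GpExt ∘ₗ D)
      (fun a b => B₀ * C * B6.c1 d δ₀ α * (1 - θ * B6.c1 d δ₀ α)⁻¹ * W a * Q b *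
        Real.exp (-((1 - 2 * α) * δ₀ * g.dist a b))) :=
  hom_majorant_of_leftFixedPoint_weighted (g := toB6 g R H) blkX blkY d δ₀ α θ B₀ C W Q hB₀ hC hW hQ hθ hαδ hαδ2
    htri hrefl hsym hdnn h261 h263 hsmall htransfer h342D hGV (rightEntry_fixpoint D h365)

/-- **Entry 3 for G′(U′U) with the powers placed as printed**, B₀′·L^jη at the OUTPUT block: one more use of the
p. 398 convention (Q(y′) ≦ C·Q(y)·e^{αδ₀d(y,y′)}, the same hypothesis read through the symmetry of d) turns
W(y)Q(y′) into W(y)Q(y) at the cost of a third α in the rate: majorant B₀C²c₁(α)(1 − θc₁(α))^{−1}·W(y)Q(y)·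
e^{−(1−3α)δ₀d(y,y′)}. [cite: Balaban1985BackgroundPropagators, (3.42)₃ p.397 + p.398 (remarks) + p.403 l.1–9] -/
theorem b9_rightEntry_outputWeight_365 [Fintype X] [DecidableEq X] [Fintype Y] [DecidableEq Y]
    (blkX : X → g.Site) (blkY : Y → g.Site) (d : ℕ) (δ₀ α θ B₀ C : ℝ) (W Q : g.Site → ℝ)
    (hB₀ : 0 ≤ B₀) (hC : 0 ≤ C) (hW : ∀ y, 0 < W y) (hQ : ∀ y, 0 ≤ Q y) (hθ : 0 ≤ θ) (hαδ : 0 ≤ α * δ₀)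
    (hαδ2 : 0 ≤ (1 - 2 * α) * δ₀) (htri : Triangle254 (toB6 g R H)) (hrefl : ∀ y : g.Site, g.dist y y = 0)
    (hsym : ∀ y y' : g.Site, g.dist y y' = g.dist y' y) (hdnn : ∀ y y' : g.Site, 0 ≤ g.dist y y')
    (h261 : Ineq261 d (toB6 g R H) δ₀ α) (h263 : Ineq263 d (toB6 g R H) δ₀ α)
    (hsmall : θ * B6.c1 d δ₀ α < 1)
    (htransfer : ∀ a b : g.Site, Q a ≤ C * Q b * Real.exp (α * δ₀ * g.dist a b))
    {GpU GpExt V' : Module.End ℝ (X → ℝ)} {D : (Y → ℝ) →ₗ[ℝ] (X → ℝ)}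
    (h342D : HasMajorantHom (g := toB6 g R H) blkY blkX (GpU ∘ₗ D)
      (fun a b => B₀ * W a * Q a * Real.exp (-(δ₀ * g.dist a b))))
    (hGV : HasMajorant (g := toB6 g R H) blkX (GpU * V')
      (fun a b => θ * W a * (W b)⁻¹ * Real.exp (-(δ₀ * g.dist a b))))
    (h365 : GpExt = GpU + GpU * V' * GpExt) :
    HasMajorantHom (g := toB6 g R H) blkY blkX (GpExt ∘ₗ D)
      (fun a b => B₀ * C ^ 2 * B6.c1 d δ₀ α * (1 - θ * B6.c1 d δ₀ α)⁻¹ * W a * Q a *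
        Real.exp (-((1 - 3 * α) * δ₀ * g.dist a b))) := by
  have h := b9_rightEntry_of_365 (R := R) (H := H) blkX blkY d δ₀ α θ B₀ C W Q hB₀ hC hW hQ hθ hαδ hαδ2 htri hrefl
    hsym hdnn h261 h263 hsmall htransfer h342D hGV h365
  refine hasMajorantHom_mono (g := toB6 g R H) blkY blkX h fun a b => ?_
  have hq1 : θ * B6.c1 d δ₀ α ≤ 1 := hsmall.le
  have hinv : 0 ≤ (1 - θ * B6.c1 d δ₀ α)⁻¹ := inv_nonneg.mpr (by linarith)
  have hK : 0 ≤ B₀ * C * B6.c1 d δ₀ α * (1 - θ * B6.c1 d δ₀ α)⁻¹ * W a :=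
    mul_nonneg (mul_nonneg (mul_nonneg (mul_nonneg hB₀ hC) (c1_nonneg d δ₀ α)) hinv) (hW a).le
  have ht : Q b ≤ C * Q a * Real.exp (α * δ₀ * g.dist a b) := by
    have := htransfer b a
    rwa [hsym b a] at this
  have hexp : Real.exp (α * δ₀ * g.dist a b) * Real.exp (-((1 - 2 * α) * δ₀ * g.dist a b)) =
      Real.exp (-((1 - 3 * α) * δ₀ * g.dist a b)) := by
    rw [← Real.exp_add]
    congr 1
    ring
  show B₀ * C * B6.c1 d δ₀ α * (1 - θ * B6.c1 d δ₀ α)⁻¹ * W a * Q b *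
      Real.exp (-((1 - 2 * α) * δ₀ * (toB6 g R H).dist a b)) ≤
    B₀ * C ^ 2 * B6.c1 d δ₀ α * (1 - θ * B6.c1 d δ₀ α)⁻¹ * W a * Q a *
      Real.exp (-((1 - 3 * α) * δ₀ * (toB6 g R H).dist a b))
  simp only [toB6_dist]
  calc B₀ * C * B6.c1 d δ₀ α * (1 - θ * B6.c1 d δ₀ α)⁻¹ * W a * Q b *
        Real.exp (-((1 - 2 * α) * δ₀ * g.dist a b))
      ≤ B₀ * C * B6.c1 d δ₀ α * (1 - θ * B6.c1 d δ₀ α)⁻¹ * W a * (C * Q a * Real.exp (α * δ₀ * g.dist a b)) *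
        Real.exp (-((1 - 2 * α) * δ₀ * g.dist a b)) :=
        mul_le_mul_of_nonneg_right (mul_le_mul_of_nonneg_left ht hK) (Real.exp_nonneg _)
    _ = B₀ * C ^ 2 * B6.c1 d δ₀ α * (1 - θ * B6.c1 d δ₀ α)⁻¹ * W a * Q a *
        (Real.exp (α * δ₀ * g.dist a b) * Real.exp (-((1 - 2 * α) * δ₀ * g.dist a b))) := by ring
    _ = _ := by rw [hexp]

end B9SideLeft

/-! ## (k) A local operator on the RIGHT of a decaying one (column-sum form) -/

section LocalRight

variable {g : B6.Geometry} {X Y Z : Type}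

/-- **A LOCAL operator on the RIGHT of a decaying one (two-space form; mirror of `local_mul_majorant`).**  If S maps
functions on the lattice Y to functions on Z with majorant A·F(y)·e^{−δ₀d(y,y″)} and B maps functions on X to functions
on Y with a majorant K_B(y″,y′) ≥ 0 that is LOCAL in the sense of (3.61) p. 402 — K_B(y″,y′) ≠ 0 only if d(y″,y′) ≤ ρ
(*"for x ∈ B^j(Λ_j), the norms on the right-hand side restricted to the block B^j(y) containing the point x"*) — with column sums
Σ_{y″}K_B(y″,y′) ≤ ϑ(y′), then SB has majorant A·e^{δ₀ρ}·F(y)·ϑ(y′)·e^{−δ₀d(y,y′)}: insert the partition over the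
middle lattice ([4] (2.52)–(2.55)) and use the triangle inequality (2.54) on the ≤ ρ-neighbourhood of y′.
[cite: Balaban1984PropagatorsII, (2.52)–(2.55) p.232–233; Balaban1985BackgroundPropagators, (3.61) p.402] -/
theorem hom_majorant_comp_localRight (blkX : X → g.Site) (blkY : Y → g.Site) (blkZ : Z → g.Site)
    (δ₀ ρ A : ℝ) (F ϑ : g.Site → ℝ) (KB : g.Site → g.Site → ℝ)
    (hA : 0 ≤ A) (hF : ∀ y, 0 ≤ F y) (hδ₀ : 0 ≤ δ₀) (htri : Triangle254 g)
    (hKB : ∀ a b, 0 ≤ KB a b) (hloc : ∀ y'' b, KB y'' b ≠ 0 → g.dist y'' b ≤ ρ)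
    (hcol : ∀ b, ∑ y'' : g.Site, KB y'' b ≤ ϑ b)
    {S : (Y → ℝ) →ₗ[ℝ] (Z → ℝ)} {B : (X → ℝ) →ₗ[ℝ] (Y → ℝ)}
    (hS : HasMajorantHom blkY blkZ S (fun a b => A * F a * Real.exp (-(δ₀ * g.dist a b))))
    (hB : HasMajorantHom blkX blkY B KB) :
    HasMajorantHom blkX blkZ (S ∘ₗ B)
      (fun a b => A * Real.exp (δ₀ * ρ) * F a * ϑ b * Real.exp (-(δ₀ * g.dist a b))) := by
  refine hasMajorantHom_mono blkX blkZ (hasMajorantHom_comp blkX blkY blkZ hS hB hKB) fun a b => ?_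
  have hcoef : 0 ≤ A * F a * Real.exp (δ₀ * ρ) * Real.exp (-(δ₀ * g.dist a b)) :=
    mul_nonneg (mul_nonneg (mul_nonneg hA (hF a)) (Real.exp_nonneg _)) (Real.exp_nonneg _)
  have hterm : ∀ y'' : g.Site, A * F a * Real.exp (-(δ₀ * g.dist a y'')) * KB y'' b ≤
      A * F a * Real.exp (δ₀ * ρ) * Real.exp (-(δ₀ * g.dist a b)) * KB y'' b := by
    intro y''
    by_cases hz : KB y'' b = 0
    · simp [hz]
    · have hd : g.dist y'' b ≤ ρ := hloc y'' b hz
      have h1 : δ₀ * g.dist a b ≤ δ₀ * g.dist a y'' + δ₀ * g.dist y'' b := by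
        have := mul_le_mul_of_nonneg_left (htri a y'' b) hδ₀
        rwa [mul_add] at this
      have h2 : δ₀ * g.dist y'' b ≤ δ₀ * ρ := mul_le_mul_of_nonneg_left hd hδ₀
      have hexp : Real.exp (-(δ₀ * g.dist a y'')) ≤ Real.exp (δ₀ * ρ) * Real.exp (-(δ₀ * g.dist a b)) := by
        rw [← Real.exp_add]
        exact Real.exp_le_exp.mpr (by linarith)
      calc A * F a * Real.exp (-(δ₀ * g.dist a y'')) * KB y'' b
          ≤ A * F a * (Real.exp (δ₀ * ρ) * Real.exp (-(δ₀ * g.dist a b))) * KB y'' b :=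
            mul_le_mul_of_nonneg_right (mul_le_mul_of_nonneg_left hexp (mul_nonneg hA (hF a))) (hKB _ _)
        _ = _ := by ring
  calc ∑ y'' : g.Site, A * F a * Real.exp (-(δ₀ * g.dist a y'')) * KB y'' b
      ≤ ∑ y'' : g.Site, A * F a * Real.exp (δ₀ * ρ) * Real.exp (-(δ₀ * g.dist a b)) * KB y'' b :=
        Finset.sum_le_sum fun y'' _ => hterm y''
    _ = A * F a * Real.exp (δ₀ * ρ) * Real.exp (-(δ₀ * g.dist a b)) * ∑ y'' : g.Site, KB y'' b := by
        rw [Finset.mul_sum]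
    _ ≤ A * F a * Real.exp (δ₀ * ρ) * Real.exp (-(δ₀ * g.dist a b)) * ϑ b :=
        mul_le_mul_of_nonneg_left (hcol b) hcoef
    _ = A * Real.exp (δ₀ * ρ) * F a * ϑ b * Real.exp (-(δ₀ * g.dist a b)) := by ring

/-- One-lattice form of `hom_majorant_comp_localRight` in pv08's vocabulary: G₀ with majorant A·F(y)e^{−δ₀d} followed
on the RIGHT by a local V (majorant K_V ≥ 0, K_V(y″,y′) ≠ 0 ⇒ d(y″,y′) ≤ ρ, column sums ≤ ϑ(y′)) — G₀V has majorant
A·e^{δ₀ρ}·F(y)ϑ(y′)·e^{−δ₀d(y,y′)}.  (`local_mul_majorant` of v1 is the LEFT version VG₀ with row sums.) [folklore] -/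
theorem majorant_mul_localRight (blk : X → g.Site) (δ₀ ρ A : ℝ) (F ϑ : g.Site → ℝ) (KV : g.Site → g.Site → ℝ)
    (hA : 0 ≤ A) (hF : ∀ y, 0 ≤ F y) (hδ₀ : 0 ≤ δ₀) (htri : Triangle254 g)
    (hKV : ∀ a b, 0 ≤ KV a b) (hloc : ∀ y'' b, KV y'' b ≠ 0 → g.dist y'' b ≤ ρ)
    (hcol : ∀ b, ∑ y'' : g.Site, KV y'' b ≤ ϑ b)
    {G0 V : Module.End ℝ (X → ℝ)}
    (hG0 : HasMajorant blk G0 (fun a b => A * F a * Real.exp (-(δ₀ * g.dist a b))))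
    (hV : HasMajorant blk V KV) :
    HasMajorant blk (G0 * V) (fun a b => A * Real.exp (δ₀ * ρ) * F a * ϑ b * Real.exp (-(δ₀ * g.dist a b))) := by
  rw [Module.End.mul_eq_comp]
  exact hom_majorant_comp_localRight blk blk blk δ₀ ρ A F ϑ KV hA hF hδ₀ htri hKV hloc hcol hG0 hV

end LocalRight

/-! ## (l) The left-routed composite G′(U)V′(A) from a DIVERGENCE FORM of V′(A) -/

section B9SideDiv

open B9Thm34Ext

variable {g : B9.Geometry} [Fintype g.Site] {R : ℝ} {H : Prop} {X Y : Type}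

/-- **The hypothesis `hGV` of `b9_rightEntry_of_365` from a divergence form of V′(A).**  Print gives V′(A) (defined
by (3.60) p. 402) only through the GRADIENT-form bound (3.61), *"|(V′(A)λ)(x)| ≦ O(1)α₁((L^jη)^{−1}|∇_Uλ| +
(L^jη)^{−2}|λ|) for x ∈ B^j(Λ_j)"*, and the right-routed composite (3.63).  IF V′(A) is written in divergence form
V′ = D∘B″ + C″ (D = ∇*_U the abstract right entry of `h342D`; B″ : fields → tensor functions and C″ : fields → fields
LOCAL block operators whose two-space majorants K_B, K_C ≥ 0 vanish unless d(y″,y′) ≤ ρ and have column sums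
≤ β·Q(y′), ≤ γ·Q(y′)², Q = (L^jη)^{−1} — the (3.61)-type coefficient sizes β, γ = O(1)α₁n₀) — a rewriting NOT displayed
in the paper (cell GAPS G-pv21g2-2) — THEN entries 1 and 3 of (3.42) for G′(U) (`h342_1`: majorant B₀W(y)e^{−δ₀d},
W = (L^jη)²; `h342D`: majorant B₀W(y)Q(y)e^{−δ₀d} of G′(U)D), the relation W·Q² = 1 and the p. 398 convention
`htransfer` give the scale-weighted majorant B₀e^{δ₀ρ}(βC + γ)·W(y)W(y′)^{−1}·e^{−(1−α)δ₀d(y,y′)} of the LEFT-routed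
composite G′(U)V′(A) = (G′(U)D)B″ + G′(U)C″ — i.e. `hGV` at the rate (1−α)δ₀.  No statement about V′(A) itself is
asserted; the divergence form and its coefficient bounds are hypotheses.
[cite: Balaban1985BackgroundPropagators, (3.42) p.397, p.398 (remarks), (3.60)–(3.61) p.402] -/
theorem b9_leftComposite_of_divForm (blkX : X → g.Site) (blkY : Y → g.Site) (δ₀ α ρ B₀ C β γ : ℝ)
    (W Q : g.Site → ℝ) (KB KC : g.Site → g.Site → ℝ)
    (hB₀ : 0 ≤ B₀) (hβ : 0 ≤ β) (hγ : 0 ≤ γ) (hW : ∀ y, 0 < W y) (hQ : ∀ y, 0 ≤ Q y)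
    (hδ₀ : 0 ≤ δ₀) (hαδ : 0 ≤ α * δ₀) (htri : Triangle254 (toB6 g R H)) (hdnn : ∀ y y' : g.Site, 0 ≤ g.dist y y')
    (hWQ : ∀ y, W y * Q y ^ 2 = 1)
    (htransfer : ∀ a b : g.Site, Q a ≤ C * Q b * Real.exp (α * δ₀ * g.dist a b))
    (hKB : ∀ a b, 0 ≤ KB a b) (hlocB : ∀ y'' b, KB y'' b ≠ 0 → g.dist y'' b ≤ ρ)
    (hcolB : ∀ b, ∑ y'' : g.Site, KB y'' b ≤ β * Q b)
    (hKC : ∀ a b, 0 ≤ KC a b) (hlocC : ∀ y'' b, KC y'' b ≠ 0 → g.dist y'' b ≤ ρ)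
    (hcolC : ∀ b, ∑ y'' : g.Site, KC y'' b ≤ γ * Q b ^ 2)
    {GpU V' Cpp : Module.End ℝ (X → ℝ)} {D : (Y → ℝ) →ₗ[ℝ] (X → ℝ)} {Bpp : (X → ℝ) →ₗ[ℝ] (Y → ℝ)}
    (h342_1 : HasMajorant (g := toB6 g R H) blkX GpU (fun a b => B₀ * W a * Real.exp (-(δ₀ * g.dist a b))))
    (h342D : HasMajorantHom (g := toB6 g R H) blkY blkX (GpU ∘ₗ D)
      (fun a b => B₀ * W a * Q a * Real.exp (-(δ₀ * g.dist a b))))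
    (hB : HasMajorantHom (g := toB6 g R H) blkX blkY Bpp KB)
    (hCpp : HasMajorant (g := toB6 g R H) blkX Cpp KC)
    (hVdiv : V' = D ∘ₗ Bpp + Cpp) :
    HasMajorant (g := toB6 g R H) blkX (GpU * V')
      (fun a b => B₀ * Real.exp (δ₀ * ρ) * (β * C + γ) * W a * (W b)⁻¹ *
        Real.exp (-((1 - α) * δ₀ * g.dist a b))) := by
  have hsplit : GpU * V' = (GpU ∘ₗ D) ∘ₗ Bpp + GpU * Cpp := by
    rw [hVdiv, mul_add]
    simp only [Module.End.mul_eq_comp, LinearMap.comp_assoc]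
  have hWQnn : ∀ y, 0 ≤ W y * Q y := fun y => mul_nonneg (hW y).le (hQ y)
  have h342D' : HasMajorantHom (g := toB6 g R H) blkY blkX (GpU ∘ₗ D)
      (fun a b => B₀ * (W a * Q a) * Real.exp (-(δ₀ * (toB6 g R H).dist a b))) :=
    hasMajorantHom_mono (g := toB6 g R H) blkY blkX h342D fun a b => le_of_eq (by simp only [toB6_dist]; ring)
  have h1 : HasMajorant (g := toB6 g R H) blkX ((GpU ∘ₗ D) ∘ₗ Bpp)
      (fun a b => B₀ * Real.exp (δ₀ * ρ) * (W a * Q a) * (β * Q b) *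
        Real.exp (-(δ₀ * (toB6 g R H).dist a b))) :=
    hom_majorant_comp_localRight (g := toB6 g R H) blkX blkY blkX δ₀ ρ B₀ (fun a => W a * Q a) (fun b => β * Q b)
      KB hB₀ hWQnn hδ₀ htri hKB hlocB hcolB h342D' hB
  have h342_1' : HasMajorant (g := toB6 g R H) blkX GpU
      (fun a b => B₀ * W a * Real.exp (-(δ₀ * (toB6 g R H).dist a b))) := by
    simpa only [toB6_dist] using h342_1
  have h2 : HasMajorant (g := toB6 g R H) blkX (GpU * Cpp)
      (fun a b => B₀ * Real.exp (δ₀ * ρ) * W a * (γ * Q b ^ 2) * Real.exp (-(δ₀ * (toB6 g R H).dist a b))) :=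
    majorant_mul_localRight (g := toB6 g R H) blkX δ₀ ρ B₀ W (fun b => γ * Q b ^ 2) KC hB₀ (fun y => (hW y).le)
      hδ₀ htri hKC hlocC hcolC h342_1' hCpp
  rw [hsplit]
  refine hasMajorant_mono (g := toB6 g R H) blkX (hasMajorant_add (g := toB6 g R H) blkX h1 h2) fun a b => ?_
  show B₀ * Real.exp (δ₀ * ρ) * (W a * Q a) * (β * Q b) * Real.exp (-(δ₀ * (toB6 g R H).dist a b)) +
      B₀ * Real.exp (δ₀ * ρ) * W a * (γ * Q b ^ 2) * Real.exp (-(δ₀ * (toB6 g R H).dist a b)) ≤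
    B₀ * Real.exp (δ₀ * ρ) * (β * C + γ) * W a * (W b)⁻¹ * Real.exp (-((1 - α) * δ₀ * (toB6 g R H).dist a b))
  simp only [toB6_dist]
  have hWinv : (W b)⁻¹ = Q b ^ 2 := by
    have hWb : W b ≠ 0 := (hW b).ne'
    field_simp
    linarith [hWQ b]
  rw [hWinv]
  have hE : 0 ≤ Real.exp (-(δ₀ * g.dist a b)) := Real.exp_nonneg _
  have hexp1 : (1 : ℝ) ≤ Real.exp (α * δ₀ * g.dist a b) :=
    Real.one_le_exp (mul_nonneg hαδ (hdnn a b))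
  have hexpeq : Real.exp (α * δ₀ * g.dist a b) * Real.exp (-(δ₀ * g.dist a b)) =
      Real.exp (-((1 - α) * δ₀ * g.dist a b)) := by
    rw [← Real.exp_add]; congr 1; ring
  have hQQ : Q a * Q b ≤ C * Q b ^ 2 * Real.exp (α * δ₀ * g.dist a b) := by
    calc Q a * Q b ≤ C * Q b * Real.exp (α * δ₀ * g.dist a b) * Q b :=
          mul_le_mul_of_nonneg_right (htransfer a b) (hQ b)
      _ = C * Q b ^ 2 * Real.exp (α * δ₀ * g.dist a b) := by ring
  have hQ2 : Q b ^ 2 ≤ Q b ^ 2 * Real.exp (α * δ₀ * g.dist a b) := by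
    simpa using mul_le_mul_of_nonneg_left hexp1 (sq_nonneg (Q b))
  have hpre : 0 ≤ B₀ * Real.exp (δ₀ * ρ) * W a := mul_nonneg (mul_nonneg hB₀ (Real.exp_nonneg _)) (hW a).le
  calc B₀ * Real.exp (δ₀ * ρ) * (W a * Q a) * (β * Q b) * Real.exp (-(δ₀ * g.dist a b)) +
        B₀ * Real.exp (δ₀ * ρ) * W a * (γ * Q b ^ 2) * Real.exp (-(δ₀ * g.dist a b))
      = B₀ * Real.exp (δ₀ * ρ) * W a * (β * (Q a * Q b) + γ * Q b ^ 2) * Real.exp (-(δ₀ * g.dist a b)) := by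
        ring
    _ ≤ B₀ * Real.exp (δ₀ * ρ) * W a * (β * (C * Q b ^ 2 * Real.exp (α * δ₀ * g.dist a b)) +
          γ * (Q b ^ 2 * Real.exp (α * δ₀ * g.dist a b))) * Real.exp (-(δ₀ * g.dist a b)) := by
        refine mul_le_mul_of_nonneg_right (mul_le_mul_of_nonneg_left ?_ hpre) hE
        exact add_le_add (mul_le_mul_of_nonneg_left hQQ hβ) (mul_le_mul_of_nonneg_left hQ2 hγ)
    _ = B₀ * Real.exp (δ₀ * ρ) * (β * C + γ) * W a * Q b ^ 2 *
          (Real.exp (α * δ₀ * g.dist a b) * Real.exp (-(δ₀ * g.dist a b))) := by ring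
    _ = B₀ * Real.exp (δ₀ * ρ) * (β * C + γ) * W a * Q b ^ 2 *
          Real.exp (-((1 - α) * δ₀ * g.dist a b)) := by rw [hexpeq]

/-- **Entry 3 of (3.42) for G′(U′U), all-left route, from printed-TYPE inputs only**: Theorem 3.1 entries 1, 3 for
G′(U) + a divergence form V′ = D∘B″ + C″ with (3.61)-type local coefficient bounds (hypotheses; the form itself is the
undisplayed step G-pv21g2-2) + (3.65)₁ + the p. 398 convention (twice, exponents αδ₀ and α′(1−α)δ₀) + Lemma 2.1 of [4]
at ((1−α)δ₀, α′) + the smallness θc₁ < 1 with θ = B₀e^{δ₀ρ}(βC + γ) (p. 402: *"for α₁ sufficiently small the norm of this operator is small"*):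
|(G′(U′U)∇*_Uλ)(x)| ≦ B₀C′c₁(1 − θc₁)^{−1}(L^jη)²(L^{j′}η)^{−1}e^{−(1−2α′)(1−α)δ₀d(y,y′)}|λ|.
[cite: Balaban1985BackgroundPropagators, (3.42) p.397, p.398 (remarks), (3.60)–(3.65) pp.402–403; Balaban1984PropagatorsII, Lemma 2.1 p.234] -/
theorem b9_rightEntry_of_365_divForm [Fintype X] [DecidableEq X] [Fintype Y] [DecidableEq Y]
    (blkX : X → g.Site) (blkY : Y → g.Site) (d : ℕ) (δ₀ α α' ρ B₀ C C' β γ : ℝ)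
    (W Q : g.Site → ℝ) (KB KC : g.Site → g.Site → ℝ)
    (hB₀ : 0 ≤ B₀) (hC : 0 ≤ C) (hC' : 0 ≤ C') (hβ : 0 ≤ β) (hγ : 0 ≤ γ) (hW : ∀ y, 0 < W y)
    (hQ : ∀ y, 0 ≤ Q y) (hδ₀ : 0 ≤ δ₀) (hαδ : 0 ≤ α * δ₀) (hα'δ : 0 ≤ α' * ((1 - α) * δ₀))
    (hα'δ2 : 0 ≤ (1 - 2 * α') * ((1 - α) * δ₀)) (htri : Triangle254 (toB6 g R H))
    (hrefl : ∀ y : g.Site, g.dist y y = 0) (hsym : ∀ y y' : g.Site, g.dist y y' = g.dist y' y)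
    (hdnn : ∀ y y' : g.Site, 0 ≤ g.dist y y')
    (h261 : Ineq261 d (toB6 g R H) ((1 - α) * δ₀) α') (h263 : Ineq263 d (toB6 g R H) ((1 - α) * δ₀) α')
    (hsmall : B₀ * Real.exp (δ₀ * ρ) * (β * C + γ) * B6.c1 d ((1 - α) * δ₀) α' < 1)
    (hWQ : ∀ y, W y * Q y ^ 2 = 1)
    (htransfer : ∀ a b : g.Site, Q a ≤ C * Q b * Real.exp (α * δ₀ * g.dist a b))
    (htransfer' : ∀ a b : g.Site, Q a ≤ C' * Q b * Real.exp (α' * ((1 - α) * δ₀) * g.dist a b))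
    (hKB : ∀ a b, 0 ≤ KB a b) (hlocB : ∀ y'' b, KB y'' b ≠ 0 → g.dist y'' b ≤ ρ)
    (hcolB : ∀ b, ∑ y'' : g.Site, KB y'' b ≤ β * Q b)
    (hKC : ∀ a b, 0 ≤ KC a b) (hlocC : ∀ y'' b, KC y'' b ≠ 0 → g.dist y'' b ≤ ρ)
    (hcolC : ∀ b, ∑ y'' : g.Site, KC y'' b ≤ γ * Q b ^ 2)
    {GpU GpExt V' Cpp : Module.End ℝ (X → ℝ)} {D : (Y → ℝ) →ₗ[ℝ] (X → ℝ)} {Bpp : (X → ℝ) →ₗ[ℝ] (Y → ℝ)}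
    (h342_1 : HasMajorant (g := toB6 g R H) blkX GpU (fun a b => B₀ * W a * Real.exp (-(δ₀ * g.dist a b))))
    (h342D : HasMajorantHom (g := toB6 g R H) blkY blkX (GpU ∘ₗ D)
      (fun a b => B₀ * W a * Q a * Real.exp (-(δ₀ * g.dist a b))))
    (hB : HasMajorantHom (g := toB6 g R H) blkX blkY Bpp KB)
    (hCpp : HasMajorant (g := toB6 g R H) blkX Cpp KC)
    (hVdiv : V' = D ∘ₗ Bpp + Cpp) (h365 : GpExt = GpU + GpU * V' * GpExt) :
    HasMajorantHom (g := toB6 g R H) blkY blkX (GpExt ∘ₗ D)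
      (fun a b => B₀ * C' * B6.c1 d ((1 - α) * δ₀) α' *
        (1 - B₀ * Real.exp (δ₀ * ρ) * (β * C + γ) * B6.c1 d ((1 - α) * δ₀) α')⁻¹ * W a * Q b *
        Real.exp (-((1 - 2 * α') * ((1 - α) * δ₀) * g.dist a b))) := by
  have hGV := b9_leftComposite_of_divForm (R := R) (H := H) blkX blkY δ₀ α ρ B₀ C β γ W Q KB KC hB₀ hβ hγ hW hQ
    hδ₀ hαδ htri hdnn hWQ htransfer hKB hlocB hcolB hKC hlocC hcolC h342_1 h342D hB hCpp hVdiv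
  have hθ : 0 ≤ B₀ * Real.exp (δ₀ * ρ) * (β * C + γ) :=
    mul_nonneg (mul_nonneg hB₀ (Real.exp_nonneg _)) (add_nonneg (mul_nonneg hβ hC) hγ)
  have h342D' : HasMajorantHom (g := toB6 g R H) blkY blkX (GpU ∘ₗ D)
      (fun a b => B₀ * W a * Q a * Real.exp (-((1 - α) * δ₀ * g.dist a b))) := by
    refine hasMajorantHom_mono (g := toB6 g R H) blkY blkX h342D fun a b => ?_
    show B₀ * W a * Q a * Real.exp (-(δ₀ * (toB6 g R H).dist a b)) ≤
      B₀ * W a * Q a * Real.exp (-((1 - α) * δ₀ * (toB6 g R H).dist a b))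
    simp only [toB6_dist]
    refine mul_le_mul_of_nonneg_left (Real.exp_le_exp.mpr ?_)
      (mul_nonneg (mul_nonneg hB₀ (hW a).le) (hQ a))
    nlinarith [mul_nonneg hαδ (hdnn a b)]
  exact b9_rightEntry_of_365 (R := R) (H := H) blkX blkY d ((1 - α) * δ₀) α'
    (B₀ * Real.exp (δ₀ * ρ) * (β * C + γ)) B₀ C' W Q hB₀ hC' hW hQ hθ hα'δ hα'δ2 htri hrefl hsym hdnn h261 h263
    hsmall htransfer' h342D' hGV h365

end B9SideDiv

/-! ## (m) A local operator on the LEFT of a decaying one (two-space, weighted row sums) -/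

section LocalLeft

variable {g : B6.Geometry} {X Y Z : Type}

/-- **A LOCAL operator on the LEFT of a decaying one (two-space form of v1's `local_mul_majorant`).**  If S maps
functions on X to functions on Y with majorant A·F(y″)·e^{−δ₀d(y″,y′)} (F ≥ 0 a block weight, e.g. L^jη or (L^jη)²)
and B maps functions on Y to functions on Z with a majorant K_B(y,y″) ≥ 0 which is LOCAL — K_B(y,y″) ≠ 0 only if
d(y,y″) ≤ ρ — with WEIGHTED ROW SUMS Σ_{y″}K_B(y,y″)F(y″) ≤ ϑ(y), then BS has majorant A·e^{δ₀ρ}·ϑ(y)·e^{−δ₀d(y,y′)}: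
the partition over the middle lattice ([4] (2.52)–(2.55)) and the triangle inequality (2.54) on the ρ-neighbourhood of
y.  This is the shape of each term of [4] (2.40) / B9 (3.88): a coefficient built from derivatives of h_□ (local, small)
times a propagator entry of (2.43) / (3.42).
[cite: Balaban1984PropagatorsII, (2.40), (2.43), (2.44) p.230 + (2.52)–(2.55) pp.232–233; Balaban1985BackgroundPropagators, (3.88)–(3.89) p.409] -/
theorem hom_majorant_localLeft_comp (blkX : X → g.Site) (blkY : Y → g.Site) (blkZ : Z → g.Site)
    (δ₀ ρ A : ℝ) (F ϑ : g.Site → ℝ) (KB : g.Site → g.Site → ℝ)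
    (hA : 0 ≤ A) (hF : ∀ y, 0 ≤ F y) (hδ₀ : 0 ≤ δ₀) (htri : Triangle254 g)
    (hKB : ∀ a b, 0 ≤ KB a b) (hloc : ∀ a y'', KB a y'' ≠ 0 → g.dist a y'' ≤ ρ)
    (hrow : ∀ a, ∑ y'' : g.Site, KB a y'' * F y'' ≤ ϑ a)
    {B : (Y → ℝ) →ₗ[ℝ] (Z → ℝ)} {S : (X → ℝ) →ₗ[ℝ] (Y → ℝ)}
    (hB : HasMajorantHom blkY blkZ B KB)
    (hS : HasMajorantHom blkX blkY S (fun a b => A * F a * Real.exp (-(δ₀ * g.dist a b)))) :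
    HasMajorantHom blkX blkZ (B ∘ₗ S)
      (fun a b => A * Real.exp (δ₀ * ρ) * ϑ a * Real.exp (-(δ₀ * g.dist a b))) := by
  have hK₂ : ∀ a b, 0 ≤ A * F a * Real.exp (-(δ₀ * g.dist a b)) := fun a b =>
    mul_nonneg (mul_nonneg hA (hF a)) (Real.exp_nonneg _)
  refine hasMajorantHom_mono blkX blkZ (hasMajorantHom_comp blkX blkY blkZ hB hS hK₂) fun a b => ?_
  have hcoef : 0 ≤ A * Real.exp (δ₀ * ρ) * Real.exp (-(δ₀ * g.dist a b)) :=
    mul_nonneg (mul_nonneg hA (Real.exp_nonneg _)) (Real.exp_nonneg _)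
  have hterm : ∀ y'' : g.Site, KB a y'' * (A * F y'' * Real.exp (-(δ₀ * g.dist y'' b))) ≤
      KB a y'' * F y'' * (A * Real.exp (δ₀ * ρ) * Real.exp (-(δ₀ * g.dist a b))) := by
    intro y''
    by_cases hz : KB a y'' = 0
    · simp [hz]
    · have hd : g.dist a y'' ≤ ρ := hloc a y'' hz
      have h1 : δ₀ * g.dist a b ≤ δ₀ * g.dist a y'' + δ₀ * g.dist y'' b := by
        have := mul_le_mul_of_nonneg_left (htri a y'' b) hδ₀
        rwa [mul_add] at this
      have h2 : δ₀ * g.dist a y'' ≤ δ₀ * ρ := mul_le_mul_of_nonneg_left hd hδ₀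
      have hexp : Real.exp (-(δ₀ * g.dist y'' b)) ≤ Real.exp (δ₀ * ρ) * Real.exp (-(δ₀ * g.dist a b)) := by
        rw [← Real.exp_add]
        exact Real.exp_le_exp.mpr (by linarith)
      calc KB a y'' * (A * F y'' * Real.exp (-(δ₀ * g.dist y'' b)))
          ≤ KB a y'' * (A * F y'' * (Real.exp (δ₀ * ρ) * Real.exp (-(δ₀ * g.dist a b)))) :=
            mul_le_mul_of_nonneg_left (mul_le_mul_of_nonneg_left hexp (mul_nonneg hA (hF y''))) (hKB _ _)
        _ = _ := by ring
  calc ∑ y'' : g.Site, KB a y'' * (A * F y'' * Real.exp (-(δ₀ * g.dist y'' b)))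
      ≤ ∑ y'' : g.Site, KB a y'' * F y'' * (A * Real.exp (δ₀ * ρ) * Real.exp (-(δ₀ * g.dist a b))) :=
        Finset.sum_le_sum fun y'' _ => hterm y''
    _ = (∑ y'' : g.Site, KB a y'' * F y'') * (A * Real.exp (δ₀ * ρ) * Real.exp (-(δ₀ * g.dist a b))) := by
        rw [Finset.sum_mul]
    _ ≤ ϑ a * (A * Real.exp (δ₀ * ρ) * Real.exp (-(δ₀ * g.dist a b))) :=
        mul_le_mul_of_nonneg_right (hrow a) hcoef
    _ = A * Real.exp (δ₀ * ρ) * ϑ a * Real.exp (-(δ₀ * g.dist a b)) := by ring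

/-- **Multiplication by h with |h| ≤ 1 on the right costs nothing**: an operator M preserving block supports
and bounds (supp λ ⊂ Δ(y′), |λ| ≤ B ⇒ the same for Mλ — the property of λ ↦ h_□λ with |h_□| ≤ 1) composed on the
right of T leaves T's two-space majorant unchanged. [folklore] -/
theorem hasMajorantHom_comp_suppPreserving (blkX : X → g.Site) (blkY : Y → g.Site)
    {T : (X → ℝ) →ₗ[ℝ] (Y → ℝ)} {M : Module.End ℝ (X → ℝ)} {K : g.Site → g.Site → ℝ}
    (hT : HasMajorantHom blkX blkY T K)
    (hM : ∀ (y' : g.Site) (μ : X → ℝ) (B : ℝ), BlockSupp blkX μ y' B → BlockSupp blkX (M μ) y' B) :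
    HasMajorantHom blkX blkY (T ∘ₗ M) K := by
  intro y' μ B hμ v
  rw [LinearMap.comp_apply]
  exact hT y' (M μ) B (hM y' μ B hμ) v

/-- A multiplication operator by a function h with |h| ≤ 1 ((Mλ)(x) = h(x)λ(x), typed through its action)
preserves block supports and bounds. [folklore] -/
theorem blockSupp_map_of_mul (blk : X → g.Site) (h : X → ℝ) (hh : ∀ x, |h x| ≤ 1) (M : Module.End ℝ (X → ℝ))
    (hM : ∀ μ x, M μ x = h x * μ x) (y' : g.Site) (μ : X → ℝ) (B : ℝ) (hμ : BlockSupp blk μ y' B) :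
    BlockSupp blk (M μ) y' B where
  nonneg := hμ.nonneg
  bound := fun x hx => by
    rw [hM, abs_mul]
    calc |h x| * |μ x| ≤ 1 * B := mul_le_mul (hh x) (hμ.bound x hx) (abs_nonneg _) zero_le_one
      _ = B := one_mul B
  off := fun x hx => by rw [hM, hμ.off x hx, mul_zero]

end LocalLeft

/-! ## (n) (3.89): the random-walk small factor K(h_□)G′_□h_□ from (3.42)₁,₂ -/

section B9K389

open B9Thm34Ext

variable {g : B9.Geometry} [Fintype g.Site] {R : ℝ} {H : Prop} {X Y : Type}

/-- **(3.89) p. 409 from (3.42)₁,₂ — the derivation the paper states in one clause.**  B9 p. 409 [render p021]: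
*"(Δ′_ahλ)(x) = h(x)(Δ′_aλ)(x) − Σ_{b∈st(x)}(∂h)(b)(Dλ)(b) + (Δh)(x)λ(x) + a_j(L^jη)^{−2}Σ_{x′∈B^j(y)}L^{−jd}(∂h)
(Γ^{(j)}_{x,y} ∪ Γ^{(j)}_{y,x′})R((U(Γ^{(j)}_{y,x}))^{−1}R(U(Γ^{(j)}_{y,x′}))λ(x′) = h(x)(Δ′_aλ)(x) − (K(h)λ)(x), (3.88)
hence Δ′_aG′₀ = I − Σ_□K(h_□)G′_□h_□ = I − R′.  Using the inequalities (3.42) for G′_□, we get the bound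
|(K(h_□)G′_□h_□λ)(x)| ≦ O(M^{−1})e^{−δ₀(L^jη)^{−1}|y−y′|}|λ| (3.89) for x∈Δ(y), supp λ ⊂ Δ(y′), y, y′∈□∈𝒟_j.  It is
exactly the bound (2.44) of [4], rescaled to η-scale."* ([4] p. 230 [render p008]: *"This inequality and (2.40) imply
|(K(h_□)G′(□)h_□λ)(x)| ≦ O(M^{−1})e^{−δ₀|x−y|}|λ| (2.44)"*, (2.43) being the pair of bounds for G′(□) and ∂G′(□).)
TYPED: K(h) = P∘D + C with D the derivative of p. 392 (*"for derivative D acting on functions defined at points of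
the lattice"*; abstract linear map site functions → bond functions), P : bond functions → site functions the LOCAL
coefficient operator of the first term of (3.88) (majorant K_P ≥ 0 vanishing unless d(y,y″) ≤ ρ, weighted row sums
Σ_{y″}K_P(y,y″)L^{j″}η ≤ p(y) — for |∂h_□| ≤ O(1)(ML^jη)^{−1} this is p = O(1)M^{−1} on the blocks meeting supp ∂h_□,
0 elsewhere) and C : site functions → site functions the LOCAL derivative-free part (the (Δh)-term AND the
a_j(L^jη)^{−2}-averaging term of (3.88); weighted row sums Σ_{y″}K_C(y,y″)(L^{j″}η)² ≤ q(y), q = O(1)(M^{−2} + M^{−1}));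
entries 1, 2 of (3.42) for G′_□ (`h342_1`: majorant B₀(L^jη)²e^{−δ₀d}; `h342_2`: majorant B₀L^jηe^{−δ₀d} of D∘G′_□,
the weight at the OUTPUT block); h_□ as an operator preserving block supports and bounds (|h_□| ≤ 1,
`blockSupp_map_of_mul`).  CONCLUSION: K(h_□)G′_□h_□ has majorant B₀e^{δ₀ρ}(p(y) + q(y))e^{−δ₀d(y,y′)} — (3.89)
with O(M^{−1}) = B₀e^{δ₀ρ}(p + q) and the multiscale d of (3.42) in the exponent (print has the scaled euclidean
distance inside one cube; cell DIVERGENCE D-b09.13).  The coefficient bounds on ∂h_□, Δh_□ (the functions h of [4]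
p. 229, *"described in (1.118), and rescale them to proper scales"*) are NOT asserted: they are the hypotheses
`hrowP`, `hrowC`. [cite: Balaban1985BackgroundPropagators, (3.42) p.397, (3.87)–(3.89) pp.408–409; Balaban1984PropagatorsII, (2.36)–(2.40) pp.229–230, (2.43)–(2.44) p.230] -/
theorem b9_389_of_342 (blkX : X → g.Site) (blkY : Y → g.Site) (δ₀ ρ B₀ : ℝ) (p q : g.Site → ℝ)
    (KP KC : g.Site → g.Site → ℝ)
    (hB₀ : 0 ≤ B₀) (hδ₀ : 0 ≤ δ₀) (htri : Triangle254 (toB6 g R H)) (hlen : ∀ y : g.Site, 0 ≤ g.len y)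
    (hKP : ∀ a b, 0 ≤ KP a b) (hlocP : ∀ a y'', KP a y'' ≠ 0 → g.dist a y'' ≤ ρ)
    (hrowP : ∀ a, ∑ y'' : g.Site, KP a y'' * g.len y'' ≤ p a)
    (hKC : ∀ a b, 0 ≤ KC a b) (hlocC : ∀ a y'', KC a y'' ≠ 0 → g.dist a y'' ≤ ρ)
    (hrowC : ∀ a, ∑ y'' : g.Site, KC a y'' * g.len y'' ^ 2 ≤ q a)
    {Gsq Kop Cop Mh : Module.End ℝ (X → ℝ)} {D : (X → ℝ) →ₗ[ℝ] (Y → ℝ)} {P : (Y → ℝ) →ₗ[ℝ] (X → ℝ)}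
    (h342_1 : HasMajorant (g := toB6 g R H) blkX Gsq
      (fun a b => B₀ * g.len a ^ 2 * Real.exp (-(δ₀ * g.dist a b))))
    (h342_2 : HasMajorantHom (g := toB6 g R H) blkX blkY (D ∘ₗ Gsq)
      (fun a b => B₀ * g.len a * Real.exp (-(δ₀ * g.dist a b))))
    (hP : HasMajorantHom (g := toB6 g R H) blkY blkX P KP)
    (hC : HasMajorant (g := toB6 g R H) blkX Cop KC)
    (hMh : ∀ (y' : g.Site) (μ : X → ℝ) (B : ℝ), BlockSupp (g := toB6 g R H) blkX μ y' B →
      BlockSupp (g := toB6 g R H) blkX (Mh μ) y' B)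
    (hK : Kop = P ∘ₗ D + Cop) :
    HasMajorant (g := toB6 g R H) blkX (Kop * Gsq * Mh)
      (fun a b => B₀ * Real.exp (δ₀ * ρ) * (p a + q a) * Real.exp (-(δ₀ * g.dist a b))) := by
  have hsplit : Kop * Gsq * Mh = P ∘ₗ ((D ∘ₗ Gsq) ∘ₗ Mh) + Cop ∘ₗ (Gsq ∘ₗ Mh) := by
    rw [hK]
    simp only [Module.End.mul_eq_comp, LinearMap.add_comp, LinearMap.comp_assoc]
  -- the bond term: P ∘ (DG′_□ ∘ h_□)
  have h2' : HasMajorantHom (g := toB6 g R H) blkX blkY ((D ∘ₗ Gsq) ∘ₗ Mh)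
      (fun a b => B₀ * g.len a * Real.exp (-(δ₀ * (toB6 g R H).dist a b))) :=
    hasMajorantHom_comp_suppPreserving (g := toB6 g R H) blkX blkY (by simpa only [toB6_dist] using h342_2) hMh
  have hPterm : HasMajorant (g := toB6 g R H) blkX (P ∘ₗ ((D ∘ₗ Gsq) ∘ₗ Mh))
      (fun a b => B₀ * Real.exp (δ₀ * ρ) * p a * Real.exp (-(δ₀ * (toB6 g R H).dist a b))) :=
    hom_majorant_localLeft_comp (g := toB6 g R H) blkX blkY blkX δ₀ ρ B₀ (fun y => g.len y) p KP hB₀ hlen hδ₀ htri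
      hKP hlocP hrowP hP h2'
  -- the site terms: C ∘ (G′_□ ∘ h_□)
  have h1' : HasMajorantHom (g := toB6 g R H) blkX blkX (Gsq ∘ₗ Mh)
      (fun a b => B₀ * g.len a ^ 2 * Real.exp (-(δ₀ * (toB6 g R H).dist a b))) :=
    by
    have h1d : HasMajorant (g := toB6 g R H) blkX Gsq
        (fun a b => B₀ * g.len a ^ 2 * Real.exp (-(δ₀ * (toB6 g R H).dist a b))) := by
      simpa only [toB6_dist] using h342_1
    exact hasMajorantHom_comp_suppPreserving (g := toB6 g R H) blkX blkX
      ((hasMajorantHom_iff (g := toB6 g R H) blkX Gsq _).mpr h1d) hMh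
  have hCterm : HasMajorant (g := toB6 g R H) blkX (Cop ∘ₗ (Gsq ∘ₗ Mh))
      (fun a b => B₀ * Real.exp (δ₀ * ρ) * q a * Real.exp (-(δ₀ * (toB6 g R H).dist a b))) :=
    hom_majorant_localLeft_comp (g := toB6 g R H) blkX blkX blkX δ₀ ρ B₀ (fun y => g.len y ^ 2) q KC hB₀
      (fun y => sq_nonneg _) hδ₀ htri hKC hlocC hrowC hC h1'
  rw [hsplit]
  refine hasMajorant_mono (g := toB6 g R H) blkX (hasMajorant_add (g := toB6 g R H) blkX hPterm hCterm)
    fun a b => le_of_eq ?_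
  show B₀ * Real.exp (δ₀ * ρ) * p a * Real.exp (-(δ₀ * (toB6 g R H).dist a b)) +
      B₀ * Real.exp (δ₀ * ρ) * q a * Real.exp (-(δ₀ * (toB6 g R H).dist a b)) =
    B₀ * Real.exp (δ₀ * ρ) * (p a + q a) * Real.exp (-(δ₀ * (toB6 g R H).dist a b))
  ring

/-- **(3.89) in the LOCALIZED form consumed by Theorem 3.7** (the majorant carries the indicator of the set S′ of
blocks meeting supp K(h_□)(·) — the shape of the hypothesis `h389` of the tree's `B9Thm37Sum.thm37_entry1`): if the
weighted row sums of the two coefficient operators vanish off S′ and are ≤ κ₁, κ₂ on it, then K(h_□)G′_□h_□ has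
majorant 1_{S′}(y)·B₀e^{δ₀ρ}(κ₁ + κ₂)·e^{−δ₀d(y,y′)}, i.e. θ = B₀e^{δ₀ρ}(κ₁ + κ₂) is the printed O(M^{−1}) made
explicit in terms of the partition-of-unity constants. [cite: Balaban1985BackgroundPropagators, (3.89) p.409, Thm 3.7 (3.90) p.409] -/
theorem b9_389_localized [DecidableEq g.Site] (blkX : X → g.Site) (blkY : Y → g.Site) (δ₀ ρ B₀ κ₁ κ₂ : ℝ) (S' : Finset g.Site)
    (KP KC : g.Site → g.Site → ℝ)
    (hB₀ : 0 ≤ B₀) (hδ₀ : 0 ≤ δ₀) (htri : Triangle254 (toB6 g R H)) (hlen : ∀ y : g.Site, 0 ≤ g.len y)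
    (hKP : ∀ a b, 0 ≤ KP a b) (hlocP : ∀ a y'', KP a y'' ≠ 0 → g.dist a y'' ≤ ρ)
    (hrowP : ∀ a : g.Site, ∑ y'' : g.Site, KP a y'' * g.len y'' ≤ if a ∈ S' then κ₁ else 0)
    (hKC : ∀ a b, 0 ≤ KC a b) (hlocC : ∀ a y'', KC a y'' ≠ 0 → g.dist a y'' ≤ ρ)
    (hrowC : ∀ a : g.Site, ∑ y'' : g.Site, KC a y'' * g.len y'' ^ 2 ≤ if a ∈ S' then κ₂ else 0)
    {Gsq Kop Cop Mh : Module.End ℝ (X → ℝ)} {D : (X → ℝ) →ₗ[ℝ] (Y → ℝ)} {P : (Y → ℝ) →ₗ[ℝ] (X → ℝ)}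
    (h342_1 : HasMajorant (g := toB6 g R H) blkX Gsq
      (fun a b => B₀ * g.len a ^ 2 * Real.exp (-(δ₀ * g.dist a b))))
    (h342_2 : HasMajorantHom (g := toB6 g R H) blkX blkY (D ∘ₗ Gsq)
      (fun a b => B₀ * g.len a * Real.exp (-(δ₀ * g.dist a b))))
    (hP : HasMajorantHom (g := toB6 g R H) blkY blkX P KP)
    (hC : HasMajorant (g := toB6 g R H) blkX Cop KC)
    (hMh : ∀ (y' : g.Site) (μ : X → ℝ) (B : ℝ), BlockSupp (g := toB6 g R H) blkX μ y' B →
      BlockSupp (g := toB6 g R H) blkX (Mh μ) y' B)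
    (hK : Kop = P ∘ₗ D + Cop) :
    HasMajorant (g := toB6 g R H) blkX (Kop * Gsq * Mh)
      (fun (a b : g.Site) => if a ∈ S' then B₀ * Real.exp (δ₀ * ρ) * (κ₁ + κ₂) * Real.exp (-(δ₀ * g.dist a b))
        else 0) := by
  have h := b9_389_of_342 (R := R) (H := H) blkX blkY δ₀ ρ B₀ (fun a : g.Site => if a ∈ S' then κ₁ else 0)
    (fun a : g.Site => if a ∈ S' then κ₂ else 0) KP KC hB₀ hδ₀ htri hlen hKP hlocP hrowP hKC hlocC hrowC h342_1 h342_2 hP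
    hC hMh hK
  refine hasMajorant_mono (g := toB6 g R H) blkX h fun a b => le_of_eq ?_
  show B₀ * Real.exp (δ₀ * ρ) * ((if a ∈ S' then κ₁ else 0) + (if a ∈ S' then κ₂ else 0)) *
      Real.exp (-(δ₀ * (toB6 g R H).dist a b)) =
    (if a ∈ S' then B₀ * Real.exp (δ₀ * ρ) * (κ₁ + κ₂) * Real.exp (-(δ₀ * (toB6 g R H).dist a b)) else 0)
  split_ifs <;> ring

end B9K389

/-! ## (o) (3.63) from the block-restricted gradient-form bound (3.61) and (3.42)₁,₂ -/

section B9Side363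

open B9Thm34Ext

variable {g : B9.Geometry} [Fintype g.Site] {R : ℝ} {H : Prop} {X Y : Type}

/-- **A BLOCK-NORM-BOUNDED local operator after a decaying one.**  If V′ is bounded by block-restricted norms —
|(V′μ)(x)| ≦ κ₁(y)B₁ + κ₂(y)B₂ whenever |Dμ| ≦ B₁ on the bonds of the block y ∋ x and |μ| ≦ B₂ on the sites of that
block (the SHAPE of B9 (3.61) p. 402: *"|(V′(A)λ)(x)| ≦ O(1)α₁((L^jη)^{−1}|∇_Uλ| + (L^jη)^{−2}|λ|) (3.61) for x∈B^j(Λ_j),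
the norms on the right-hand side restricted to the block B^j(y) containing the point x."*, read on the block map of
(3.42), D abstract) — and G′ has the (3.42)₁-type majorant B₀W(y)e^{−δ₀d(y,y′)} while D∘G′ has the (3.42)₂-type
two-space majorant B₀L(y)e^{−δ₀d(y,y′)}, then V′G′ has majorant (κ₁(y)L(y) + κ₂(y)W(y))B₀e^{−δ₀d(y,y′)}: no
neighbourhood spill, the norms living on the block of x itself. [cite: Balaban1985BackgroundPropagators, (3.61)–(3.63) p.402] -/
theorem majorant_mul_of_blockNormBound (blkX : X → g.Site) (blkY : Y → g.Site) (δ₀ B₀ : ℝ)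
    (κ₁ κ₂ W Lw : g.Site → ℝ) {Gp V' : Module.End ℝ (X → ℝ)} {D : (X → ℝ) →ₗ[ℝ] (Y → ℝ)}
    (h361 : ∀ (μ : X → ℝ) (x : X) (B₁ B₂ : ℝ), (∀ b : Y, blkY b = blkX x → |D μ b| ≤ B₁) →
      (∀ x' : X, blkX x' = blkX x → |μ x'| ≤ B₂) → |V' μ x| ≤ κ₁ (blkX x) * B₁ + κ₂ (blkX x) * B₂)
    (h342_1 : HasMajorant (g := toB6 g R H) blkX Gp (fun a b => B₀ * W a * Real.exp (-(δ₀ * g.dist a b))))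
    (h342_2 : HasMajorantHom (g := toB6 g R H) blkX blkY (D ∘ₗ Gp)
      (fun a b => B₀ * Lw a * Real.exp (-(δ₀ * g.dist a b)))) :
    HasMajorant (g := toB6 g R H) blkX (V' * Gp)
      (fun a b => (κ₁ a * Lw a + κ₂ a * W a) * B₀ * Real.exp (-(δ₀ * g.dist a b))) := by
  intro y' μ B hμ x
  have h1 : ∀ b : Y, blkY b = blkX x →
      |D (Gp μ) b| ≤ B₀ * Lw (blkX x) * Real.exp (-(δ₀ * g.dist (blkX x) y')) * B := by
    intro b hb
    have h := h342_2 y' μ B hμ b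
    simp only [LinearMap.comp_apply] at h
    rw [hb] at h
    exact h
  have h2 : ∀ x' : X, blkX x' = blkX x →
      |Gp μ x'| ≤ B₀ * W (blkX x) * Real.exp (-(δ₀ * g.dist (blkX x) y')) * B := by
    intro x' hx'
    have h := h342_1 y' μ B hμ x'
    simp only [] at h
    rw [hx'] at h
    exact h
  have h := h361 (Gp μ) x _ _ h1 h2
  show |V' (Gp μ) x| ≤ (κ₁ (blkX x) * Lw (blkX x) + κ₂ (blkX x) * W (blkX x)) * B₀ *
      Real.exp (-(δ₀ * g.dist (blkX x) y')) * B
  calc |V' (Gp μ) x| ≤ κ₁ (blkX x) * (B₀ * Lw (blkX x) * Real.exp (-(δ₀ * g.dist (blkX x) y')) * B) +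
        κ₂ (blkX x) * (B₀ * W (blkX x) * Real.exp (-(δ₀ * g.dist (blkX x) y')) * B) := h
    _ = _ := by ring

/-- **(3.63) p. 402 from (3.61) and (3.42)₁,₂** — *"and the operator V′(A)G′(U) satisfies the bound |(V′(A)G′(U)λ)(x)|
≦ O(1)B₀α₁e^{−δ₀d(y,y′)} (3.63) for x∈Δ(y), supp λ ⊂ Δ(y′), or the bound |V′(A)G′(U)λ|_{(y)} ≦ O(1)B₀α₁|λ|_{(y)}. Thus
for α₁ sufficiently small the norm of this operator is small and I − V′(A)G′(U) is an invertible operator, the inverse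
is given by a convergent Neumann series."* (the factor |λ| of (3.42) being implicit in the first form).  TYPED: (3.61)
with O(1) =: c₁′, c₂′ on the block map of (3.42) (hypothesis `h361`, D = ∇_U abstract), entries 1, 2 of (3.42) for G′(U)
(majorants B₀(L^jη)²e^{−δ₀d}, B₀L^jηe^{−δ₀d} at the OUTPUT block, L^jη = `g.len y` > 0) ⟹ V′(A)G′(U) has the block-sup
majorant (c₁′ + c₂′)B₀α₁e^{−δ₀d(y,y′)} — exactly the hypothesis `h363` (θ = κ₀B₀α₁, κ₀ = c₁′ + c₂′) of
`b9_leftEntry_explicit_365` in (e).  So the LEFT entries 1, 2, 4 of (3.42) for G′(U′U) rest on Theorem 3.1 for G′(U),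
the gradient-form bound (3.61), the identity (3.65)₂ and Lemma 2.1 of [4] only; the divergence form of (j)–(l) is
needed for the right entry alone. [cite: Balaban1985BackgroundPropagators, (3.61)–(3.65) p.402, (3.42) p.397] -/
theorem b9_363_of_361 (blkX : X → g.Site) (blkY : Y → g.Site) (δ₀ B₀ α₁ c₁' c₂' : ℝ)
    (hlen : ∀ y : g.Site, 0 < g.len y) {Gp V' : Module.End ℝ (X → ℝ)} {D : (X → ℝ) →ₗ[ℝ] (Y → ℝ)}
    (h361 : ∀ (μ : X → ℝ) (x : X) (B₁ B₂ : ℝ), (∀ b : Y, blkY b = blkX x → |D μ b| ≤ B₁) →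
      (∀ x' : X, blkX x' = blkX x → |μ x'| ≤ B₂) →
      |V' μ x| ≤ c₁' * α₁ * (g.len (blkX x))⁻¹ * B₁ + c₂' * α₁ * (g.len (blkX x) ^ 2)⁻¹ * B₂)
    (h342_1 : HasMajorant (g := toB6 g R H) blkX Gp
      (fun a b => B₀ * g.len a ^ 2 * Real.exp (-(δ₀ * g.dist a b))))
    (h342_2 : HasMajorantHom (g := toB6 g R H) blkX blkY (D ∘ₗ Gp)
      (fun a b => B₀ * g.len a * Real.exp (-(δ₀ * g.dist a b)))) :
    HasMajorant (g := toB6 g R H) blkX (V' * Gp)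
      (fun a b => (c₁' + c₂') * B₀ * α₁ * Real.exp (-(δ₀ * g.dist a b))) := by
  have h := majorant_mul_of_blockNormBound (R := R) (H := H) blkX blkY δ₀ B₀
    (fun y => c₁' * α₁ * (g.len y)⁻¹) (fun y => c₂' * α₁ * (g.len y ^ 2)⁻¹) (fun y => g.len y ^ 2)
    (fun y => g.len y) h361 h342_1 h342_2
  refine hasMajorant_mono (g := toB6 g R H) blkX h fun a b => le_of_eq ?_
  have ha : g.len a ≠ 0 := (hlen a).ne'
  show (c₁' * α₁ * (g.len a)⁻¹ * g.len a + c₂' * α₁ * (g.len a ^ 2)⁻¹ * g.len a ^ 2) * B₀ *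
      Real.exp (-(δ₀ * (toB6 g R H).dist a b)) = (c₁' + c₂') * B₀ * α₁ * Real.exp (-(δ₀ * (toB6 g R H).dist a b))
  have h2 : g.len a ^ 2 ≠ 0 := pow_ne_zero 2 ha
  field_simp

/-- **Entries 1, 2, 4 of (3.42) for G′(U′U) from PRINTED-SHAPE inputs only** (assembly of `b9_363_of_361` with (e)
`b9_leftEntry_explicit_365`): a left entry E (E = 1, ∇_U, Δ_U with weight P = (L^jη)², L^jη, 1) of G′(U) with majorant
B₀P(y)e^{−δ₀d} (`h342E`), entries 1, 2 of (3.42) for G′(U) (`h342_1`, `h342_2`), the gradient-form bound (3.61) with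
constants c₁′, c₂′ (`h361`), the identity (3.65)₂ G′(U′U) = G′(U) + G′(U′U)V′(A)G′(U) (`h365`), Lemma 2.1 of [4] at the
exponent α and α₁ ≦ a₁ := (2(c₁′ + c₂′)B₀c₁(α))^{−1} give |(EG′(U′U)λ)(v)| ≦ 2B₀c₁(α)P(y)e^{−(1−α)δ₀d(y,y′)}|λ| —
Theorem 3.4's *"we can prove all the statements (3.42)–(3.47) of Theorem 3.1 for the operator G′(U′U), of course with
different constants"* (p. 403) for the left sup-entries, with a₁ depending on d, L only through B₀, δ₀, c₁(α), c₁′, c₂′.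
[cite: Balaban1985BackgroundPropagators, Thm 3.4 p.400, (3.61)–(3.65) p.402, p.403 l.1–9; Balaban1984PropagatorsII, (2.66) p.234] -/
theorem b9_leftEntry_of_361_365 [Fintype X] [DecidableEq X] {Z : Type} [Fintype Z] [DecidableEq Z]
    (blkX : X → g.Site) (blkY : Y → g.Site) (blkZ : Z → g.Site) (d : ℕ) (δ₀ α B₀ α₁ c₁' c₂' : ℝ) (P : g.Site → ℝ)
    (hB₀ : 0 < B₀) (hc' : 0 < c₁' + c₂') (hα₁ : 0 ≤ α₁) (hP : ∀ y, 0 ≤ P y) (hαδ : 0 ≤ (1 - α) * δ₀)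
    (hc₁ : 0 < B6.c1 d δ₀ α) (hlen : ∀ y : g.Site, 0 < g.len y)
    (htri : Triangle254 (toB6 g R H)) (hrefl : ∀ y : g.Site, g.dist y y = 0)
    (hdnn : ∀ y y' : g.Site, 0 ≤ g.dist y y') (h261 : Ineq261 d (toB6 g R H) δ₀ α)
    (h263 : Ineq263 d (toB6 g R H) δ₀ α) (ha₁ : α₁ ≤ (2 * (c₁' + c₂') * B₀ * B6.c1 d δ₀ α)⁻¹)
    {GpU GpExt V' : Module.End ℝ (X → ℝ)} {D : (X → ℝ) →ₗ[ℝ] (Y → ℝ)} {E : (X → ℝ) →ₗ[ℝ] (Z → ℝ)}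
    (h342E : HasMajorantHom (g := toB6 g R H) blkX blkZ (E ∘ₗ GpU)
      (fun a b => B₀ * P a * Real.exp (-(δ₀ * g.dist a b))))
    (h342_1 : HasMajorant (g := toB6 g R H) blkX GpU
      (fun a b => B₀ * g.len a ^ 2 * Real.exp (-(δ₀ * g.dist a b))))
    (h342_2 : HasMajorantHom (g := toB6 g R H) blkX blkY (D ∘ₗ GpU)
      (fun a b => B₀ * g.len a * Real.exp (-(δ₀ * g.dist a b))))
    (h361 : ∀ (μ : X → ℝ) (x : X) (B₁ B₂ : ℝ), (∀ b : Y, blkY b = blkX x → |D μ b| ≤ B₁) →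
      (∀ x' : X, blkX x' = blkX x → |μ x'| ≤ B₂) →
      |V' μ x| ≤ c₁' * α₁ * (g.len (blkX x))⁻¹ * B₁ + c₂' * α₁ * (g.len (blkX x) ^ 2)⁻¹ * B₂)
    (h365 : GpExt = GpU + GpExt * (V' * GpU)) :
    HasMajorantHom (g := toB6 g R H) blkX blkZ (E ∘ₗ GpExt)
      (fun a b => 2 * B₀ * B6.c1 d δ₀ α * P a * Real.exp (-((1 - α) * δ₀ * g.dist a b))) :=
  b9_leftEntry_explicit_365 (R := R) (H := H) blkX blkZ d δ₀ α (c₁' + c₂') B₀ α₁ P hB₀ hc' hα₁ hP hαδ hc₁ htri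
    hrefl hdnn h261 h263 ha₁ h342E
    (by simpa only [mul_comm, mul_left_comm, mul_assoc] using
      b9_363_of_361 (R := R) (H := H) blkX blkY δ₀ B₀ α₁ c₁' c₂' hlen h361 h342_1 h342_2)
    h365

end B9Side363

end Literature.MathematicalPhysics.QuantumFieldTheory.Balaban1983to89.B6RandomWalkHom
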